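import Literature.MathematicalPhysics.QuantumFieldTheory.Balaban1983to89.Beta.AxialProjector
import Literature.MathematicalPhysics.QuantumFieldTheory.Balaban1983to89.Beta.OneStepResolventKernel
import Literature.MathematicalPhysics.QuantumFieldTheory.Balaban1983to89.Beta.KernelWard
import Literature.MathematicalPhysics.QuantumFieldTheory.Balaban1983to89.Beta.OneStepKernelFamily

/-!
# `Balaban1983to89.Beta.AxialDressing` — route (α) of RULING (R29), item (A2): the DRESSING FUNCTOR `JetData.dress`
# (the transpose projector `Πᵀ = AxialProjector.coProj` applied to the stencil bond slot and to both `inl`-legs of every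
# kernel table), with the localisation bookkeeping `LocStencil`/`VertexFamily₂ ↦` same rate, explicit `N`-dependent constant;
# (v1.1) the whole-lattice ℓ¹ ADJUNCTION `Σ'⟨A, Πᵀg⟩ = Σ'⟨ΠA, g⟩` and its kernel-leg / bond-slot forms (`Γ_tree = Π Γ Πᵀ`, `ℋ_tree = Π ℋ`)
# (v1.2) the TADPOLE HALF of the dressing lemma assembled: `tadpole KInv (Πᵀ W Πᵀ) = tadpole (Π KInv Π) W`
# (v1.3) the BUBBLE HALF and the ASSEMBLED DRESSING LEMMA `TOf (dress J) = hessKer (Π KInv Π) V^Π J.W` (localisation-only)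
# (v1.4) the same over an ARBITRARY decaying resolvent `K` (`hessKer_dress`) and for the STEP kernels `TstepOf Lc j (dress J)` /
# the wall family `TbalOf Lc (fun j ↦ dress (Js j))` (decimated composite resolvent `KInvStep Lc j`, chain-rule vertex `vertexOfK`; every `j`)

HONEST FRAMING (cell `pub-balaban`, β-function road; verbatim): «discharging BetaPertH makes Balaban's UV stability UNCONDITIONAL —
a real constructive-QFT result; it is NOT the continuum limit and NOT the Clay problem.»  ABSOLUTE RULE (verbatim): «No
internally-minted statement may enter as a cited fact. Every hypothesis is either kernel-proved in this package or a verbatim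
quotation of a PUBLISHED theorem with page reference. The manuscript(s) under audit are NOT citable for their own disputed steps —
they are the thing under adjudication; programme-internal (2001/route/tribunal) claims are never citable.»  This file cites NOTHING
and quotes nothing: every declaration is a definition or a kernel-checked estimate about definitions ([folklore] throughout); no
`Prop` mirrors a printed claim; the printed sentences it serves (B12 (1.22) read over Bałaban's block-tree axial gauge, B10 p.258 (9),
with the residual group `G₀ = {u : u(y) = 1 at centres}`, B12 p.254) are quoted verbatim in `Beta.GaugeFixing` / `Beta.AveragingContours`
and enter here as LOCATORS only.

WHAT THIS IS.  RULING (R29) + the β-lead's ANSWER of 2026-08-19T16:09:12Z fix route (α): the completed one-loop family is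
`TbalOf Lc (JsBal N Lc)` with `JsBal N Lc := dress (JsBal⁰ N Lc)` — SAME type `JetData 3 Lc`, the typed weak-Landau resolvent `KInv`
KEPT, and the change of slice (weak-Landau → block-tree axial, unipotent: `Beta.TreeSliceUnipotent`) carried by the JETS: «weights
through `ℋ_tree = Π·ℋ_N` AND both kernel legs by `Πᵀ` — same `Π`, no mixture; dressing = one final functor».  By the adjunction
`AxialProjector.sum_coProj_mul` (`⟨Πᵀg, A⟩ = ⟨g, ΠA⟩`), putting `Π` on the contravariant objects (`Γ_tree = ΠΓΠᵀ`, `ℋ_tree = Πℋ`;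
`GaugeFixingPropagators.kktInv_sliceChange`, an5 `SliceComposition`) is the same as putting `Πᵀ := AxialProjector.coProj N` on the
covariant jets: on the bond slot `(κ′, u)` of the stencil family (contracted against the `ℋ`-column in `vertexOf`) and on each
`inl`-leg `(x, inl α)` of every kernel table (contracted against `KInv` in `hessKer`); multiplier legs `inr` are untouched
(`diag(Π, 1)`).  THIS LEAF TYPES THAT FUNCTOR and its estimates:

* §1 `legCo₁ N K`, `legCo₂ N K` (Πᵀ on the first / second `inl`-leg of `K : MKer (d+1) (Fib d)`), `dressK N := legCo₂ N ∘ legCo₁ N`;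
  `inl`/`inr` computation rules.  §1b `coProj_map` (`Πᵀ` commutes with additive maps), `legCo_comm` (THE TWO LEG DRESSINGS COMMUTE —
  `Πᵀ ⊗ 1` and `1 ⊗ Πᵀ`), `legCo₂_eq_transpose`, `dressK_antisymm` (the stripping-convention antisymmetry `K y x b a = −K x y a b` of
  `Beta/StepJetData` §5 SURVIVES the dressing).
* §2 geometry of «near»: `l1_sub_le_of_blk_eq` (same block ⇒ `ℓ¹`-distance `≤ (d+1)·N`), `l1_sub_le_of_near` (block or incoming
  bond ⇒ `≤ (d+1)·N + 1`), `exp_recenter_le`.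
* §3 LOCALISATION IS PRESERVED, leg by leg: `biLoc_legCo₁`, `biLoc_legCo₂`, `biLoc_dressK` — `BiLoc K p q C δ ⇒ BiLoc (dressK N K) p q
  (cN² · C) δ` with `cN := (1 + 2(d+1)N^{d+1})·exp(δ((d+1)N+1))` (from `AxialProjector.abs_coProj_le`: `Πᵀ` bounded of range one
  block).
* §4 THE BOND SLOT: `coProj_eval` (evaluation at a kernel entry commutes with `Πᵀ` on `MKer`-valued bond families) and
  `locStencil_coProj : LocStencil S Cs δ → LocStencil (coProj N S) (cN′·Cs) δ`, `cN′ := (1 + 2(d+1)N^{d+1})·exp(2δ((d+1)N+1))`.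
* §4b COARSE-TRANSLATION COVARIANCE: `cod_shift`, `inPath_shift`, `subtreeSum_shift`, `coProj_shift` (the transpose of
  `AxialProjector.axProj_shift`), `coProj_shiftK`, `legCo₁_shiftK`/`legCo₂_shiftK`/`dressK_shiftK`, and the SOCKETS `dressS_translate`
  (`covS` shape of `BalabanStepJets.S0_translate` survives: `S κ (u+N•t) = shiftK (−N•t) (S κ u)` ⇒ same for `dressK N (Πᵀ S κ u)`),
  `dressW_translate` (`BlockCovariant.covW` shape survives).
* §5 `JetData.dress (J : JetData d N) : JetData d N` — `S ↦ dressK N (coProj N S κ u)`, `W ↦ dressK N (W μ y ν y′)`, same rate `δ`,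
  constants as above — and `TdressOf J := TOf (dress J)` (the route-(α) COMPLETED typed kernel of a jet datum, by DEFINITION of the
  route; no identification with print is asserted here).
* §6 (v1.1) THE ℓ¹ ADJUNCTION ON THE WHOLE LATTICE (the analytic half of the dressing lemma, leg by leg): `blockMass`
  (block-constant majorant), `summable_comp_blk` (a summable coarse function read through `blk` is summable: fibres have `L^n`
  points), `summable_treeGauge` / `summable_axProj` (the tree integral and `Π A` of a summable `A` are summable), `tsum_cod_mul`
  (summation by parts `Σ' dᵀg·T = Σ' g·grad T`, `KKTFluctuationEnergy.tsum_shift`), `tsum_sum_mul_subtreeSum` (the correction term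
  re-summed over endpoints, block by block via `KKTFluctuationEnergy.tsum_blocks` and `AxialProjector.treeGauge_eq_sum_inPath`), and
  **`tsum_mul_coProj : (∀ κ, Summable (A κ)) → (∀ κ y, |g κ y| ≤ M) → Σ'_y Σ_κ A_κ(y)·(Πᵀg)_κ(y) = Σ'_y Σ_κ (ΠA)_κ(y)·g_κ(y)`**
  (+ `tsum_coProj_mul`, `sum_tsum_mul_coProj`) — the `tsum` form of `AxialProjector.sum_coProj_mul`: A SUMMABLE column against a
  BOUNDED leg, no finite-support hypothesis.
* §7 (v1.1) KERNEL-LEG AND BOND-SLOT FORMS: `legAx₁`/`legAx₂` (`Π = axProj` on the first / second `inl` leg of a kernel table, the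
  contravariant twin of `legCo₁`/`legCo₂`), **`comp_legCo₁ : comp A (legCo₁ N K) x z a b = comp (legAx₂ N A) K x z a b`** (summable
  `A`-row, bounded `K`-column) and **`comp_legCo₂ : comp (legCo₂ N K) A x z a b = comp K (legAx₁ N A) x z a b`**, i.e. inside every
  `ExpKernelCalculus.comp` the dressing moves from the jet leg onto the resolvent leg (`Γ_tree = Π Γ Πᵀ` entrywise); and
  **`vertexOf_coProj : vertexOf (coProj N S) μ y x z a b = Σ_{κ′} wsum (Π ℋ-column)(κ′) (S κ′) x z a b`** for a local stencil family
  (`ℋ_tree = Π ℋ` at the bond slot; summability of the `ℋ`-column from `KernelSpecInstance.decay_wH` +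
  `DecimatedMomentLimit.summable_of_decay510`).
* §8 (v1.2) THE TADPOLE HALF OF THE DRESSING LEMMA, ASSEMBLED: `axDressK N A := legAx₁ N (legAx₂ N A)` (`Π A Π`),
  `summable_row_of_decays` / `summable_col_of_decays`, `abs_legAx₁_le` / `abs_legAx₂_le` / `bdd_axDressK` (constant
  `(1 + 2(d+1)N)` per leg, `KernelWard.Bdd`), `summable_legAx₂_col` (Π on the second leg keeps first-leg summability: the correction
  is a finite sum of columns over the block-tree path sites), the product majorants `prodBound_bdd_biLoc` / `prodBound_biLoc_bdd`, and
  **`tadpole_dressK : Decays A C δ → 0 < δ → BiLoc K p q Ck δk → 0 < δk → tadpole A (dressK N K) = tadpole (axDressK N A) K`**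
  (chain `comp_legCo₁` → trace cyclicity `KernelWard.tr_comp_comm_of_bound` BY NAME → `comp_legCo₂` → cyclicity back), with the
  `JetData` corollary **`tadpole_dress_W : tadpole KInv ((dress J).W μ y ν y′) = tadpole (axDressK N KInv) (J.W μ y ν y′)`**
  (`OneStepResolventKernel.decays_KInv`, `J.loc₂`).
* §9 (v1.3) THE BUBBLE HALF AND THE ASSEMBLED DRESSING LEMMA (route (α), (R29-5); localisation-only hypotheses — `Decays` / `BiLoc` /
  `LocStencil`, NO finite support).  §9a `Π`/`Πᵀ` pass through pointwise-summable series and finite linear combinations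
  (`coProj_tsum`, `axProj_tsum`, `coProj_finset_sum`, `axProj_finset_sum`, `coProj_mul_left`, …); §9b so do the leg maps
  (`legCo₁_tsum`, `legCo₂_tsum`, `legAx₁_tsum`, `dressK_tsum`, `dressK_mul_left`, `dressK_finset_sum`), whence the OUTWARD EXCHANGES
  **`comp_legCo₂_out : comp A (legCo₂ N K) = legCo₂ N (comp A K)`**, **`legAx₁_comp : legAx₁ N (comp B K) = comp (legAx₁ N B) K`** and
  `legAx₁_legCo₂_comm` (Π on leg 1 commutes with Πᵀ on leg 2); §9c the `Π`-legged resolvents DECAY at the same rate: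
  `decays_legAx₁` / `decays_legAx₂` / **`decays_axDressK : Decays A C δ → Decays (axDressK N A) (cAx²·C) δ`**,
  `cAx := (1 + 2(d+1)N)·exp(δ((d+1)N+1))`, and `summable_row_of_biLoc` / `summable_col_of_biLoc`; §9d **`vertexOf_dressK :
  vertexOf (dressK ∘ T) μ y = dressK N (vertexOf T μ y)`** (local stencil family; the leg dressings pass under the `u`-series, absolutely
  convergent by `KernelSpecInstance.decay_wH`), the named `Π`-DRESSED CHAIN-RULE VERTEX **`axVertexOf S μ y := Σ_{κ′} wsum ((Π ℋ-column) κ′)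
  (S κ′)`** (= §7's `vertexOf_coProj` right-hand side: `vertexOf_coProj_eq`), `vertexFamily_axVertexOf'` (it is a vertex family) and
  **`vertexOf_dress_S : vertexOf (dress J).S μ y = dressK N (axVertexOf J.S μ y)`**; §9e **`bubble_dressK : Decays A C δ → 0 < δ →
  BiLoc V p p′ Cv δv → BiLoc V′ q q′ Cv′ δv → 0 < δv → bubble A (dressK N V) (dressK N V′) = bubble (axDressK N A) V V′`** (chain, NO
  associativity: `comp_legCo₂_out` + `comp_legCo₁`, entrywise `comp_legCo₂` under the trace, `legAx₁_legCo₂_comm` + `legAx₁_comp`,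
  cyclicity `KernelWard.tr_comp_comm_bb` BY NAME, the same two moves again, cyclicity back; all rates unified to `min δ δv` first) and
  THE ASSEMBLED STATEMENT **`TOf_dress : TOf (dress J) = hessKer (axDressK N KInv) (axVertexOf J.S) J.W`** (+ `TOf_dress'` with
  `vertexOf (coProj N J.S)`, `TdressOf_eq_hessKer`) — sign convention of `ExpKernelCalculus.hessKer` unchanged:
  `hessKer A V W μ ν z = ½·tadpole A (W μ 0 ν z) − ½·bubble A (V μ 0) (V ν z)`; the dressing is applied ONCE per jet datum (`dress`
  is a functor on `JetData d N`; the composite family of the cell is the literal `JsBal N Lc := fun j ↦ dress (JsBal⁰ N Lc j)`).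
* §10 (v1.4; lead PRECISION (P1′), journal 2026-08-19T17:50:29Z) THE DRESSING LEMMA FOR THE STEP KERNELS.  The wall reads the STEP family
  `OneStepKernelFamily.TbalOf Lc Js j = TstepOf Lc j (Js j) = hessKer (KInvStep Lc j) (vertexOfK (KInvStep Lc j) Lc (Js j).S) (Js j).W` — the
  DECIMATED composite resolvent `KInvStep Lc j = dec (Lc^j) (KInv (Lc^(j+1)))` and the chain-rule vertex through ITS `ℋ`-column
  (`OneStepKernelFamily.colH` / `vertexOfK`) — so §9's `TOf_dress` (resolvent `KInv N`, vertex `vertexOf`) is the `j = 0` / one-shot instance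
  only (an4 `HessianTelescopingKKT.kInvStep_zero` / `tbalOf_zero`).  §10 transcribes §9d with the weights `colH K` of an ARBITRARY decaying `K`
  in place of the `wH`-column: `summable_colH_mul_stencil` (`OneStepKernelFamily.abs_colH_le`), **`vertexOfK_dressK : vertexOfK K N (dressK ∘ T)
  μ y = dressK N (vertexOfK K N T μ y)`**, the named vertex **`axVertexOfK K N S μ y := Σ_{κ′} wsum (axProj N (colH K N μ y) κ′) (S κ′)`**
  (`axVertexOfK_KInv : axVertexOfK (KInv N) N S = axVertexOf S` entrywise), the bond-slot adjunction through `K` **`vertexOfK_coProj(_eq) :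
  vertexOfK K N (coProj N S) μ y = axVertexOfK K N S μ y`** (§6's `sum_tsum_mul_coProj` with the summable side `colH K`,
  `summable_col_of_decays`), `vertexFamily_axVertexOfK'` (via `OneStepKernelFamily.vertexFamily_vertexOfK'` + `locStencil_coProj`),
  `vertexOfK_dress_S`, and the GENERIC ASSEMBLED STATEMENT **`hessKer_dress : Decays K C δ → 0 < δ → hessKer K (vertexOfK K N (dress J).S)
  (dress J).W = hessKer (axDressK N K) (axVertexOfK K N J.S) J.W`** (halves `tadpole_dressK` §8 / `bubble_dressK` §9e, both already generic in
  `A`), whence **`TstepOf_dress : TstepOf Lc j (dress J) = hessKer (axDressK Lc (KInvStep Lc j)) (axVertexOfK (KInvStep Lc j) Lc J.S) J.W`**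
  (`OneStepKernelFamily.decays_KInvStep`) and, member by member for ANY `Js : ℕ → JetData 3 Lc`, **`TbalOf_dress : TbalOf Lc (fun j ↦ dress
  (Js j)) j = hessKer (axDressK Lc (KInvStep Lc j)) (axVertexOfK (KInvStep Lc j) Lc (Js j).S) (Js j).W`** — the sentence the wall needs at
  EVERY `j`; `hessKer_dress_KInv` records the consistency with `TOf_dress`.  Localisation only; no finite support; no new import but
  `Beta.OneStepKernelFamily` (an4 lineage, for `KInvStep` / `colH` / `vertexOfK` / `TstepOf` / `TbalOf`, BY NAME).

DICTIONARY WITH THE FINITE-DIMENSIONAL MODEL (an5 `Beta.SliceComposition` p191120, object ↦ object; the (A3) sentence, recorded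
here so the tree carries it): slice rows `P` ↦ the block-tree axial rows τ_tree (`AveragingContours` comb / `AxialProjector.InPath`);
gauge generator `W` at `B = 0` ↦ `grad` on `{λ : λ|base = 0}`; `(P W)⁻¹` ↦ tree integration `A ↦ treeGauge A L` (unipotent:
`TreeSliceUnipotent.abs_linearMapDet_eq_one_of_comb_formula`, BY NAME); `1 − W (P W)⁻¹ P` ↦ `axProj L` (`AxialProjector.axProj_apply`,
`rfl`) and its transpose on jets ↦ `coProj L`; `SliceComposition.toCols₁_minOp_sliceChange` ↦ `vertexOf_coProj` (§7);
`SliceComposition.blocks_comp_sliceChange` (`Π(·)Πᵀ`) ↦ `comp_legCo₁` / `comp_legCo₂` (§7), `tadpole_dressK` (§8), `bubble_dressK` and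
`TOf_dress` (§9), `hessKer_dress` / `TstepOf_dress` (§10, any decaying resolvent / the step resolvents); the
hypotheses `K W = 0`, `Kᵀ W = 0`, `Q W = 0` ↦ the lead's (R29-9) ladder (D-i), order 0 typed, order ≥ 1 an1/an3 certificates.

WHAT IS NOT HERE.  (a) no tree-independence / reflection lemma (CHECK ITEM (D-h′): hR for the dressed family goes through
`TreeSliceUnipotent` for the tree and its reflection + pv25 II′, later on the P5′ road; this leaf dresses by ONE tree, the comb rooted at
the block base point with axis order `0 < 1 < … < d`); (b) hierarchical trees (A4); (c) the bridge to an1's node 11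
`AveragingAxialDictionary` is `AxialProjector.axProj_apply` (`rfl`), not restated; (d) no identification of `TOf (dress J)` with a
printed kernel is asserted, nor of `TstepOf Lc j (dress J)` (the (D-i) order-0/1 certificates are the lead's ladder, BY NAME elsewhere; the
step jets `JsBal⁰ N Lc j`, `j ≥ 1`, are NOT constructed here — work-order (P3)); (e) NOT continuum; NOT Clay.
[v1.2's item (a), the bubble half and the assembled `TOf (dress J) = hessKer (Π KInv Π) V^Π J.W`, is §9 of v1.3 — proved WITHOUT the
associativity moves foreseen there.]

Provenance: b2b-balaban β sub-cell, unit beta-an2 gen 9 (node AXPROJ / (A2)), 2026-08-19 (v1; v1.1 = + §6/§7; v1.2 = + §8, the same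
day), gen 10 (v1.3 = + §9; v1.4 = + §10 and the import `Beta.OneStepKernelFamily`, 2026-08-19); earlier declarations byte-identical at
each step; over `Beta.AxialProjector` v1.1, `Beta.OneStepResolventKernel`, the an2-lineage `Beta.KernelWard` (Fubini bricks, BY NAME) and
(v1.4) the an4-lineage `Beta.OneStepKernelFamily`.
-/

open Finset
open scoped BigOperators
open Literature.MathematicalPhysics.QuantumFieldTheory
open Literature.MathematicalPhysics.QuantumFieldTheory.Balaban1983to89
open Literature.MathematicalPhysics.QuantumFieldTheory.Balaban1983to89.Beta
open B12Sec2to5 (l1 l1_nonneg Decay510)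
open ExpKernelCalculus (BiLoc Decays VertexFamily₂ l1_sub_triangle l1_sub_symm summable_exp_shift summable_exp_shift')
open KernelWard (Bdd bdd_of_decays bdd_of_biLoc tr_comp_comm_of_bound)
open AffineAveraging (Form0 Form1 unitVec unitVec_apply box toSite)
open AveragingContours (blk off blk_block blk_add_off off_mem_box treeGauge grad)
open AxialProjector (axProj axProj_apply coProj coProj_apply subtreeSum cod InPath treeGauge_eq_sum_inPath abs_cod_le abs_coProj_le
  abs_axProj_le zsmul_blk_le lt_zsmul_blk_add)
open OneStepResolventKernel (Fib LocStencil JetData TOf wsum vertexOf KInv decays_KInv)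
open KernelSpecInstance (wH decay_wH)
open KKTFluctuationEnergy (tsum_blocks summable_blocks tsum_shift summable_shift summable_mul_of_bdd summable_mul_of_bdd')
open DecimatedMomentLimit (summable_of_decay510)
open OneStepKernelFamily (colH abs_colH_le vertexOfK vertexOfK_KInv vertexFamily_vertexOfK' KInvStep decays_KInvStep TstepOf TbalOf)

namespace Literature.MathematicalPhysics.QuantumFieldTheory.Balaban1983to89.Beta.AxialDressing

variable {d : ℕ}

/-! ## §1 The leg dressings `legCo₁`, `legCo₂`, `dressK` -/

section Legs

/-- [folklore] `Πᵀ` on the FIRST leg of a kernel table: for `a = inl α` the bond family `(α′, x′) ↦ K x′ y (inl α′) b` is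
dressed by `AxialProjector.coProj N`; multiplier legs `a = inr _` are untouched (`diag(Πᵀ, 1)`). -/
noncomputable def legCo₁ (N : ℕ) (K : ExpKernelCalculus.MKer (d + 1) (Fib d)) : ExpKernelCalculus.MKer (d + 1) (Fib d) :=
  fun x y a b =>
    match a with
    | Sum.inl α => coProj N (fun α' x' => K x' y (Sum.inl α') b) α x
    | Sum.inr _ => K x y a b

/-- [folklore] `Πᵀ` on the SECOND leg of a kernel table. -/
noncomputable def legCo₂ (N : ℕ) (K : ExpKernelCalculus.MKer (d + 1) (Fib d)) : ExpKernelCalculus.MKer (d + 1) (Fib d) :=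
  fun x y a b =>
    match b with
    | Sum.inl β => coProj N (fun β' y' => K x y' a (Sum.inl β')) β y
    | Sum.inr _ => K x y a b

/-- [folklore] **THE KERNEL DRESSING** `K ↦ Πᵀ-on-leg-2 (Πᵀ-on-leg-1 K)` (`diag(Πᵀ,1) · K · diag(Πᵀ,1)ᵀ` in matrix terms). -/
noncomputable def dressK (N : ℕ) (K : ExpKernelCalculus.MKer (d + 1) (Fib d)) : ExpKernelCalculus.MKer (d + 1) (Fib d) :=
  legCo₂ N (legCo₁ N K)

/-- [folklore] Computation rule, first leg, field component. -/
theorem legCo₁_inl (N : ℕ) (K : ExpKernelCalculus.MKer (d + 1) (Fib d)) (x y : Fin (d + 1) → ℤ) (α : Fin (d + 1))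
    (b : Fib d) : legCo₁ N K x y (Sum.inl α) b = coProj N (fun α' x' => K x' y (Sum.inl α') b) α x := rfl

/-- [folklore] Computation rule, first leg, multiplier component (untouched). -/
theorem legCo₁_inr (N : ℕ) (K : ExpKernelCalculus.MKer (d + 1) (Fib d)) (x y : Fin (d + 1) → ℤ) (m : Fin (d + 1))
    (b : Fib d) : legCo₁ N K x y (Sum.inr m) b = K x y (Sum.inr m) b := rfl

/-- [folklore] Computation rule, second leg, field component. -/
theorem legCo₂_inl (N : ℕ) (K : ExpKernelCalculus.MKer (d + 1) (Fib d)) (x y : Fin (d + 1) → ℤ) (a : Fib d)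
    (β : Fin (d + 1)) : legCo₂ N K x y a (Sum.inl β) = coProj N (fun β' y' => K x y' a (Sum.inl β')) β y := rfl

/-- [folklore] Computation rule, second leg, multiplier component (untouched). -/
theorem legCo₂_inr (N : ℕ) (K : ExpKernelCalculus.MKer (d + 1) (Fib d)) (x y : Fin (d + 1) → ℤ) (a : Fib d)
    (m : Fin (d + 1)) : legCo₂ N K x y a (Sum.inr m) = K x y a (Sum.inr m) := rfl

/-- [folklore] The dressing does not touch the multiplier–multiplier block. -/
theorem dressK_inr_inr (N : ℕ) (K : ExpKernelCalculus.MKer (d + 1) (Fib d)) (x y : Fin (d + 1) → ℤ) (m m' : Fin (d + 1)) :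
    dressK N K x y (Sum.inr m) (Sum.inr m') = K x y (Sum.inr m) (Sum.inr m') := rfl

end Legs

/-! ## §1b `Πᵀ` commutes with additive maps; the two leg dressings commute; antisymmetry survives -/

section Maps

variable {n : ℕ} {R R' : Type*} [AddCommGroup R] [AddCommGroup R']

/-- [folklore] `Πᵀ` COMMUTES WITH ADDITIVE MAPS applied pointwise: `Πᵀ (φ ∘ g) = φ ∘ Πᵀ g` (it is a finite `ℤ`-linear
combination of values of `g`). -/
theorem coProj_map (L : ℕ) (φ : R →+ R') (g : Form1 n R) (α : Fin n) (q : Fin n → ℤ) :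
    coProj L (fun κ u => φ (g κ u)) α q = φ (coProj L g α q) := by
  simp only [coProj_apply, subtreeSum, cod, map_sub, map_sum]
  congr 1
  refine Finset.sum_congr rfl fun c _ => ?_
  rw [apply_ite (⇑φ), map_zero, map_sum]
  simp only [map_sub]

/-- [folklore] `Πᵀ (−g) = −Πᵀ g`. -/
theorem coProj_neg' (L : ℕ) (g : Form1 n R) : coProj L (-g) = -coProj L g := by
  have h := AxialProjector.coProj_sub L 0 g
  rwa [zero_sub, AxialProjector.coProj_zero, zero_sub] at h

/-- [folklore] Evaluation of a bond family at a bond, as an additive map. -/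
def evHom (β : Fin n) (y : Fin n → ℤ) : Form1 n R →+ R where
  toFun h := h β y
  map_zero' := rfl
  map_add' _ _ := rfl

/-- [folklore] `Πᵀ` as an additive endomorphism of bond families. -/
def coProjHom (L : ℕ) : Form1 n R →+ Form1 n R where
  toFun := coProj L
  map_zero' := AxialProjector.coProj_zero L
  map_add' := AxialProjector.coProj_add L

end Maps

section Comm

/-- [folklore] **THE TWO LEG DRESSINGS COMMUTE** (`Πᵀ ⊗ 1` and `1 ⊗ Πᵀ` act on different legs): `legCo₂ ∘ legCo₁ =
legCo₁ ∘ legCo₂`. -/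
theorem legCo_comm (N : ℕ) (K : ExpKernelCalculus.MKer (d + 1) (Fib d)) : legCo₂ N (legCo₁ N K) = legCo₁ N (legCo₂ N K) := by
  funext x y a b
  cases a with
  | inr m =>
    cases b with
    | inr m' => rfl
    | inl β => rfl
  | inl α =>
    cases b with
    | inr m' => rfl
    | inl β =>
      let k : Form1 (d + 1) (Form1 (d + 1) ℝ) := fun α' x' β' y' => K x' y' (Sum.inl α') (Sum.inl β')
      have h1 : (fun β' y' => legCo₁ N K x y' (Sum.inl α) (Sum.inl β')) = coProj N k α x := by
        funext β' y'
        exact coProj_map N (evHom β' y') k α x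
      have h2 : (fun α' x' => legCo₂ N K x' y (Sum.inl α') (Sum.inl β)) =
          fun α' x' => evHom β y (coProjHom N (k α' x')) := rfl
      show coProj N (fun β' y' => legCo₁ N K x y' (Sum.inl α) (Sum.inl β')) β y =
        coProj N (fun α' x' => legCo₂ N K x' y (Sum.inl α') (Sum.inl β)) α x
      rw [h1, h2, coProj_map N (evHom β y) (fun α' x' => coProjHom N (k α' x')) α x, coProj_map N (coProjHom N) k α x]
      rfl

/-- [folklore] The second-leg dressing is the first-leg dressing of the transposed table. -/
theorem legCo₂_eq_transpose (N : ℕ) (K : ExpKernelCalculus.MKer (d + 1) (Fib d)) (x y : Fin (d + 1) → ℤ) (a b : Fib d) :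
    legCo₂ N K x y a b = legCo₁ N (fun x' y' a' b' => K y' x' b' a') y x b a := by
  cases b with
  | inl β => rfl
  | inr m => rfl

/-- [folklore] The first-leg dressing is odd. -/
theorem legCo₁_neg_apply (N : ℕ) (K : ExpKernelCalculus.MKer (d + 1) (Fib d)) (x y : Fin (d + 1) → ℤ) (a b : Fib d) :
    legCo₁ N (fun x' y' a' b' => -K x' y' a' b') x y a b = -legCo₁ N K x y a b := by
  cases a with
  | inr m => rfl
  | inl α =>
    show coProj N (-fun α' x' => K x' y (Sum.inl α') b) α x = -coProj N (fun α' x' => K x' y (Sum.inl α') b) α x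
    rw [coProj_neg']
    rfl

/-- [folklore] **ANTISYMMETRY ON THE PACKED FIBRE SURVIVES THE DRESSING** (the stripping convention of `Beta/StepJetData` §5:
`K y x b a = −K x y a b`): both legs are dressed by the same `Πᵀ`, and the two dressings commute. -/
theorem dressK_antisymm (N : ℕ) {K : ExpKernelCalculus.MKer (d + 1) (Fib d)} (hK : ∀ x y a b, K y x b a = -K x y a b)
    (x y : Fin (d + 1) → ℤ) (a b : Fib d) : dressK N K y x b a = -dressK N K x y a b := by
  have hT : (fun x' y' a' b' => K y' x' b' a') = fun x' y' a' b' => -K x' y' a' b' := by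
    funext x' y' a' b'
    exact hK x' y' a' b'
  have h2 : (fun x' y' a' b' => legCo₁ N K y' x' b' a') = fun x' y' a' b' => -legCo₂ N K x' y' a' b' := by
    funext x' y' a' b'
    rw [legCo₂_eq_transpose, hT, legCo₁_neg_apply, neg_neg]
  show legCo₂ N (legCo₁ N K) y x b a = -legCo₂ N (legCo₁ N K) x y a b
  rw [legCo₂_eq_transpose N (legCo₁ N K) y x b a, h2, legCo₁_neg_apply, legCo_comm]

end Comm

/-! ## §2 Geometry of «near»: ℓ¹-distances inside a block and across an incoming bond -/

section Near

/-- [folklore] Two points of the same `N`-block are at `ℓ¹`-distance `≤ (d+1)·N` (`1 ≤ N`). -/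
theorem l1_sub_le_of_blk_eq {N : ℕ} (hN : 1 ≤ N) {x z : Fin (d + 1) → ℤ} (h : blk N z = blk N x) :
    l1 (x - z) ≤ ((d : ℝ) + 1) * N := by
  unfold l1
  have key : ∀ i : Fin (d + 1), |(((x - z) i : ℤ) : ℝ)| ≤ (N : ℝ) := by
    intro i
    have a1 := zsmul_blk_le hN x i
    have a2 := lt_zsmul_blk_add hN x i
    have b1 := zsmul_blk_le hN z i
    have b2 := lt_zsmul_blk_add hN z i
    rw [h] at b1 b2
    have h4 : |((x - z) i : ℤ)| ≤ (N : ℤ) := by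
      rw [Pi.sub_apply]
      exact abs_le.mpr ⟨by linarith, by linarith⟩
    have h5 : ((|((x - z) i : ℤ)| : ℤ) : ℝ) ≤ (N : ℝ) := by exact_mod_cast h4
    rw [Int.cast_abs] at h5
    exact h5
  calc ∑ i : Fin (d + 1), |(((x - z) i : ℤ) : ℝ)| ≤ ∑ i : Fin (d + 1), (N : ℝ) := Finset.sum_le_sum fun i _ => key i
    _ = ((d : ℝ) + 1) * N := by
        rw [Finset.sum_const, Finset.card_univ, Fintype.card_fin, nsmul_eq_mul]
        push_cast
        ring

/-- [folklore] A point in the block of `x`, or whose `κ`-head is, is at `ℓ¹`-distance `≤ (d+1)·N + 1` from `x` (`1 ≤ N`). -/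
theorem l1_sub_le_of_near {N : ℕ} (hN : 1 ≤ N) {x z : Fin (d + 1) → ℤ} {κ : Fin (d + 1)}
    (h : blk N z = blk N x ∨ blk N (z + unitVec κ) = blk N x) : l1 (x - z) ≤ ((d : ℝ) + 1) * N + 1 := by
  rcases h with h | h
  · have := l1_sub_le_of_blk_eq hN h
    linarith
  · have h1 := l1_sub_le_of_blk_eq hN h
    have h2 : l1 (x - z) ≤ l1 (x - (z + unitVec κ)) + l1 ((z + unitVec κ) - z) := l1_sub_triangle x (z + unitVec κ) z
    -- `ℓ¹(e_κ) = 1` (the count is `StepJetData.l1_unitVec`; computed inline here to keep the import light)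
    have h3 : l1 ((z + unitVec κ) - z) = 1 := by
      rw [add_sub_cancel_left]
      unfold l1
      simp [unitVec_apply, apply_ite abs, Finset.sum_ite_eq', Finset.mem_univ]
    linarith

/-- [folklore] Re-centring an exponential bound across a bounded displacement: if `ℓ¹(x − z) ≤ r` then
`C·e^{−δ(ℓ¹(z−p)+t)} ≤ C·e^{δr}·e^{−δ(ℓ¹(x−p)+t)}` (`0 ≤ C`, `0 ≤ δ`). -/
theorem exp_recenter_le {x z p : Fin (d + 1) → ℤ} {r C δ t : ℝ} (hr : l1 (x - z) ≤ r) (hC : 0 ≤ C) (hδ : 0 ≤ δ) :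
    C * Real.exp (-δ * (l1 (z - p) + t)) ≤ C * Real.exp (δ * r) * Real.exp (-δ * (l1 (x - p) + t)) := by
  have tri : l1 (x - p) ≤ l1 (x - z) + l1 (z - p) := l1_sub_triangle x z p
  rw [mul_assoc, ← Real.exp_add]
  refine mul_le_mul_of_nonneg_left (Real.exp_le_exp.2 ?_) hC
  nlinarith

end Near

/-! ## §3 Localisation is preserved by the leg dressings -/

section LegBounds

/-- [folklore] The dressing constant of one leg: `cN δ := (1 + 2(d+1)·N^{d+1}) · exp(δ((d+1)N + 1))`. -/
noncomputable def cN (d N : ℕ) (δ : ℝ) : ℝ :=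
  (1 + 2 * ((d : ℝ) + 1) * (N : ℝ) ^ (d + 1)) * Real.exp (δ * (((d : ℝ) + 1) * N + 1))

/-- [folklore] `1 ≤ cN`. -/
theorem one_le_cN (d N : ℕ) {δ : ℝ} (hδ : 0 ≤ δ) : 1 ≤ cN d N δ := by
  unfold cN
  have h1 : (1 : ℝ) ≤ 1 + 2 * ((d : ℝ) + 1) * (N : ℝ) ^ (d + 1) := by
    have : (0 : ℝ) ≤ 2 * ((d : ℝ) + 1) * (N : ℝ) ^ (d + 1) := by positivity
    linarith
  have h2 : (1 : ℝ) ≤ Real.exp (δ * (((d : ℝ) + 1) * N + 1)) := Real.one_le_exp (by positivity)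
  nlinarith

/-- [folklore] `0 ≤ cN`. -/
theorem cN_nonneg (d N : ℕ) (δ : ℝ) : 0 ≤ cN d N δ := by
  unfold cN
  positivity

/-- [folklore] **FIRST-LEG DRESSING PRESERVES BI-LOCALISATION:** `BiLoc K p q C δ ⇒ BiLoc (legCo₁ N K) p q (cN·C) δ` (`1 ≤ N`,
`0 ≤ δ`). -/
theorem biLoc_legCo₁ {N : ℕ} (hN : 1 ≤ N) {K : ExpKernelCalculus.MKer (d + 1) (Fib d)} {p q : Fin (d + 1) → ℤ} {C δ : ℝ}
    (h : BiLoc K p q C δ) (hδ : 0 ≤ δ) : BiLoc (legCo₁ N K) p q (cN d N δ * C) δ := by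
  have hC : 0 ≤ C := h.nonneg (Sum.inl 0)
  intro x y a b
  cases a with
  | inr m =>
    rw [legCo₁_inr]
    calc |K x y (Sum.inr m) b| ≤ C * Real.exp (-δ * (l1 (x - p) + l1 (y - q))) := h x y _ b
      _ ≤ cN d N δ * C * Real.exp (-δ * (l1 (x - p) + l1 (y - q))) := by
          have h1 := one_le_cN d N hδ
          have h2 : 0 ≤ C * Real.exp (-δ * (l1 (x - p) + l1 (y - q))) := by positivity
          nlinarith
  | inl α =>
    rw [legCo₁_inl]
    have hM0 : 0 ≤ C * Real.exp (δ * (((d : ℝ) + 1) * N + 1)) * Real.exp (-δ * (l1 (x - p) + l1 (y - q))) := by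
      positivity
    have hM : ∀ (κ : Fin (d + 1)) (z : Fin (d + 1) → ℤ), (blk N z = blk N x ∨ blk N (z + unitVec κ) = blk N x) →
        |K z y (Sum.inl κ) b| ≤ C * Real.exp (δ * (((d : ℝ) + 1) * N + 1)) * Real.exp (-δ * (l1 (x - p) + l1 (y - q))) :=
      fun κ z hz => (h z y _ b).trans (exp_recenter_le (l1_sub_le_of_near hN hz) hC hδ)
    calc |coProj N (fun α' x' => K x' y (Sum.inl α') b) α x|
        ≤ (1 + 2 * ((d + 1 : ℕ) : ℝ) * (N : ℝ) ^ (d + 1)) *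
            (C * Real.exp (δ * (((d : ℝ) + 1) * N + 1)) * Real.exp (-δ * (l1 (x - p) + l1 (y - q)))) :=
          abs_coProj_le N _ α x hM0 hM
      _ = cN d N δ * C * Real.exp (-δ * (l1 (x - p) + l1 (y - q))) := by
          unfold cN
          push_cast
          ring

/-- [folklore] **SECOND-LEG DRESSING PRESERVES BI-LOCALISATION:** `BiLoc K p q C δ ⇒ BiLoc (legCo₂ N K) p q (cN·C) δ`. -/
theorem biLoc_legCo₂ {N : ℕ} (hN : 1 ≤ N) {K : ExpKernelCalculus.MKer (d + 1) (Fib d)} {p q : Fin (d + 1) → ℤ} {C δ : ℝ}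
    (h : BiLoc K p q C δ) (hδ : 0 ≤ δ) : BiLoc (legCo₂ N K) p q (cN d N δ * C) δ := by
  have hC : 0 ≤ C := h.nonneg (Sum.inl 0)
  intro x y a b
  cases b with
  | inr m =>
    rw [legCo₂_inr]
    calc |K x y a (Sum.inr m)| ≤ C * Real.exp (-δ * (l1 (x - p) + l1 (y - q))) := h x y a _
      _ ≤ cN d N δ * C * Real.exp (-δ * (l1 (x - p) + l1 (y - q))) := by
          have h1 := one_le_cN d N hδ
          have h2 : 0 ≤ C * Real.exp (-δ * (l1 (x - p) + l1 (y - q))) := by positivity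
          nlinarith
  | inl β =>
    rw [legCo₂_inl]
    have hM0 : 0 ≤ C * Real.exp (δ * (((d : ℝ) + 1) * N + 1)) * Real.exp (-δ * (l1 (y - q) + l1 (x - p))) := by
      positivity
    have hM : ∀ (κ : Fin (d + 1)) (z : Fin (d + 1) → ℤ), (blk N z = blk N y ∨ blk N (z + unitVec κ) = blk N y) →
        |K x z a (Sum.inl κ)| ≤ C * Real.exp (δ * (((d : ℝ) + 1) * N + 1)) * Real.exp (-δ * (l1 (y - q) + l1 (x - p))) := by
      intro κ z hz
      have h1 := h x z a (Sum.inl κ)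
      rw [add_comm (l1 (x - p)) (l1 (z - q))] at h1
      exact h1.trans (exp_recenter_le (l1_sub_le_of_near hN hz) hC hδ)
    calc |coProj N (fun β' y' => K x y' a (Sum.inl β')) β y|
        ≤ (1 + 2 * ((d + 1 : ℕ) : ℝ) * (N : ℝ) ^ (d + 1)) *
            (C * Real.exp (δ * (((d : ℝ) + 1) * N + 1)) * Real.exp (-δ * (l1 (y - q) + l1 (x - p)))) :=
          abs_coProj_le N _ β y hM0 hM
      _ = cN d N δ * C * Real.exp (-δ * (l1 (x - p) + l1 (y - q))) := by
          unfold cN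
          rw [add_comm (l1 (y - q))]
          push_cast
          ring

/-- [folklore] **THE KERNEL DRESSING PRESERVES BI-LOCALISATION:** `BiLoc K p q C δ ⇒ BiLoc (dressK N K) p q (cN²·C) δ`. -/
theorem biLoc_dressK {N : ℕ} (hN : 1 ≤ N) {K : ExpKernelCalculus.MKer (d + 1) (Fib d)} {p q : Fin (d + 1) → ℤ} {C δ : ℝ}
    (h : BiLoc K p q C δ) (hδ : 0 ≤ δ) : BiLoc (dressK N K) p q (cN d N δ * (cN d N δ * C)) δ :=
  biLoc_legCo₂ hN (biLoc_legCo₁ hN h hδ) hδ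

end LegBounds

/-! ## §4 The bond slot: `Πᵀ` on the `MKer`-valued stencil family -/

section BondSlot

/-- [folklore] Evaluation at a kernel entry commutes with `Πᵀ` on `MKer`-valued bond families:
`(Πᵀ S) κ u x y a b = Πᵀ (fun κ′ u′ ↦ S κ′ u′ x y a b) κ u`. -/
theorem coProj_eval (N : ℕ) (S : Fin (d + 1) → (Fin (d + 1) → ℤ) → ExpKernelCalculus.MKer (d + 1) (Fib d))
    (κ : Fin (d + 1)) (u x y : Fin (d + 1) → ℤ) (a b : Fib d) :
    coProj N S κ u x y a b = coProj N (fun κ' u' => S κ' u' x y a b) κ u := by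
  simp only [coProj_apply, subtreeSum, cod, Pi.sub_apply, Finset.sum_apply]
  congr 1
  refine Finset.sum_congr rfl fun c _ => ?_
  split
  · simp only [Finset.sum_apply, Pi.sub_apply]
  · rfl

/-- [folklore] The dressing constant of the bond slot: `cN' δ := (1 + 2(d+1)·N^{d+1}) · exp(2δ((d+1)N + 1))`. -/
noncomputable def cN' (d N : ℕ) (δ : ℝ) : ℝ :=
  (1 + 2 * ((d : ℝ) + 1) * (N : ℝ) ^ (d + 1)) * Real.exp (2 * δ * (((d : ℝ) + 1) * N + 1))

/-- [folklore] `0 ≤ cN'`. -/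
theorem cN'_nonneg (d N : ℕ) (δ : ℝ) : 0 ≤ cN' d N δ := by
  unfold cN'
  positivity

/-- [folklore] **THE BOND-SLOT DRESSING PRESERVES `LocStencil`:** `LocStencil S Cs δ ⇒ LocStencil (Πᵀ S) (cN'·Cs) δ` (`1 ≤ N`,
`0 ≤ δ`): every stencil read by `(Πᵀ S) κ u` is centred within `ℓ¹`-distance `(d+1)N + 1` of `u`, and there are at most
`1 + 2(d+1)N^{d+1}` of them. -/
theorem locStencil_coProj {N : ℕ} (hN : 1 ≤ N)
    {S : Fin (d + 1) → (Fin (d + 1) → ℤ) → ExpKernelCalculus.MKer (d + 1) (Fib d)} {Cs δ : ℝ}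
    (hS : LocStencil S Cs δ) (hδ : 0 ≤ δ) : LocStencil (coProj N S) (cN' d N δ * Cs) δ := by
  have hC : 0 ≤ Cs := (hS 0 0).nonneg (Sum.inl 0)
  intro κ u x y a b
  rw [coProj_eval]
  have hM0 : 0 ≤ Cs * Real.exp (2 * δ * (((d : ℝ) + 1) * N + 1)) * Real.exp (-δ * (l1 (x - u) + l1 (y - u))) := by
    positivity
  have hM : ∀ (κ' : Fin (d + 1)) (z : Fin (d + 1) → ℤ), (blk N z = blk N u ∨ blk N (z + unitVec κ') = blk N u) →
      |S κ' z x y a b| ≤ Cs * Real.exp (2 * δ * (((d : ℝ) + 1) * N + 1)) * Real.exp (-δ * (l1 (x - u) + l1 (y - u))) := by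
    intro κ' z hz
    have hr : l1 (u - z) ≤ ((d : ℝ) + 1) * N + 1 := l1_sub_le_of_near hN hz
    have tx : l1 (x - u) ≤ l1 (x - z) + l1 (z - u) := l1_sub_triangle x z u
    have ty : l1 (y - u) ≤ l1 (y - z) + l1 (z - u) := l1_sub_triangle y z u
    rw [l1_sub_symm] at hr
    calc |S κ' z x y a b| ≤ Cs * Real.exp (-δ * (l1 (x - z) + l1 (y - z))) := hS κ' z x y a b
      _ ≤ Cs * (Real.exp (2 * δ * (((d : ℝ) + 1) * N + 1)) * Real.exp (-δ * (l1 (x - u) + l1 (y - u)))) := by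
          refine mul_le_mul_of_nonneg_left ?_ hC
          rw [← Real.exp_add]
          exact Real.exp_le_exp.2 (by nlinarith)
      _ = Cs * Real.exp (2 * δ * (((d : ℝ) + 1) * N + 1)) * Real.exp (-δ * (l1 (x - u) + l1 (y - u))) := by ring
  calc |coProj N (fun κ' u' => S κ' u' x y a b) κ u|
      ≤ (1 + 2 * ((d + 1 : ℕ) : ℝ) * (N : ℝ) ^ (d + 1)) *
          (Cs * Real.exp (2 * δ * (((d : ℝ) + 1) * N + 1)) * Real.exp (-δ * (l1 (x - u) + l1 (y - u)))) :=
        abs_coProj_le N _ κ u hM0 hM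
    _ = cN' d N δ * Cs * Real.exp (-δ * (l1 (x - u) + l1 (y - u))) := by
        unfold cN'
        push_cast
        ring

/-- [folklore] `LocStencil` survives the full kernel dressing of every stencil value as well. -/
theorem locStencil_dressK {N : ℕ} (hN : 1 ≤ N)
    {S : Fin (d + 1) → (Fin (d + 1) → ℤ) → ExpKernelCalculus.MKer (d + 1) (Fib d)} {Cs δ : ℝ}
    (hS : LocStencil S Cs δ) (hδ : 0 ≤ δ) :
    LocStencil (fun κ u => dressK N (S κ u)) (cN d N δ * (cN d N δ * Cs)) δ :=
  fun κ u => biLoc_dressK hN (hS κ u) hδ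

end BondSlot

/-! ## §4b Coarse-translation covariance of `Πᵀ` and of the dressings -/

section Shift

variable {n : ℕ} {R : Type*} [AddCommGroup R]

/-- [folklore] The codifferential commutes with translations. -/
theorem cod_shift (g : Form1 n R) (v p : Fin n → ℤ) : cod (fun κ u => g κ (u + v)) p = cod g (p + v) := by
  simp only [cod]
  refine Finset.sum_congr rfl fun κ _ => ?_
  rw [sub_add_eq_add_sub]

/-- [folklore] Comb-path membership is invariant under COARSE translations (by `L•z`). -/
theorem inPath_shift {L : ℕ} (hL : 1 ≤ L) (α : Fin n) (q p z : Fin n → ℤ) :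
    InPath L α (q + (L : ℤ) • z) (p + (L : ℤ) • z) ↔ InPath L α q p := by
  unfold InPath
  rw [AxialProjector.blk_add_zsmul hL, AxialProjector.blk_add_zsmul hL]
  have e1 : (blk L p + z = blk L q + z) ↔ blk L p = blk L q := add_left_inj z
  have e2 : ∀ j : Fin n, ((q + (L : ℤ) • z) j = (p + (L : ℤ) • z) j) ↔ q j = p j := fun j => by
    simp only [Pi.add_apply]
    exact add_left_inj _
  have e3 : ∀ j : Fin n, ((q + (L : ℤ) • z) j = ((L : ℤ) • (blk L q + z)) j) ↔ q j = ((L : ℤ) • blk L q) j := fun j => by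
    simp only [Pi.add_apply, Pi.smul_apply, smul_eq_mul, mul_add]
    exact ⟨fun h => by linarith, fun h => by linarith⟩
  have e4 : ((q + (L : ℤ) • z) α < (p + (L : ℤ) • z) α) ↔ q α < p α := by
    simp only [Pi.add_apply]
    exact add_lt_add_iff_right _
  rw [e1, e4]
  simp only [e2, e3]

/-- [folklore] The subtree sum commutes with coarse translations. -/
theorem subtreeSum_shift {L : ℕ} (hL : 1 ≤ L) (h : Form0 n R) (z : Fin n → ℤ) (α : Fin n) (q : Fin n → ℤ) :
    subtreeSum L (fun p => h (p + (L : ℤ) • z)) α q = subtreeSum L h α (q + (L : ℤ) • z) := by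
  simp only [subtreeSum]
  rw [AxialProjector.blk_add_zsmul hL]
  refine Finset.sum_congr rfl fun c _ => ?_
  have e : (L : ℤ) • (blk L q + z) + toSite c = ((L : ℤ) • blk L q + toSite c) + (L : ℤ) • z := by
    rw [smul_add]
    abel
  rw [e]
  simp only [inPath_shift hL]

/-- [folklore] **`Πᵀ` IS COARSE-TRANSLATION COVARIANT**: `Πᵀ (g ∘ shift (L•z)) (α, q) = (Πᵀ g)(α, q + L•z)` (the transpose
of `AxialProjector.axProj_shift`). -/
theorem coProj_shift {L : ℕ} (hL : 1 ≤ L) (g : Form1 n R) (z : Fin n → ℤ) (α : Fin n) (q : Fin n → ℤ) :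
    coProj L (fun κ u => g κ (u + (L : ℤ) • z)) α q = coProj L g α (q + (L : ℤ) • z) := by
  have hc : cod (fun κ u => g κ (u + (L : ℤ) • z)) = fun p => cod g (p + (L : ℤ) • z) := funext (cod_shift g _)
  simp only [coProj_apply, hc, subtreeSum_shift hL]

end Shift

section ShiftK

/-- [folklore] `Πᵀ` on an `MKer`-valued bond family commutes with a simultaneous shift of the kernel arguments. -/
theorem coProj_shiftK (N : ℕ) (S : Fin (d + 1) → (Fin (d + 1) → ℤ) → ExpKernelCalculus.MKer (d + 1) (Fib d))
    (v : Fin (d + 1) → ℤ) (κ : Fin (d + 1)) (u : Fin (d + 1) → ℤ) :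
    coProj N (fun κ' u' => ExpKernelCalculus.shiftK v (S κ' u')) κ u = ExpKernelCalculus.shiftK v (coProj N S κ u) := by
  funext x y a b
  rw [coProj_eval]
  show coProj N (fun κ' u' => S κ' u' (x + v) (y + v) a b) κ u = coProj N S κ u (x + v) (y + v) a b
  rw [coProj_eval]

/-- [folklore] The first-leg dressing commutes with simultaneous COARSE shifts (`N•t`) of the kernel arguments. -/
theorem legCo₁_shiftK {N : ℕ} (hN : 1 ≤ N) (K : ExpKernelCalculus.MKer (d + 1) (Fib d)) (t : Fin (d + 1) → ℤ) :
    legCo₁ N (ExpKernelCalculus.shiftK ((N : ℤ) • t) K) = ExpKernelCalculus.shiftK ((N : ℤ) • t) (legCo₁ N K) := by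
  funext x y a b
  cases a with
  | inr m => rfl
  | inl α =>
    show coProj N (fun α' x' => K (x' + (N : ℤ) • t) (y + (N : ℤ) • t) (Sum.inl α') b) α x =
      coProj N (fun α' x' => K x' (y + (N : ℤ) • t) (Sum.inl α') b) α (x + (N : ℤ) • t)
    exact coProj_shift hN (fun α' x' => K x' (y + (N : ℤ) • t) (Sum.inl α') b) t α x

/-- [folklore] The second-leg dressing commutes with simultaneous coarse shifts. -/
theorem legCo₂_shiftK {N : ℕ} (hN : 1 ≤ N) (K : ExpKernelCalculus.MKer (d + 1) (Fib d)) (t : Fin (d + 1) → ℤ) :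
    legCo₂ N (ExpKernelCalculus.shiftK ((N : ℤ) • t) K) = ExpKernelCalculus.shiftK ((N : ℤ) • t) (legCo₂ N K) := by
  funext x y a b
  cases b with
  | inr m => rfl
  | inl β =>
    show coProj N (fun β' y' => K (x + (N : ℤ) • t) (y' + (N : ℤ) • t) a (Sum.inl β')) β y =
      coProj N (fun β' y' => K (x + (N : ℤ) • t) y' a (Sum.inl β')) β (y + (N : ℤ) • t)
    exact coProj_shift hN (fun β' y' => K (x + (N : ℤ) • t) y' a (Sum.inl β')) t β y

/-- [folklore] **THE KERNEL DRESSING COMMUTES WITH COARSE SHIFTS.** -/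
theorem dressK_shiftK {N : ℕ} (hN : 1 ≤ N) (K : ExpKernelCalculus.MKer (d + 1) (Fib d)) (t : Fin (d + 1) → ℤ) :
    dressK N (ExpKernelCalculus.shiftK ((N : ℤ) • t) K) = ExpKernelCalculus.shiftK ((N : ℤ) • t) (dressK N K) := by
  show legCo₂ N (legCo₁ N (ExpKernelCalculus.shiftK ((N : ℤ) • t) K)) = ExpKernelCalculus.shiftK ((N : ℤ) • t) (legCo₂ N (legCo₁ N K))
  rw [legCo₁_shiftK hN, legCo₂_shiftK hN]

/-- [folklore] **THE `covS` SOCKET SURVIVES THE DRESSING**: if `S κ (u + N•t) = shiftK (−N•t) (S κ u)` (coarse-translation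
covariance of a stencil family, the shape of `BalabanStepJets.S0_translate` / `BalabanCompositeJets.Sc_translate`) then the
dressed family `dressK N (Πᵀ S κ u)` obeys the same law. -/
theorem dressS_translate {N : ℕ} (hN : 1 ≤ N)
    {S : Fin (d + 1) → (Fin (d + 1) → ℤ) → ExpKernelCalculus.MKer (d + 1) (Fib d)}
    (hS : ∀ κ u t, S κ (u + (N : ℤ) • t) = ExpKernelCalculus.shiftK (-((N : ℤ) • t)) (S κ u))
    (κ : Fin (d + 1)) (u t : Fin (d + 1) → ℤ) :
    dressK N (coProj N S κ (u + (N : ℤ) • t)) = ExpKernelCalculus.shiftK (-((N : ℤ) • t)) (dressK N (coProj N S κ u)) := by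
  have h1 : coProj N S κ (u + (N : ℤ) • t) = coProj N (fun κ' u' => S κ' (u' + (N : ℤ) • t)) κ u :=
    (coProj_shift hN S t κ u).symm
  have h2 : (fun κ' u' => S κ' (u' + (N : ℤ) • t)) = fun κ' u' => ExpKernelCalculus.shiftK (-((N : ℤ) • t)) (S κ' u') := by
    funext κ' u'
    exact hS κ' u' t
  rw [h1, h2, coProj_shiftK, ← smul_neg, dressK_shiftK hN]

/-- [folklore] **THE `covW` SOCKET SURVIVES THE DRESSING** (`ExpKernelCalculus.BlockCovariant.covW` shape). -/
theorem dressW_translate {N : ℕ} (hN : 1 ≤ N)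
    {W : Fin (d + 1) → (Fin (d + 1) → ℤ) → Fin (d + 1) → (Fin (d + 1) → ℤ) → ExpKernelCalculus.MKer (d + 1) (Fib d)}
    (hW : ∀ μ y ν y' t, W μ (y + t) ν (y' + t) = ExpKernelCalculus.shiftK (-((N : ℤ) • t)) (W μ y ν y'))
    (μ : Fin (d + 1)) (y : Fin (d + 1) → ℤ) (ν : Fin (d + 1)) (y' t : Fin (d + 1) → ℤ) :
    dressK N (W μ (y + t) ν (y' + t)) = ExpKernelCalculus.shiftK (-((N : ℤ) • t)) (dressK N (W μ y ν y')) := by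
  rw [hW, ← smul_neg, dressK_shiftK hN]

end ShiftK

/-! ## §5 The dressing functor on `JetData` and the completed typed kernel -/

section Dress

/-- [folklore] **THE DRESSING FUNCTOR** of route (α): `Πᵀ` on the stencil bond slot, then on both `inl`-legs of every stencil
value; `Πᵀ` on both `inl`-legs of every second-order table; same rate, constants `cN²·cN'·Cs` and `cN²·Cw`. -/
noncomputable def dress {N : ℕ} [NeZero N] (J : JetData d N) : JetData d N where
  S := fun κ u => dressK N (coProj N J.S κ u)
  W := fun μ y ν y' => dressK N (J.W μ y ν y')
  Cs := cN d N J.δ * (cN d N J.δ * (cN' d N J.δ * J.Cs))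
  Cw := cN d N J.δ * (cN d N J.δ * J.Cw)
  δ := J.δ
  δ_pos := J.δ_pos
  loc := locStencil_dressK ((Nat.one_le_iff_ne_zero.mpr (NeZero.ne N))) (locStencil_coProj ((Nat.one_le_iff_ne_zero.mpr (NeZero.ne N))) J.loc J.δ_pos.le) J.δ_pos.le
  loc₂ := fun μ y ν y' => biLoc_dressK ((Nat.one_le_iff_ne_zero.mpr (NeZero.ne N))) (J.loc₂ μ y ν y') J.δ_pos.le

/-- [folklore] The dressed stencil family, by definition. -/
theorem dress_S {N : ℕ} [NeZero N] (J : JetData d N) (κ : Fin (d + 1)) (u : Fin (d + 1) → ℤ) :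
    (dress J).S κ u = dressK N (coProj N J.S κ u) := rfl

/-- [folklore] The dressed second-order family, by definition. -/
theorem dress_W {N : ℕ} [NeZero N] (J : JetData d N) (μ : Fin (d + 1)) (y : Fin (d + 1) → ℤ) (ν : Fin (d + 1))
    (y' : Fin (d + 1) → ℤ) : (dress J).W μ y ν y' = dressK N (J.W μ y ν y') := rfl

/-- [folklore] The dressing keeps the localisation rate. -/
theorem dress_δ {N : ℕ} [NeZero N] (J : JetData d N) : (dress J).δ = J.δ := rfl

/-- [folklore] **THE ROUTE-(α) COMPLETED TYPED KERNEL of a jet datum** — the resolvent Hessian kernel of the typed `U = 1`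
system with the DRESSED jets: `TdressOf J := TOf (dress J)` (a DEFINITION of the route; its identification with the Hessian
of the orbit functional in Bałaban's tree gauge is the dressing lemma + `TreeSliceUnipotent`, not asserted here). -/
noncomputable def TdressOf {N : ℕ} [NeZero N] (J : JetData d N) : Fin (d + 1) → Fin (d + 1) → (Fin (d + 1) → ℤ) → ℝ :=
  TOf (N := N) (dress J)

/-- [folklore] `TdressOf` unfolds to `TOf ∘ dress`. -/
theorem TdressOf_eq {N : ℕ} [NeZero N] (J : JetData d N) : TdressOf J = TOf (N := N) (dress J) := rfl

end Dress

/-! ## §6 (v1.1) The ℓ¹ adjunction `Σ'_y Σ_κ A_κ(y)·(Πᵀg)_κ(y) = Σ'_y Σ_κ (ΠA)_κ(y)·g_κ(y)` — the analytic half of the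
dressing lemma, leg by leg -/

section Adjunction

variable {n : ℕ}

/-- [folklore] BLOCK MASS of a real one-form: `S(c) := Σ_{b ∈ box} Σ_κ |A_κ(L•c + b)|`, the `ℓ¹` mass of `A` on the block
of index `c` (the block-constant majorant used for every summability statement of this section). -/
noncomputable def blockMass (L : ℕ) (A : Form1 n ℝ) (c : AffineAveraging.Site n) : ℝ :=
  ∑ b ∈ box n L, ∑ κ : Fin n, |A κ ((L : ℤ) • c + toSite b)|

/-- [folklore] Block masses are non-negative. -/
theorem blockMass_nonneg (L : ℕ) (A : Form1 n ℝ) (c : AffineAveraging.Site n) : 0 ≤ blockMass L A c :=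
  Finset.sum_nonneg fun _ _ => Finset.sum_nonneg fun _ _ => abs_nonneg _

/-- [folklore] For a componentwise summable one-form the block masses are summable over the coarse lattice
(`KKTFluctuationEnergy.summable_blocks`). -/
theorem summable_blockMass {L : ℕ} [NeZero L] {A : Form1 n ℝ} (hA : ∀ κ : Fin n, Summable (A κ)) :
    Summable (blockMass L A) := by
  have h1 : Summable (fun y : AffineAveraging.Site n => ∑ κ : Fin n, |A κ y|) := summable_sum fun κ _ => (hA κ).abs
  refine (summable_blocks (N := L) h1).congr (fun c => ?_)
  unfold blockMass
  rfl

/-- [folklore] A single entry is bounded by the mass of its block. -/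
theorem abs_le_blockMass {L : ℕ} (hL : 1 ≤ L) (A : Form1 n ℝ) (κ : Fin n) (y : AffineAveraging.Site n) :
    |A κ y| ≤ blockMass L A (blk L y) := by
  have hmem := off_mem_box hL y
  have hy : (L : ℤ) • blk L y + toSite (off L y) = y := blk_add_off hL y
  unfold blockMass
  calc |A κ y| = |A κ ((L : ℤ) • blk L y + toSite (off L y))| := by rw [hy]
    _ ≤ ∑ κ' : Fin n, |A κ' ((L : ℤ) • blk L y + toSite (off L y))| :=
        Finset.single_le_sum (f := fun κ' => |A κ' ((L : ℤ) • blk L y + toSite (off L y))|)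
          (fun _ _ => abs_nonneg _) (Finset.mem_univ κ)
    _ ≤ ∑ b ∈ box n L, ∑ κ' : Fin n, |A κ' ((L : ℤ) • blk L y + toSite b)| :=
        Finset.single_le_sum (f := fun b => ∑ κ' : Fin n, |A κ' ((L : ℤ) • blk L y + toSite b)|)
          (fun _ _ => Finset.sum_nonneg fun _ _ => abs_nonneg _) hmem

/-- [folklore] **THE TREE INTEGRAL IS BOUNDED BY THE BLOCK MASS**: `|(G_tree A)(p)| ≤ S(blk p)` (the path from the base
point stays in the block of `p`; `AxialProjector.treeGauge_eq_sum_inPath`). -/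
theorem abs_treeGauge_le_blockMass {L : ℕ} (hL : 1 ≤ L) (A : Form1 n ℝ) (p : AffineAveraging.Site n) :
    |treeGauge A L p| ≤ blockMass L A (blk L p) := by
  rw [treeGauge_eq_sum_inPath hL]
  unfold blockMass
  calc |∑ α : Fin n, ∑ c ∈ box n L,
          (if InPath L α ((L : ℤ) • blk L p + toSite c) p then A α ((L : ℤ) • blk L p + toSite c) else 0)|
        ≤ ∑ α : Fin n, ∑ c ∈ box n L, |A α ((L : ℤ) • blk L p + toSite c)| := by
          refine (Finset.abs_sum_le_sum_abs _ _).trans (Finset.sum_le_sum fun α _ => ?_)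
          refine (Finset.abs_sum_le_sum_abs _ _).trans (Finset.sum_le_sum fun c _ => ?_)
          split_ifs
          · exact le_rfl
          · rw [abs_zero]; exact abs_nonneg _
    _ = ∑ c ∈ box n L, ∑ α : Fin n, |A α ((L : ℤ) • blk L p + toSite c)| := Finset.sum_comm

/-- [folklore] **A SUMMABLE COARSE FUNCTION READ THROUGH THE BLOCK INDEX IS SUMMABLE**: for `S ≥ 0` summable on the coarse
lattice, `p ↦ S(blk p)` is summable on the fine lattice (each fibre of `blk` has `L^n` points). -/
theorem summable_comp_blk {L : ℕ} (hL : 1 ≤ L) {S : AffineAveraging.Site n → ℝ} (hS : Summable S) (hS0 : ∀ c, 0 ≤ S c) :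
    Summable (fun p : AffineAveraging.Site n => S (blk L p)) := by
  classical
  refine summable_of_sum_le (c := ((L : ℝ) ^ n) * ∑' c, S c) (fun p => hS0 (blk L p)) (fun U => ?_)
  have hbox : (box n L).card = L ^ n := by
    rw [AffineAveraging.box, Fintype.card_piFinset]
    simp only [Finset.card_range, Finset.prod_const, Finset.card_univ, Fintype.card_fin]
  have hfib : ∀ c ∈ U.image (blk L),
      ∑ p ∈ U.filter (fun p => blk L p = c), S (blk L p) ≤ (L : ℝ) ^ n * S c := by
    intro c _
    have hcard : (U.filter (fun p => blk L p = c)).card ≤ L ^ n := by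
      rw [← hbox]
      refine Finset.card_le_card_of_injOn (off L) (fun p _ => Finset.mem_coe.mpr (off_mem_box hL p)) ?_
      intro p hp q hq h
      have hp' : blk L p = c := (Finset.mem_filter.mp (Finset.mem_coe.mp hp)).2
      have hq' : blk L q = c := (Finset.mem_filter.mp (Finset.mem_coe.mp hq)).2
      calc p = (L : ℤ) • blk L p + toSite (off L p) := (blk_add_off hL p).symm
        _ = (L : ℤ) • blk L q + toSite (off L q) := by rw [hp', hq', h]
        _ = q := blk_add_off hL q
    calc ∑ p ∈ U.filter (fun p => blk L p = c), S (blk L p)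
          = ∑ p ∈ U.filter (fun p => blk L p = c), S c :=
            Finset.sum_congr rfl fun p hp => by rw [(Finset.mem_filter.mp hp).2]
      _ = ((U.filter (fun p => blk L p = c)).card : ℝ) * S c := by rw [Finset.sum_const, nsmul_eq_mul]
      _ ≤ (L : ℝ) ^ n * S c := by
            refine mul_le_mul_of_nonneg_right ?_ (hS0 c)
            exact_mod_cast hcard
  calc ∑ p ∈ U, S (blk L p)
        = ∑ c ∈ U.image (blk L), ∑ p ∈ U.filter (fun p => blk L p = c), S (blk L p) :=
          (Finset.sum_fiberwise_of_maps_to (fun p hp => Finset.mem_image_of_mem (blk L) hp) _).symm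
    _ ≤ ∑ c ∈ U.image (blk L), (L : ℝ) ^ n * S c := Finset.sum_le_sum hfib
    _ = (L : ℝ) ^ n * ∑ c ∈ U.image (blk L), S c := by rw [Finset.mul_sum]
    _ ≤ (L : ℝ) ^ n * ∑' c, S c := by
          refine mul_le_mul_of_nonneg_left ?_ (by positivity)
          exact hS.sum_le_tsum _ (fun c _ => hS0 c)

/-- [folklore] **THE TREE INTEGRAL OF A SUMMABLE ONE-FORM IS SUMMABLE** (in fact `Σ_p |G_tree A (p)| ≤ L^n · ‖A‖₁`). -/
theorem summable_treeGauge {L : ℕ} (hL : 1 ≤ L) {A : Form1 n ℝ} (hA : ∀ κ : Fin n, Summable (A κ)) :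
    Summable (treeGauge A L) := by
  haveI : NeZero L := ⟨by omega⟩
  have hmaj : Summable (fun p : AffineAveraging.Site n => blockMass L A (blk L p)) :=
    summable_comp_blk hL (summable_blockMass hA) (blockMass_nonneg L A)
  refine Summable.of_norm_bounded hmaj (fun p => ?_)
  rw [Real.norm_eq_abs]
  exact abs_treeGauge_le_blockMass hL A p

/-- [folklore] **`Π A` IS SUMMABLE** componentwise when `A` is (the correction is a lattice gradient of the summable tree
integral). -/
theorem summable_axProj {L : ℕ} (hL : 1 ≤ L) {A : Form1 n ℝ} (hA : ∀ κ : Fin n, Summable (A κ)) (κ : Fin n) :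
    Summable (axProj L A κ) := by
  have hG : Summable (treeGauge A L) := summable_treeGauge hL hA
  have e : axProj L A κ = fun y => A κ y - (treeGauge A L (y + unitVec κ) - treeGauge A L y) := by
    funext y; rw [axProj_apply]
  rw [e]
  exact (hA κ).sub ((summable_shift hG (unitVec κ)).sub hG)

/-- [folklore] **SUMMATION BY PARTS ON THE WHOLE LATTICE**: for a bounded one-form `g` and a summable function `T`,
`Σ'_p (dᵀ g)(p)·T(p) = Σ'_p Σ_κ g_κ(p)·(grad T)_κ(p)` (`cod` = the bond-to-point codifferential of `AxialProjector` §9; the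
finite-support version is `AxialProjector.sum_mul_grad_eq`). -/
theorem tsum_cod_mul {g : Form1 n ℝ} {M : ℝ} (hg : ∀ κ p, |g κ p| ≤ M) {T : Form0 n ℝ} (hT : Summable T) :
    ∑' p, cod g p * T p = ∑' p, ∑ κ : Fin n, g κ p * grad T κ p := by
  -- summability of the four families involved
  have s1 : ∀ κ : Fin n, Summable (fun p : AffineAveraging.Site n => g κ (p - unitVec κ) * T p) :=
    fun κ => summable_mul_of_bdd (fun p => hg κ _) hT
  have s2 : ∀ κ : Fin n, Summable (fun p : AffineAveraging.Site n => g κ p * T p) := fun κ => summable_mul_of_bdd (fun p => hg κ p) hT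
  have s3 : ∀ κ : Fin n, Summable (fun p : AffineAveraging.Site n => g κ p * T (p + unitVec κ)) :=
    fun κ => summable_mul_of_bdd (fun p => hg κ p) (summable_shift hT (unitVec κ))
  -- expand the codifferential and distribute
  have e1 : ∀ p : AffineAveraging.Site n, cod g p * T p = ∑ κ : Fin n, (g κ (p - unitVec κ) * T p - g κ p * T p) := by
    intro p
    rw [cod, Finset.sum_mul]
    exact Finset.sum_congr rfl fun κ _ => by ring
  have e2 : ∀ p : AffineAveraging.Site n, ∑ κ : Fin n, g κ p * grad T κ p = ∑ κ : Fin n, (g κ p * T (p + unitVec κ) - g κ p * T p) := by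
    intro p
    exact Finset.sum_congr rfl fun κ _ => by rw [AveragingContours.grad]; ring
  simp_rw [e1, e2]
  rw [Summable.tsum_finsetSum (fun κ _ => (s1 κ).sub (s2 κ)), Summable.tsum_finsetSum (fun κ _ => (s3 κ).sub (s2 κ))]
  refine Finset.sum_congr rfl fun κ _ => ?_
  rw [(s1 κ).tsum_sub (s2 κ), (s3 κ).tsum_sub (s2 κ)]
  congr 1
  -- the shift `p ↦ p + e_κ`
  have := tsum_shift (fun p : AffineAveraging.Site n => g κ (p - unitVec κ) * T p) (unitVec κ)
  rw [← this]
  refine tsum_congr fun p => ?_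
  simp only [add_sub_cancel_right]

/-- [folklore] The summand `Σ_κ A_κ(y)·(G_treeᵀ dᵀg)_κ(y)` of the correction term, written out over the block of `y`. -/
theorem sum_mul_subtreeSum_eq {L : ℕ} (A g : Form1 n ℝ) (y : AffineAveraging.Site n) :
    ∑ κ : Fin n, A κ y * subtreeSum L (cod g) κ y =
      ∑ c ∈ box n L, ∑ κ : Fin n,
        (if InPath L κ y ((L : ℤ) • blk L y + toSite c) then A κ y * cod g ((L : ℤ) • blk L y + toSite c) else 0) := by
  rw [Finset.sum_comm]
  refine Finset.sum_congr rfl fun κ _ => ?_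
  rw [subtreeSum, Finset.mul_sum]
  exact Finset.sum_congr rfl fun c _ => by rw [mul_ite, mul_zero]

/-- [folklore] The correction summand is dominated by `2n·M·L^n · Σ_κ |A_κ(y)|` for `|g| ≤ M`. -/
theorem abs_sum_mul_subtreeSum_le {L : ℕ} (A g : Form1 n ℝ) {M : ℝ} (hg : ∀ κ p, |g κ p| ≤ M) (y : AffineAveraging.Site n) :
    |∑ κ : Fin n, A κ y * subtreeSum L (cod g) κ y| ≤ (2 * (n : ℝ) * M * (L : ℝ) ^ n) * ∑ κ : Fin n, |A κ y| := by
  have hbox : ((box n L).card : ℝ) = (L : ℝ) ^ n := by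
    rw [AffineAveraging.box, Fintype.card_piFinset]
    simp only [Finset.card_range, Finset.prod_const, Finset.card_univ, Fintype.card_fin, Nat.cast_pow]
  have hsub : ∀ κ : Fin n, |subtreeSum L (cod g) κ y| ≤ 2 * (n : ℝ) * M * (L : ℝ) ^ n := by
    intro κ
    rw [subtreeSum]
    calc |∑ c ∈ box n L, (if InPath L κ y ((L : ℤ) • blk L y + toSite c) then cod g ((L : ℤ) • blk L y + toSite c) else 0)|
          ≤ ∑ c ∈ box n L, |(if InPath L κ y ((L : ℤ) • blk L y + toSite c) then cod g ((L : ℤ) • blk L y + toSite c) else 0)| :=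
            Finset.abs_sum_le_sum_abs _ _
      _ ≤ ∑ c ∈ box n L, 2 * (n : ℝ) * M := by
            refine Finset.sum_le_sum fun c _ => ?_
            split_ifs
            · exact abs_cod_le g _ (fun κ' => ⟨hg κ' _, hg κ' _⟩)
            · rw [abs_zero]
              have : 0 ≤ M := (abs_nonneg _).trans (hg κ y)
              positivity
      _ = 2 * (n : ℝ) * M * (L : ℝ) ^ n := by rw [Finset.sum_const, nsmul_eq_mul, hbox]; ring
  calc |∑ κ : Fin n, A κ y * subtreeSum L (cod g) κ y|
        ≤ ∑ κ : Fin n, |A κ y * subtreeSum L (cod g) κ y| := Finset.abs_sum_le_sum_abs _ _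
    _ ≤ ∑ κ : Fin n, |A κ y| * (2 * (n : ℝ) * M * (L : ℝ) ^ n) := by
          refine Finset.sum_le_sum fun κ _ => ?_
          rw [abs_mul]
          exact mul_le_mul_of_nonneg_left (hsub κ) (abs_nonneg _)
    _ = (2 * (n : ℝ) * M * (L : ℝ) ^ n) * ∑ κ : Fin n, |A κ y| := by rw [← Finset.sum_mul]; ring

/-- [folklore] **THE CORRECTION TERM, RE-SUMMED OVER ENDPOINTS**: `Σ'_y Σ_κ A_κ(y)·(G_treeᵀ dᵀg)_κ(y) = Σ'_p (dᵀg)(p)·(G_tree A)(p)`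
— block by block (`KKTFluctuationEnergy.tsum_blocks`) the path indicator is read once from the bond side (`subtreeSum`) and
once from the endpoint side (`treeGauge_eq_sum_inPath`). -/
theorem tsum_sum_mul_subtreeSum {L : ℕ} (hL : 1 ≤ L) {A g : Form1 n ℝ} (hA : ∀ κ : Fin n, Summable (A κ)) {M : ℝ}
    (hg : ∀ κ p, |g κ p| ≤ M) :
    ∑' y, ∑ κ : Fin n, A κ y * subtreeSum L (cod g) κ y = ∑' p, cod g p * treeGauge A L p := by
  haveI : NeZero L := ⟨by omega⟩
  have hAabs : Summable (fun y : AffineAveraging.Site n => ∑ κ : Fin n, |A κ y|) :=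
    summable_sum fun κ _ => (hA κ).abs
  have sL : Summable (fun y : AffineAveraging.Site n => ∑ κ : Fin n, A κ y * subtreeSum L (cod g) κ y) := by
    refine Summable.of_norm_bounded (hAabs.mul_left (2 * (n : ℝ) * M * (L : ℝ) ^ n)) (fun y => ?_)
    rw [Real.norm_eq_abs]
    exact abs_sum_mul_subtreeSum_le A g hg y
  have hcod : ∀ p, |cod g p| ≤ 2 * (n : ℝ) * M := fun p => abs_cod_le g p (fun κ => ⟨hg κ _, hg κ _⟩)
  have sR : Summable (fun p : AffineAveraging.Site n => cod g p * treeGauge A L p) :=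
    summable_mul_of_bdd hcod (summable_treeGauge hL hA)
  rw [tsum_blocks (N := L) sL, tsum_blocks (N := L) sR]
  refine tsum_congr fun cb => ?_
  have eL : ∀ b ∈ box n L,
      ∑ κ : Fin n, A κ ((L : ℤ) • cb + toSite b) * subtreeSum L (cod g) κ ((L : ℤ) • cb + toSite b) =
        ∑ c ∈ box n L, ∑ κ : Fin n, (if InPath L κ ((L : ℤ) • cb + toSite b) ((L : ℤ) • cb + toSite c)
          then A κ ((L : ℤ) • cb + toSite b) * cod g ((L : ℤ) • cb + toSite c) else 0) := by
    intro b hb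
    rw [sum_mul_subtreeSum_eq, blk_block cb hb]
  have eR : ∀ c ∈ box n L,
      cod g ((L : ℤ) • cb + toSite c) * treeGauge A L ((L : ℤ) • cb + toSite c) =
        ∑ b ∈ box n L, ∑ κ : Fin n, (if InPath L κ ((L : ℤ) • cb + toSite b) ((L : ℤ) • cb + toSite c)
          then A κ ((L : ℤ) • cb + toSite b) * cod g ((L : ℤ) • cb + toSite c) else 0) := by
    intro c hc
    rw [treeGauge_eq_sum_inPath hL, blk_block cb hc]
    simp only [Finset.mul_sum, mul_ite, mul_zero]
    rw [Finset.sum_comm]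
    exact Finset.sum_congr rfl fun b _ => Finset.sum_congr rfl fun κ _ => by rw [mul_comm]
  show (∑ b ∈ box n L, ∑ κ : Fin n, A κ ((L : ℤ) • cb + toSite b) * subtreeSum L (cod g) κ ((L : ℤ) • cb + toSite b)) =
    ∑ c ∈ box n L, cod g ((L : ℤ) • cb + toSite c) * treeGauge A L ((L : ℤ) • cb + toSite c)
  calc (∑ b ∈ box n L, ∑ κ : Fin n, A κ ((L : ℤ) • cb + toSite b) * subtreeSum L (cod g) κ ((L : ℤ) • cb + toSite b))
      = ∑ b ∈ box n L, ∑ c ∈ box n L, ∑ κ : Fin n, (if InPath L κ ((L : ℤ) • cb + toSite b) ((L : ℤ) • cb + toSite c)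
          then A κ ((L : ℤ) • cb + toSite b) * cod g ((L : ℤ) • cb + toSite c) else 0) := Finset.sum_congr rfl eL
    _ = ∑ c ∈ box n L, ∑ b ∈ box n L, ∑ κ : Fin n, (if InPath L κ ((L : ℤ) • cb + toSite b) ((L : ℤ) • cb + toSite c)
          then A κ ((L : ℤ) • cb + toSite b) * cod g ((L : ℤ) • cb + toSite c) else 0) := Finset.sum_comm
    _ = ∑ c ∈ box n L, cod g ((L : ℤ) • cb + toSite c) * treeGauge A L ((L : ℤ) • cb + toSite c) :=
          (Finset.sum_congr rfl eR).symm

/-- [folklore] **THE ℓ¹ ADJUNCTION `Σ' ⟨A, Πᵀ g⟩ = Σ' ⟨Π A, g⟩`** (whole lattice): for a componentwise SUMMABLE real one-form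
`A` (a resolvent / minimiser column) and a BOUNDED one-form `g` (a kernel leg, a stencil bond slot),
`Σ'_y Σ_κ A_κ(y)·(Πᵀ g)_κ(y) = Σ'_y Σ_κ (Π A)_κ(y)·g_κ(y)` — dressing the covariant leg by `Πᵀ = coProj` IS dressing the
contravariant column by `Π = axProj`.  This is the `tsum` form of `AxialProjector.sum_coProj_mul` and the analytic content of the
dressing lemma of route (α) ((R29-5): `Γ_tree = Π Γ Πᵀ`, `ℋ_tree = Π ℋ`), one leg at a time. -/
theorem tsum_mul_coProj {L : ℕ} (hL : 1 ≤ L) {A g : Form1 n ℝ} (hA : ∀ κ : Fin n, Summable (A κ)) {M : ℝ}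
    (hg : ∀ κ y, |g κ y| ≤ M) :
    ∑' y, ∑ κ : Fin n, A κ y * coProj L g κ y = ∑' y, ∑ κ : Fin n, axProj L A κ y * g κ y := by
  have sAg : Summable (fun y : AffineAveraging.Site n => ∑ κ : Fin n, A κ y * g κ y) :=
    summable_sum fun κ _ => summable_mul_of_bdd' (hA κ) (hg κ)
  have hAabs : Summable (fun y : AffineAveraging.Site n => ∑ κ : Fin n, |A κ y|) :=
    summable_sum fun κ _ => (hA κ).abs
  have sT : Summable (fun y : AffineAveraging.Site n => ∑ κ : Fin n, A κ y * subtreeSum L (cod g) κ y) := by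
    refine Summable.of_norm_bounded (hAabs.mul_left (2 * (n : ℝ) * M * (L : ℝ) ^ n)) (fun y => ?_)
    rw [Real.norm_eq_abs]
    exact abs_sum_mul_subtreeSum_le A g hg y
  have hG : Summable (treeGauge A L) := summable_treeGauge hL hA
  have sG : Summable (fun y : AffineAveraging.Site n => ∑ κ : Fin n, g κ y * grad (treeGauge A L) κ y) := by
    refine summable_sum fun κ _ => ?_
    have e : (fun y : AffineAveraging.Site n => g κ y * grad (treeGauge A L) κ y) =
        fun y => g κ y * treeGauge A L (y + unitVec κ) - g κ y * treeGauge A L y := by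
      funext y
      simp only [AveragingContours.grad]
      ring
    rw [e]
    exact (summable_mul_of_bdd (fun p => hg κ p) (summable_shift hG (unitVec κ))).sub
      (summable_mul_of_bdd (fun p => hg κ p) hG)
  have e1 : ∀ y : AffineAveraging.Site n, ∑ κ : Fin n, A κ y * coProj L g κ y =
      ∑ κ : Fin n, A κ y * g κ y - ∑ κ : Fin n, A κ y * subtreeSum L (cod g) κ y := by
    intro y
    rw [← Finset.sum_sub_distrib]
    exact Finset.sum_congr rfl fun κ _ => by rw [coProj_apply, mul_sub]
  have e2 : ∀ y : AffineAveraging.Site n, ∑ κ : Fin n, axProj L A κ y * g κ y =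
      ∑ κ : Fin n, A κ y * g κ y - ∑ κ : Fin n, g κ y * grad (treeGauge A L) κ y := by
    intro y
    rw [← Finset.sum_sub_distrib]
    exact Finset.sum_congr rfl fun κ _ => by rw [axProj_apply]; simp only [AveragingContours.grad]; ring
  rw [tsum_congr e1, tsum_congr e2, sAg.tsum_sub sT, sAg.tsum_sub sG, tsum_sum_mul_subtreeSum hL hA hg,
    tsum_cod_mul hg hG]

/-- [folklore] The adjunction in the other order of factors: `Σ'_y Σ_κ (Πᵀ g)_κ(y)·A_κ(y) = Σ'_y Σ_κ g_κ(y)·(Π A)_κ(y)`. -/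
theorem tsum_coProj_mul {L : ℕ} (hL : 1 ≤ L) {A g : Form1 n ℝ} (hA : ∀ κ : Fin n, Summable (A κ)) {M : ℝ}
    (hg : ∀ κ y, |g κ y| ≤ M) :
    ∑' y, ∑ κ : Fin n, coProj L g κ y * A κ y = ∑' y, ∑ κ : Fin n, g κ y * axProj L A κ y := by
  have h := tsum_mul_coProj hL hA hg
  have e1 : ∀ y : AffineAveraging.Site n, ∑ κ : Fin n, coProj L g κ y * A κ y = ∑ κ : Fin n, A κ y * coProj L g κ y :=
    fun y => Finset.sum_congr rfl fun κ _ => mul_comm _ _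
  have e2 : ∀ y : AffineAveraging.Site n, ∑ κ : Fin n, g κ y * axProj L A κ y = ∑ κ : Fin n, axProj L A κ y * g κ y :=
    fun y => Finset.sum_congr rfl fun κ _ => mul_comm _ _
  rw [tsum_congr e1, tsum_congr e2, h]

/-- [folklore] The adjunction with the finite sum outside: `Σ_κ Σ'_y A_κ(y)·(Πᵀg)_κ(y) = Σ_κ Σ'_y (ΠA)_κ(y)·g_κ(y)` (the
shape of `OneStepResolventKernel.vertexOf`'s `Σ_{κ′} wsum`). -/
theorem sum_tsum_mul_coProj {L : ℕ} (hL : 1 ≤ L) {A g : Form1 n ℝ} (hA : ∀ κ : Fin n, Summable (A κ)) {M : ℝ}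
    (hg : ∀ κ y, |g κ y| ≤ M) :
    ∑ κ : Fin n, ∑' y, A κ y * coProj L g κ y = ∑ κ : Fin n, ∑' y, axProj L A κ y * g κ y := by
  haveI : NeZero L := ⟨by omega⟩
  rcases Nat.eq_zero_or_pos n with hn | hn
  · subst hn
    simp
  have hM0 : 0 ≤ M := (abs_nonneg _).trans (hg ⟨0, hn⟩ 0)
  -- `Πᵀ g` is bounded (`abs_coProj_le`), `Π A` is summable componentwise
  have hco : ∀ κ y, |coProj L g κ y| ≤ (1 + 2 * (n : ℝ) * (L : ℝ) ^ n) * M :=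
    fun κ y => AxialProjector.abs_coProj_le L g κ y hM0 (fun κ' z _ => hg κ' z)
  rw [← Summable.tsum_finsetSum (fun κ _ => summable_mul_of_bdd' (hA κ) (hco κ)),
    ← Summable.tsum_finsetSum (fun κ _ => summable_mul_of_bdd' (summable_axProj hL hA κ) (hg κ))]
  exact tsum_mul_coProj hL hA hg

end Adjunction


/-! ## §7 (v1.1) The adjunction at kernel-leg level — `A ∘ (Πᵀ-leg K) = (Π-column A) ∘ K` — and at the bond slot of
`vertexOf` -/

section LegAdjunction

variable {d : ℕ}

/-- [folklore] `Π` on the FIRST leg (row field index) of a kernel table: the column `x′ ↦ A x′ y (inl ·) b` through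
`AxialProjector.axProj`; multiplier rows untouched. -/
noncomputable def legAx₁ (N : ℕ) (A : ExpKernelCalculus.MKer (d + 1) (Fib d)) : ExpKernelCalculus.MKer (d + 1) (Fib d) :=
  fun x y a b =>
    match a with
    | Sum.inl α => axProj N (fun α' x' => A x' y (Sum.inl α') b) α x
    | Sum.inr _ => A x y a b

/-- [folklore] `Π` on the SECOND leg (column field index) of a kernel table. -/
noncomputable def legAx₂ (N : ℕ) (A : ExpKernelCalculus.MKer (d + 1) (Fib d)) : ExpKernelCalculus.MKer (d + 1) (Fib d) :=
  fun x y a b =>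
    match b with
    | Sum.inl β => axProj N (fun β' y' => A x y' a (Sum.inl β')) β y
    | Sum.inr _ => A x y a b

/-- [folklore] Computation rule, `Π` on the first leg, field component. -/
theorem legAx₁_inl (N : ℕ) (A : ExpKernelCalculus.MKer (d + 1) (Fib d)) (x y : Fin (d + 1) → ℤ) (α : Fin (d + 1))
    (b : Fib d) : legAx₁ N A x y (Sum.inl α) b = axProj N (fun α' x' => A x' y (Sum.inl α') b) α x := rfl

/-- [folklore] Computation rule, `Π` on the first leg, multiplier component (untouched). -/
theorem legAx₁_inr (N : ℕ) (A : ExpKernelCalculus.MKer (d + 1) (Fib d)) (x y : Fin (d + 1) → ℤ) (m : Fin (d + 1))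
    (b : Fib d) : legAx₁ N A x y (Sum.inr m) b = A x y (Sum.inr m) b := rfl

/-- [folklore] Computation rule, `Π` on the second leg, field component. -/
theorem legAx₂_inl (N : ℕ) (A : ExpKernelCalculus.MKer (d + 1) (Fib d)) (x y : Fin (d + 1) → ℤ) (a : Fib d)
    (β : Fin (d + 1)) : legAx₂ N A x y a (Sum.inl β) = axProj N (fun β' y' => A x y' a (Sum.inl β')) β y := rfl

/-- [folklore] Computation rule, `Π` on the second leg, multiplier component (untouched). -/
theorem legAx₂_inr (N : ℕ) (A : ExpKernelCalculus.MKer (d + 1) (Fib d)) (x y : Fin (d + 1) → ℤ) (a : Fib d)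
    (m : Fin (d + 1)) : legAx₂ N A x y a (Sum.inr m) = A x y a (Sum.inr m) := rfl

/-- [folklore] **`A ∘ (Πᵀ on the first leg of K) = (Π on the second leg of A) ∘ K`**, entry by entry: for a kernel `A`
whose `(x, a)`-row is summable in the column variable (a resolvent row, `OneStepResolventKernel.decays_KInv`) and a kernel
`K` whose `(z, b)`-column is bounded (a jet leg), `ExpKernelCalculus.comp A (legCo₁ N K) x z a b = comp (legAx₂ N A) K x z a b`
— the tadpole / bubble traces of `TOf (dress J)` move the dressing from the jets onto the resolvent (`Γ_tree = Π Γ Πᵀ`). -/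
theorem comp_legCo₁ {N : ℕ} (hN : 1 ≤ N) {A K : ExpKernelCalculus.MKer (d + 1) (Fib d)} {x z : Fin (d + 1) → ℤ}
    {a b : Fib d} {M : ℝ} (hA : ∀ f : Fib d, Summable (fun y => A x y a f))
    (hK : ∀ (y : Fin (d + 1) → ℤ) (f : Fib d), |K y z f b| ≤ M) :
    ExpKernelCalculus.comp A (legCo₁ N K) x z a b = ExpKernelCalculus.comp (legAx₂ N A) K x z a b := by
  have hM0 : 0 ≤ M := (abs_nonneg _).trans (hK z (Sum.inl 0))
  have eL : ∀ y : Fin (d + 1) → ℤ, ∑ f : Fib d, A x y a f * legCo₁ N K y z f b =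
      ∑ κ : Fin (d + 1), A x y a (Sum.inl κ) * coProj N (fun κ' y' => K y' z (Sum.inl κ') b) κ y +
        ∑ m : Fin (d + 1), A x y a (Sum.inr m) * K y z (Sum.inr m) b := by
    intro y; rw [Fintype.sum_sum_type]; rfl
  have eR : ∀ y : Fin (d + 1) → ℤ, ∑ f : Fib d, legAx₂ N A x y a f * K y z f b =
      ∑ κ : Fin (d + 1), axProj N (fun κ' y' => A x y' a (Sum.inl κ')) κ y * K y z (Sum.inl κ) b +
        ∑ m : Fin (d + 1), A x y a (Sum.inr m) * K y z (Sum.inr m) b := by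
    intro y; rw [Fintype.sum_sum_type]; rfl
  have hA' : ∀ κ : Fin (d + 1), Summable ((fun κ' y' => A x y' a (Sum.inl κ')) κ) := fun κ => hA (Sum.inl κ)
  have hg' : ∀ (κ : Fin (d + 1)) (y' : Fin (d + 1) → ℤ), |(fun κ' y' => K y' z (Sum.inl κ') b) κ y'| ≤ M :=
    fun κ y' => hK y' (Sum.inl κ)
  have hco : ∀ (κ : Fin (d + 1)) (y : Fin (d + 1) → ℤ),
      |coProj N (fun κ' y' => K y' z (Sum.inl κ') b) κ y| ≤ (1 + 2 * ((d + 1 : ℕ) : ℝ) * (N : ℝ) ^ (d + 1)) * M :=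
    fun κ y => abs_coProj_le N _ κ y hM0 (fun κ' z' _ => hg' κ' z')
  have s1 : Summable (fun y : Fin (d + 1) → ℤ =>
      ∑ κ : Fin (d + 1), A x y a (Sum.inl κ) * coProj N (fun κ' y' => K y' z (Sum.inl κ') b) κ y) :=
    summable_sum fun κ _ => summable_mul_of_bdd' (hA (Sum.inl κ)) (hco κ)
  have s1' : Summable (fun y : Fin (d + 1) → ℤ =>
      ∑ κ : Fin (d + 1), axProj N (fun κ' y' => A x y' a (Sum.inl κ')) κ y * K y z (Sum.inl κ) b) :=
    summable_sum fun κ _ => summable_mul_of_bdd' (summable_axProj hN hA' κ) (fun y => hK y (Sum.inl κ))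
  have s2 : Summable (fun y : Fin (d + 1) → ℤ => ∑ m : Fin (d + 1), A x y a (Sum.inr m) * K y z (Sum.inr m) b) :=
    summable_sum fun m _ => summable_mul_of_bdd' (hA (Sum.inr m)) (fun y => hK y (Sum.inr m))
  show (∑' y, ∑ f : Fib d, A x y a f * legCo₁ N K y z f b) = ∑' y, ∑ f : Fib d, legAx₂ N A x y a f * K y z f b
  rw [tsum_congr eL, tsum_congr eR, s1.tsum_add s2, s1'.tsum_add s2, tsum_mul_coProj hN hA' hg']

/-- [folklore] **`(Πᵀ on the second leg of K) ∘ A = K ∘ (Π on the first leg of A)`**, entry by entry (bounded `K`-row,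
summable `A`-column). -/
theorem comp_legCo₂ {N : ℕ} (hN : 1 ≤ N) {A K : ExpKernelCalculus.MKer (d + 1) (Fib d)} {x z : Fin (d + 1) → ℤ}
    {a b : Fib d} {M : ℝ} (hK : ∀ (y : Fin (d + 1) → ℤ) (f : Fib d), |K x y a f| ≤ M)
    (hA : ∀ f : Fib d, Summable (fun y => A y z f b)) :
    ExpKernelCalculus.comp (legCo₂ N K) A x z a b = ExpKernelCalculus.comp K (legAx₁ N A) x z a b := by
  have hM0 : 0 ≤ M := (abs_nonneg _).trans (hK x (Sum.inl 0))
  have eL : ∀ y : Fin (d + 1) → ℤ, ∑ f : Fib d, legCo₂ N K x y a f * A y z f b =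
      ∑ κ : Fin (d + 1), coProj N (fun κ' y' => K x y' a (Sum.inl κ')) κ y * A y z (Sum.inl κ) b +
        ∑ m : Fin (d + 1), K x y a (Sum.inr m) * A y z (Sum.inr m) b := by
    intro y; rw [Fintype.sum_sum_type]; rfl
  have eR : ∀ y : Fin (d + 1) → ℤ, ∑ f : Fib d, K x y a f * legAx₁ N A y z f b =
      ∑ κ : Fin (d + 1), K x y a (Sum.inl κ) * axProj N (fun κ' y' => A y' z (Sum.inl κ') b) κ y +
        ∑ m : Fin (d + 1), K x y a (Sum.inr m) * A y z (Sum.inr m) b := by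
    intro y; rw [Fintype.sum_sum_type]; rfl
  have hA' : ∀ κ : Fin (d + 1), Summable ((fun κ' y' => A y' z (Sum.inl κ') b) κ) := fun κ => hA (Sum.inl κ)
  have hg' : ∀ (κ : Fin (d + 1)) (y' : Fin (d + 1) → ℤ), |(fun κ' y' => K x y' a (Sum.inl κ')) κ y'| ≤ M :=
    fun κ y' => hK y' (Sum.inl κ)
  have hco : ∀ (κ : Fin (d + 1)) (y : Fin (d + 1) → ℤ),
      |coProj N (fun κ' y' => K x y' a (Sum.inl κ')) κ y| ≤ (1 + 2 * ((d + 1 : ℕ) : ℝ) * (N : ℝ) ^ (d + 1)) * M :=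
    fun κ y => abs_coProj_le N _ κ y hM0 (fun κ' z' _ => hg' κ' z')
  have s1 : Summable (fun y : Fin (d + 1) → ℤ =>
      ∑ κ : Fin (d + 1), coProj N (fun κ' y' => K x y' a (Sum.inl κ')) κ y * A y z (Sum.inl κ) b) :=
    summable_sum fun κ _ => summable_mul_of_bdd (hco κ) (hA (Sum.inl κ))
  have s1' : Summable (fun y : Fin (d + 1) → ℤ =>
      ∑ κ : Fin (d + 1), K x y a (Sum.inl κ) * axProj N (fun κ' y' => A y' z (Sum.inl κ') b) κ y) :=
    summable_sum fun κ _ => summable_mul_of_bdd (fun y => hK y (Sum.inl κ)) (summable_axProj hN hA' κ)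
  have s2 : Summable (fun y : Fin (d + 1) → ℤ => ∑ m : Fin (d + 1), K x y a (Sum.inr m) * A y z (Sum.inr m) b) :=
    summable_sum fun m _ => summable_mul_of_bdd (fun y => hK y (Sum.inr m)) (hA (Sum.inr m))
  show (∑' y, ∑ f : Fib d, legCo₂ N K x y a f * A y z f b) = ∑' y, ∑ f : Fib d, K x y a f * legAx₁ N A y z f b
  rw [tsum_congr eL, tsum_congr eR, s1.tsum_add s2, s1'.tsum_add s2, tsum_coProj_mul hN hA' hg']

/-- [folklore] **THE BOND SLOT: `vertexOf (Πᵀ S) = (Π ℋ-column) · S`.**  For a local stencil family `S` (every entry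
bounded by `Cs`) the chain-rule vertex of the `Πᵀ`-dressed bond family is the superposition of the UNDRESSED stencils
with the `Π`-dressed minimiser column `u ↦ (Π ℋ(·; μ, N•y))(κ′, u)` as weights — `ℋ_tree = Π ℋ` at the level of
`OneStepResolventKernel.vertexOf`. -/
theorem vertexOf_coProj {N : ℕ} [NeZero N] {S : Fin (d + 1) → (Fin (d + 1) → ℤ) → ExpKernelCalculus.MKer (d + 1) (Fib d)}
    {Cs δ : ℝ} (hS : LocStencil S Cs δ) (hδ : 0 ≤ δ) (μ : Fin (d + 1)) (y x z : Fin (d + 1) → ℤ) (a b : Fib d) :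
    vertexOf (N := N) (coProj N S) μ y x z a b =
      ∑ κ' : Fin (d + 1), wsum (axProj N (fun κ u => wH (N := N) κ μ (u - (N : ℤ) • y)) κ') (S κ') x z a b := by
  have hN : 1 ≤ N := Nat.one_le_iff_ne_zero.mpr (NeZero.ne N)
  -- the `ℋ`-column is summable (exponential decay of `wH`)
  obtain ⟨δw, Cw, hδw, hwH⟩ := decay_wH (N := N) (d := d)
  have hA : ∀ κ : Fin (d + 1), Summable ((fun κ u => wH (N := N) κ μ (u - (N : ℤ) • y)) κ) := by
    intro κ
    have h0 : Summable (wH (N := N) κ μ) := summable_of_decay510 hδw (hwH κ μ)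
    have h1 := summable_shift h0 (-((N : ℤ) • y))
    refine h1.congr (fun u => ?_)
    simp only [sub_eq_add_neg]
  -- the stencil entries are bounded by `Cs`
  have hg : ∀ (κ : Fin (d + 1)) (u : Fin (d + 1) → ℤ), |(fun κ u => S κ u x z a b) κ u| ≤ Cs := by
    intro κ u
    have h := hS κ u x z a b
    have hCs : 0 ≤ Cs := (hS κ u).nonneg (Sum.inl 0)
    have he : Real.exp (-δ * (l1 (x - u) + l1 (z - u))) ≤ 1 := by
      rw [Real.exp_le_one_iff]
      have := l1_nonneg (x - u)
      have := l1_nonneg (z - u)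
      nlinarith
    calc |S κ u x z a b| ≤ Cs * Real.exp (-δ * (l1 (x - u) + l1 (z - u))) := h
      _ ≤ Cs * 1 := mul_le_mul_of_nonneg_left he hCs
      _ = Cs := mul_one _
  have e1 : vertexOf (N := N) (coProj N S) μ y x z a b =
      ∑ κ' : Fin (d + 1), ∑' u, wH (N := N) κ' μ (u - (N : ℤ) • y) * coProj N (fun κ u => S κ u x z a b) κ' u := by
    show (∑ κ' : Fin (d + 1), ∑' u, wH (N := N) κ' μ (u - (N : ℤ) • y) * coProj N S κ' u x z a b) = _
    refine Finset.sum_congr rfl fun κ' _ => tsum_congr fun u => ?_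
    rw [coProj_eval]
  rw [e1, sum_tsum_mul_coProj hN hA hg]
  rfl

end LegAdjunction


/-! ## §8 (v1.2) The TADPOLE HALF of the assembled dressing lemma: `tadpole A (Πᵀ K Πᵀ) = tadpole (Π A Π) K` on the whole lattice
(trace cyclicity from the an2-lineage Fubini bricks `KernelWard.tr_comp_comm_of_bound`, BY NAME) -/

section TadpoleHalf

variable {d : ℕ}

/-- [folklore] `Π` on BOTH legs of a kernel table (`Π A Π`, the contravariant twin of `dressK = Πᵀ · Πᵀ`). -/
noncomputable def axDressK (N : ℕ) (A : ExpKernelCalculus.MKer (d + 1) (Fib d)) : ExpKernelCalculus.MKer (d + 1) (Fib d) :=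
  legAx₁ N (legAx₂ N A)

/-- [folklore] A row of a decaying kernel (rate `δ > 0`) is summable. -/
theorem summable_row_of_decays {A : ExpKernelCalculus.MKer (d + 1) (Fib d)} {C δ : ℝ} (hA : Decays A C δ) (hδ : 0 < δ)
    (x : Fin (d + 1) → ℤ) (a b : Fib d) : Summable (fun y => A x y a b) := by
  refine Summable.of_norm_bounded ((summable_exp_shift hδ x).mul_left C) (fun y => ?_)
  rw [Real.norm_eq_abs]
  exact hA x y a b

/-- [folklore] A column of a decaying kernel (rate `δ > 0`) is summable. -/
theorem summable_col_of_decays {A : ExpKernelCalculus.MKer (d + 1) (Fib d)} {C δ : ℝ} (hA : Decays A C δ) (hδ : 0 < δ)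
    (y : Fin (d + 1) → ℤ) (a b : Fib d) : Summable (fun x => A x y a b) := by
  refine Summable.of_norm_bounded ((summable_exp_shift' hδ y).mul_left C) (fun x => ?_)
  rw [Real.norm_eq_abs]
  exact hA x y a b

/-- [folklore] `Π` on the second leg of a BOUNDED kernel is bounded, constant `(1 + 2(d+1)N)`. -/
theorem abs_legAx₂_le {N : ℕ} (hN : 1 ≤ N) {A : ExpKernelCalculus.MKer (d + 1) (Fib d)} {B : ℝ} (hA : Bdd A B) (hB : 0 ≤ B)
    (x y : Fin (d + 1) → ℤ) (a b : Fib d) : |legAx₂ N A x y a b| ≤ (1 + 2 * ((d + 1 : ℕ) : ℝ) * N) * B := by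
  cases b with
  | inl β =>
    rw [legAx₂_inl]
    exact abs_axProj_le hN _ β y hB (fun κ q _ => hA x q a (Sum.inl κ))
  | inr m =>
    rw [legAx₂_inr]
    refine (hA x y a (Sum.inr m)).trans (le_mul_of_one_le_left hB ?_)
    have : (0 : ℝ) ≤ 2 * ((d + 1 : ℕ) : ℝ) * N := by positivity
    linarith

/-- [folklore] `Π` on the first leg of a BOUNDED kernel is bounded, constant `(1 + 2(d+1)N)`. -/
theorem abs_legAx₁_le {N : ℕ} (hN : 1 ≤ N) {A : ExpKernelCalculus.MKer (d + 1) (Fib d)} {B : ℝ} (hA : Bdd A B) (hB : 0 ≤ B)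
    (x y : Fin (d + 1) → ℤ) (a b : Fib d) : |legAx₁ N A x y a b| ≤ (1 + 2 * ((d + 1 : ℕ) : ℝ) * N) * B := by
  cases a with
  | inl α =>
    rw [legAx₁_inl]
    exact abs_axProj_le hN _ α x hB (fun κ q _ => hA q y (Sum.inl κ) b)
  | inr m =>
    rw [legAx₁_inr]
    refine (hA x y (Sum.inr m) b).trans (le_mul_of_one_le_left hB ?_)
    have : (0 : ℝ) ≤ 2 * ((d + 1 : ℕ) : ℝ) * N := by positivity
    linarith

/-- [folklore] `Π A Π` of a bounded kernel is bounded, constant `(1 + 2(d+1)N)²`. -/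
theorem bdd_axDressK {N : ℕ} (hN : 1 ≤ N) {A : ExpKernelCalculus.MKer (d + 1) (Fib d)} {B : ℝ} (hA : Bdd A B) (hB : 0 ≤ B) :
    Bdd (axDressK N A) ((1 + 2 * ((d + 1 : ℕ) : ℝ) * N) * ((1 + 2 * ((d + 1 : ℕ) : ℝ) * N) * B)) := by
  have hB' : 0 ≤ (1 + 2 * ((d + 1 : ℕ) : ℝ) * N) * B := by positivity
  intro x y a b
  exact abs_legAx₁_le hN (fun x' y' a' b' => abs_legAx₂_le hN hA hB x' y' a' b') hB' x y a b

/-- [folklore] `Π` on the second leg preserves FIRST-LEG (column) summability: the correction is a finite sum, over the block-tree path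
sites of the second endpoint, of columns of `A`. -/
theorem summable_legAx₂_col {N : ℕ} (hN : 1 ≤ N) {A : ExpKernelCalculus.MKer (d + 1) (Fib d)} {f : Fib d}
    (hA : ∀ (w : Fin (d + 1) → ℤ) (g : Fib d), Summable (fun y => A y w f g)) (z : Fin (d + 1) → ℤ) (b : Fib d) :
    Summable (fun y => legAx₂ N A y z f b) := by
  -- the tree integral at a fixed endpoint, as a function of the first leg, is a finite sum of columns
  have hT : ∀ w : Fin (d + 1) → ℤ, Summable (fun y => treeGauge (fun β' y' => A y y' f (Sum.inl β')) N w) := by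
    intro w
    have e : (fun y => treeGauge (fun β' y' => A y y' f (Sum.inl β')) N w) = fun y =>
        ∑ α : Fin (d + 1), ∑ c ∈ box (d + 1) N,
          (if InPath N α ((N : ℤ) • blk N w + toSite c) w then A y ((N : ℤ) • blk N w + toSite c) f (Sum.inl α) else 0) := by
      funext y; rw [treeGauge_eq_sum_inPath hN]
    rw [e]
    refine summable_sum fun α _ => summable_sum fun c _ => ?_
    by_cases h : InPath N α ((N : ℤ) • blk N w + toSite c) w
    · simp only [if_pos h]; exact hA _ _
    · simp only [if_neg h]; exact summable_zero
  cases b with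
  | inl β =>
    have e : (fun y => legAx₂ N A y z f (Sum.inl β)) = fun y => A y z f (Sum.inl β) -
        (treeGauge (fun β' y' => A y y' f (Sum.inl β')) N (z + unitVec β) - treeGauge (fun β' y' => A y y' f (Sum.inl β')) N z) := by
      funext y; rw [legAx₂_inl, axProj_apply]
    rw [e]
    exact (hA z (Sum.inl β)).sub ((hT (z + unitVec β)).sub (hT z))
  | inr m =>
    have e : (fun y => legAx₂ N A y z f (Sum.inr m)) = fun y => A y z f (Sum.inr m) := by
      funext y; rw [legAx₂_inr]
    rw [e]
    exact hA z (Sum.inr m)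

/-- [folklore] Product majorant, bounded ∘ bi-localised: the hypothesis of `KernelWard.tr_comp_comm_of_bound`. -/
theorem prodBound_bdd_biLoc {K L : ExpKernelCalculus.MKer (d + 1) (Fib d)} {B C δ : ℝ} {p q : Fin (d + 1) → ℤ} (hK : Bdd K B)
    (hB : 0 ≤ B) (hL : BiLoc L p q C δ) (hδ : 0 < δ) :
    ∃ φ ψ : (Fin (d + 1) → ℤ) → ℝ, Summable φ ∧ Summable ψ ∧ (∀ x, 0 ≤ φ x) ∧ (∀ y, 0 ≤ ψ y) ∧
      ∀ x y (a f : Fib d), |K x y a f * L y x f a| ≤ φ x * ψ y := by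
  have hC : 0 ≤ C := hL.nonneg (Sum.inl 0)
  refine ⟨fun x => B * C * Real.exp (-δ * l1 (x - q)), fun y => Real.exp (-δ * l1 (y - p)),
    (summable_exp_shift' hδ q).mul_left _, summable_exp_shift' hδ p, fun x => by positivity, fun y => by positivity,
    fun x y a f => ?_⟩
  rw [abs_mul]
  have h1 := hK x y a f
  have h2 := hL y x f a
  have e : B * (C * Real.exp (-δ * (l1 (y - p) + l1 (x - q)))) = B * C * Real.exp (-δ * l1 (x - q)) * Real.exp (-δ * l1 (y - p)) := by
    rw [mul_add, Real.exp_add]; ring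
  calc |K x y a f| * |L y x f a| ≤ B * (C * Real.exp (-δ * (l1 (y - p) + l1 (x - q)))) :=
        mul_le_mul h1 h2 (abs_nonneg _) hB
    _ = _ := e

/-- [folklore] Product majorant, bi-localised ∘ bounded. -/
theorem prodBound_biLoc_bdd {K L : ExpKernelCalculus.MKer (d + 1) (Fib d)} {B C δ : ℝ} {p q : Fin (d + 1) → ℤ}
    (hK : BiLoc K p q C δ) (hδ : 0 < δ) (hL : Bdd L B) :
    ∃ φ ψ : (Fin (d + 1) → ℤ) → ℝ, Summable φ ∧ Summable ψ ∧ (∀ x, 0 ≤ φ x) ∧ (∀ y, 0 ≤ ψ y) ∧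
      ∀ x y (a f : Fib d), |K x y a f * L y x f a| ≤ φ x * ψ y := by
  have hC : 0 ≤ C := hK.nonneg (Sum.inl 0)
  have hB : 0 ≤ B := (abs_nonneg _).trans (hL p q (Sum.inl 0) (Sum.inl 0))
  refine ⟨fun x => C * B * Real.exp (-δ * l1 (x - p)), fun y => Real.exp (-δ * l1 (y - q)),
    (summable_exp_shift' hδ p).mul_left _, summable_exp_shift' hδ q, fun x => by positivity, fun y => by positivity,
    fun x y a f => ?_⟩
  rw [abs_mul]
  have h1 := hK x y a f
  have h2 := hL y x f a
  have e : C * Real.exp (-δ * (l1 (x - p) + l1 (y - q))) * B = C * B * Real.exp (-δ * l1 (x - p)) * Real.exp (-δ * l1 (y - q)) := by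
    rw [mul_add, Real.exp_add]; ring
  calc |K x y a f| * |L y x f a| ≤ C * Real.exp (-δ * (l1 (x - p) + l1 (y - q))) * B :=
        mul_le_mul h1 h2 (abs_nonneg _) (by positivity)
    _ = _ := e

/-- [folklore] **THE TADPOLE HALF OF THE DRESSING LEMMA, ASSEMBLED ON THE WHOLE LATTICE.**  For a decaying kernel `A` (rate
`δ > 0`; the resolvent `KInv`) and a bi-localised second-order jet leg `K`:
`tadpole A (dressK N K) = tadpole (axDressK N A) K`, i.e. `tr (A ∘ Πᵀ K Πᵀ) = tr ((Π A Π) ∘ K)` — the dressing of the jet is the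
`Π`-conjugation of the resolvent.  Chain: `comp_legCo₁` (first leg) → trace cyclicity (`KernelWard.tr_comp_comm_of_bound`, product
majorant bounded × bi-localised) → `comp_legCo₂` (second leg, now adjacent) → trace cyclicity back. -/
theorem tadpole_dressK {N : ℕ} (hN : 1 ≤ N) {A K : ExpKernelCalculus.MKer (d + 1) (Fib d)} {C δ Ck δk : ℝ}
    {p q : Fin (d + 1) → ℤ} (hA : Decays A C δ) (hδ : 0 < δ) (hK : BiLoc K p q Ck δk) (hδk : 0 < δk) :
    ExpKernelCalculus.tadpole A (dressK N K) = ExpKernelCalculus.tadpole (axDressK N A) K := by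
  have hC : 0 ≤ C := hA.nonneg (Sum.inl 0)
  have hBA : Bdd A C := bdd_of_decays hA hδ.le
  have hK₂ : BiLoc (legCo₂ N K) p q (cN d N δk * Ck) δk := biLoc_legCo₂ hN hK hδk.le
  have hBK₂ : Bdd (legCo₂ N K) (cN d N δk * Ck) := bdd_of_biLoc hK₂ hδk.le
  have hBK : Bdd K Ck := bdd_of_biLoc hK hδk.le
  have hB₂ : Bdd (legAx₂ N A) ((1 + 2 * ((d + 1 : ℕ) : ℝ) * N) * C) := fun x y a b => abs_legAx₂_le hN hBA hC x y a b
  have hB₂0 : 0 ≤ (1 + 2 * ((d + 1 : ℕ) : ℝ) * N) * C := by positivity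
  have hBAA := bdd_axDressK hN hBA hC
  -- the dressed leg order: `dressK = legCo₂ ∘ legCo₁ = legCo₁ ∘ legCo₂`
  have e0 : dressK N K = legCo₁ N (legCo₂ N K) := legCo_comm N K
  -- S1: first leg onto `A`
  have e1 : ExpKernelCalculus.tr (ExpKernelCalculus.comp A (legCo₁ N (legCo₂ N K))) =
      ExpKernelCalculus.tr (ExpKernelCalculus.comp (legAx₂ N A) (legCo₂ N K)) := by
    show (∑' x, ∑ a : Fib d, ExpKernelCalculus.comp A (legCo₁ N (legCo₂ N K)) x x a a) =
      ∑' x, ∑ a : Fib d, ExpKernelCalculus.comp (legAx₂ N A) (legCo₂ N K) x x a a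
    refine tsum_congr fun x => Finset.sum_congr rfl fun a _ => ?_
    exact comp_legCo₁ hN (fun f => summable_row_of_decays hA hδ x a f) (fun y f => hBK₂ y x f a)
  -- S2: trace cyclicity
  have e2 : ExpKernelCalculus.tr (ExpKernelCalculus.comp (legAx₂ N A) (legCo₂ N K)) =
      ExpKernelCalculus.tr (ExpKernelCalculus.comp (legCo₂ N K) (legAx₂ N A)) :=
    tr_comp_comm_of_bound (prodBound_bdd_biLoc hB₂ hB₂0 hK₂ hδk)
  -- S3: second leg onto `Π A`
  have e3 : ExpKernelCalculus.tr (ExpKernelCalculus.comp (legCo₂ N K) (legAx₂ N A)) =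
      ExpKernelCalculus.tr (ExpKernelCalculus.comp K (axDressK N A)) := by
    show (∑' z, ∑ b : Fib d, ExpKernelCalculus.comp (legCo₂ N K) (legAx₂ N A) z z b b) =
      ∑' z, ∑ b : Fib d, ExpKernelCalculus.comp K (legAx₁ N (legAx₂ N A)) z z b b
    refine tsum_congr fun z => Finset.sum_congr rfl fun b _ => ?_
    exact comp_legCo₂ hN (fun y f => hBK z y b f)
      (fun f => summable_legAx₂_col hN (fun w g => summable_col_of_decays hA hδ w f g) z b)
  -- S4: trace cyclicity back
  have e4 : ExpKernelCalculus.tr (ExpKernelCalculus.comp K (axDressK N A)) =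
      ExpKernelCalculus.tr (ExpKernelCalculus.comp (axDressK N A) K) :=
    tr_comp_comm_of_bound (prodBound_biLoc_bdd hK hδk hBAA)
  show ExpKernelCalculus.tr (ExpKernelCalculus.comp A (dressK N K)) =
    ExpKernelCalculus.tr (ExpKernelCalculus.comp (axDressK N A) K)
  rw [e0, e1, e2, e3, e4]

/-- [folklore] **THE TADPOLE TERM OF `TOf (dress J)`** is the tadpole of the `Π`-CONJUGATED RESOLVENT against the UNDRESSED
second-order jet: `tadpole KInv ((dress J).W μ y ν y′) = tadpole (axDressK N KInv) (J.W μ y ν y′)`. -/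
theorem tadpole_dress_W {N : ℕ} [NeZero N] (J : JetData d N) (μ : Fin (d + 1)) (y : Fin (d + 1) → ℤ) (ν : Fin (d + 1))
    (y' : Fin (d + 1) → ℤ) :
    ExpKernelCalculus.tadpole (KInv (N := N) (d := d)) ((dress J).W μ y ν y') =
      ExpKernelCalculus.tadpole (axDressK N (KInv (N := N) (d := d))) (J.W μ y ν y') := by
  obtain ⟨δ, C, hδ, -, hA⟩ := decays_KInv (N := N) (d := d)
  rw [dress_W]
  exact tadpole_dressK (Nat.one_le_iff_ne_zero.mpr (NeZero.ne N)) hA hδ (J.loc₂ μ y ν y') J.δ_pos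

end TadpoleHalf

/-! ## §9 (v1.3) The BUBBLE HALF of the dressing lemma and the assembled statement `TOf_dress`:
`TOf (dress J) = hessKer (Π KInv Π) (axVertexOf J.S) J.W` — the typed kernel of the DRESSED jets is the resolvent Hessian kernel of
the `Π`-CONJUGATED resolvent with the UNDRESSED jets over `ℋ_tree = Π ℋ` (localisation-only hypotheses; no finite support) -/

/-! ### §9a Pointwise-summable series and finite linear combinations pass through `Π` and `Πᵀ` (both are finite `ℤ`-combinations
of values) -/

section Series

variable {n : ℕ} {ι : Type*}

/-- [folklore] A summable family under a fixed `if`. -/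
theorem summable_ite_prop {P : Prop} [Decidable P] {f : ι → ℝ} (hf : Summable f) :
    Summable fun i => (if P then f i else 0) := by
  by_cases hP : P
  · simp only [hP, if_true]; exact hf
  · simp only [hP]; exact summable_zero

/-- [folklore] A series under a fixed `if`. -/
theorem tsum_ite_prop {P : Prop} [Decidable P] (f : ι → ℝ) :
    (∑' i, (if P then f i else 0)) = if P then ∑' i, f i else 0 := by
  by_cases hP : P
  · simp only [hP, if_true]
  · simp only [hP]; exact tsum_zero

/-- [folklore] The codifferential of a pointwise-summable series of bond families is the series of the codifferentials. -/
theorem cod_tsum {g : ι → Form1 n ℝ} (hg : ∀ κ p, Summable fun i => g i κ p) (p : Fin n → ℤ) :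
    cod (fun κ p => ∑' i, g i κ p) p = ∑' i, cod (g i) p := by
  simp only [cod]
  rw [Summable.tsum_finsetSum (fun κ _ => (hg κ (p - unitVec κ)).sub (hg κ p))]
  exact Finset.sum_congr rfl fun κ _ => ((hg κ (p - unitVec κ)).tsum_sub (hg κ p)).symm

/-- [folklore] … and the family of codifferentials is summable. -/
theorem summable_family_cod {g : ι → Form1 n ℝ} (hg : ∀ κ p, Summable fun i => g i κ p) (p : Fin n → ℤ) :
    Summable fun i => cod (g i) p := by
  show Summable fun i => ∑ κ : Fin n, (g i κ (p - unitVec κ) - g i κ p)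
  exact summable_sum fun κ _ => (hg κ (p - unitVec κ)).sub (hg κ p)

/-- [folklore] The subtree sum of a pointwise-summable series of point functions is the series of the subtree sums. -/
theorem subtreeSum_tsum (L : ℕ) {h : ι → Form0 n ℝ} (hh : ∀ p, Summable fun i => h i p) (α : Fin n) (q : Fin n → ℤ) :
    subtreeSum L (fun p => ∑' i, h i p) α q = ∑' i, subtreeSum L (h i) α q := by
  have hs : ∀ c ∈ box n L, Summable fun i =>
      (if InPath L α q ((L : ℤ) • blk L q + toSite c) then h i ((L : ℤ) • blk L q + toSite c) else 0) :=
    fun c _ => summable_ite_prop (hh _)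
  simp only [subtreeSum]
  rw [Summable.tsum_finsetSum hs]
  exact Finset.sum_congr rfl fun c _ => (tsum_ite_prop _).symm

/-- [folklore] … and the family of subtree sums is summable. -/
theorem summable_family_subtreeSum (L : ℕ) {h : ι → Form0 n ℝ} (hh : ∀ p, Summable fun i => h i p) (α : Fin n)
    (q : Fin n → ℤ) : Summable fun i => subtreeSum L (h i) α q := by
  show Summable fun i => ∑ c ∈ box n L,
    (if InPath L α q ((L : ℤ) • blk L q + toSite c) then h i ((L : ℤ) • blk L q + toSite c) else 0)
  exact summable_sum fun c _ => summable_ite_prop (hh _)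

/-- [folklore] **`Πᵀ` PASSES THROUGH POINTWISE-SUMMABLE SERIES:** `Πᵀ (Σ'_i g_i) = Σ'_i Πᵀ g_i` at every bond. -/
theorem coProj_tsum (L : ℕ) {g : ι → Form1 n ℝ} (hg : ∀ κ p, Summable fun i => g i κ p) (α : Fin n) (q : Fin n → ℤ) :
    coProj L (fun κ p => ∑' i, g i κ p) α q = ∑' i, coProj L (g i) α q := by
  have hcod : ∀ p, Summable fun i => cod (g i) p := summable_family_cod hg
  have e : cod (fun κ p => ∑' i, g i κ p) = fun p => ∑' i, cod (g i) p := funext (cod_tsum hg)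
  calc coProj L (fun κ p => ∑' i, g i κ p) α q
      = (∑' i, g i α q) - subtreeSum L (fun p => ∑' i, cod (g i) p) α q := by rw [coProj_apply, e]
    _ = (∑' i, g i α q) - ∑' i, subtreeSum L (cod (g i)) α q := by
        rw [subtreeSum_tsum L (h := fun i => cod (g i)) hcod α q]
    _ = ∑' i, (g i α q - subtreeSum L (cod (g i)) α q) :=
        ((hg α q).tsum_sub (summable_family_subtreeSum L (h := fun i => cod (g i)) hcod α q)).symm
    _ = ∑' i, coProj L (g i) α q := rfl

/-- [folklore] … and the family `i ↦ Πᵀ g_i` is summable at every bond. -/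
theorem summable_family_coProj (L : ℕ) {g : ι → Form1 n ℝ} (hg : ∀ κ p, Summable fun i => g i κ p) (α : Fin n)
    (q : Fin n → ℤ) : Summable fun i => coProj L (g i) α q :=
  (hg α q).sub (summable_family_subtreeSum L (h := fun i => cod (g i)) (summable_family_cod hg) α q)

/-- [folklore] The tree integral of a pointwise-summable series is the series of the tree integrals (`1 ≤ L`). -/
theorem treeGauge_tsum {L : ℕ} (hL : 1 ≤ L) {g : ι → Form1 n ℝ} (hg : ∀ κ p, Summable fun i => g i κ p)
    (p : Fin n → ℤ) : treeGauge (fun κ p => ∑' i, g i κ p) L p = ∑' i, treeGauge (g i) L p := by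
  have hs : ∀ (α : Fin n), ∀ c ∈ box n L, Summable fun i =>
      (if InPath L α ((L : ℤ) • blk L p + toSite c) p then g i α ((L : ℤ) • blk L p + toSite c) else 0) :=
    fun α c _ => summable_ite_prop (hg _ _)
  have e : ∀ A : Form1 n ℝ, treeGauge A L p = ∑ α : Fin n, ∑ c ∈ box n L,
      (if InPath L α ((L : ℤ) • blk L p + toSite c) p then A α ((L : ℤ) • blk L p + toSite c) else 0) :=
    fun A => treeGauge_eq_sum_inPath hL A p
  simp only [e]
  rw [Summable.tsum_finsetSum (fun α _ => summable_sum (hs α))]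
  refine Finset.sum_congr rfl fun α _ => ?_
  rw [Summable.tsum_finsetSum (hs α)]
  exact Finset.sum_congr rfl fun c _ => (tsum_ite_prop _).symm

/-- [folklore] … and the family of tree integrals is summable. -/
theorem summable_family_treeGauge {L : ℕ} (hL : 1 ≤ L) {g : ι → Form1 n ℝ} (hg : ∀ κ p, Summable fun i => g i κ p)
    (p : Fin n → ℤ) : Summable fun i => treeGauge (g i) L p := by
  have e : ∀ A : Form1 n ℝ, treeGauge A L p = ∑ α : Fin n, ∑ c ∈ box n L,
      (if InPath L α ((L : ℤ) • blk L p + toSite c) p then A α ((L : ℤ) • blk L p + toSite c) else 0) :=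
    fun A => treeGauge_eq_sum_inPath hL A p
  simp only [e]
  exact summable_sum fun α _ => summable_sum fun c _ => summable_ite_prop (hg _ _)

/-- [folklore] **`Π` PASSES THROUGH POINTWISE-SUMMABLE SERIES:** `Π (Σ'_i g_i) = Σ'_i Π g_i` at every bond (`1 ≤ L`). -/
theorem axProj_tsum {L : ℕ} (hL : 1 ≤ L) {g : ι → Form1 n ℝ} (hg : ∀ κ p, Summable fun i => g i κ p) (α : Fin n)
    (x : Fin n → ℤ) : axProj L (fun κ p => ∑' i, g i κ p) α x = ∑' i, axProj L (g i) α x := by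
  have hT := summable_family_treeGauge hL hg
  rw [axProj_apply, treeGauge_tsum hL hg, treeGauge_tsum hL hg, ← (hT _).tsum_sub (hT _),
    ← (hg α x).tsum_sub ((hT _).sub (hT _))]
  rfl

/-- [folklore] … and the family `i ↦ Π g_i` is summable at every bond. -/
theorem summable_family_axProj {L : ℕ} (hL : 1 ≤ L) {g : ι → Form1 n ℝ} (hg : ∀ κ p, Summable fun i => g i κ p)
    (α : Fin n) (x : Fin n → ℤ) : Summable fun i => axProj L (g i) α x := by
  have hT := summable_family_treeGauge hL hg
  exact (hg α x).sub ((hT _).sub (hT _))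

/-- [folklore] `Πᵀ` as an additive map: `coProjHom L g = Πᵀ g`. -/
theorem coProjHom_apply (L : ℕ) (g : Form1 n ℝ) : coProjHom L g = coProj L g := rfl

/-- [folklore] `Π` as an additive endomorphism of bond families. -/
def axProjHom {R : Type*} [AddCommGroup R] (L : ℕ) : Form1 n R →+ Form1 n R where
  toFun := axProj L
  map_zero' := AxialProjector.axProj_zero L
  map_add' := AxialProjector.axProj_add L

/-- [folklore] `axProjHom L A = Π A`. -/
theorem axProjHom_apply {R : Type*} [AddCommGroup R] (L : ℕ) (A : Form1 n R) : axProjHom L A = axProj L A := rfl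

/-- [folklore] `Πᵀ` of a left multiple. -/
theorem coProj_mul_left (L : ℕ) (c : ℝ) (g : Form1 n ℝ) (α : Fin n) (q : Fin n → ℤ) :
    coProj L (fun κ p => c * g κ p) α q = c * coProj L g α q := by
  have h := coProj_map L (AddMonoidHom.mulLeft c) g α q
  simp only [AddMonoidHom.coe_mulLeft] at h
  exact h

/-- [folklore] `Π` of a left multiple. -/
theorem axProj_mul_left (L : ℕ) (c : ℝ) (A : Form1 n ℝ) (α : Fin n) (x : Fin n → ℤ) :
    axProj L (fun κ p => c * A κ p) α x = c * axProj L A α x := by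
  have h := AxialProjector.axProj_map (AddMonoidHom.mulLeft c) A L α x
  simp only [AddMonoidHom.coe_mulLeft] at h
  exact h

/-- [folklore] `Π` of a right multiple. -/
theorem axProj_mul_right (L : ℕ) (c : ℝ) (A : Form1 n ℝ) (α : Fin n) (x : Fin n → ℤ) :
    axProj L (fun κ p => A κ p * c) α x = axProj L A α x * c := by
  have h := AxialProjector.axProj_map (AddMonoidHom.mulRight c) A L α x
  simp only [AddMonoidHom.coe_mulRight] at h
  exact h

/-- [folklore] `Πᵀ` of a finite sum of bond families. -/
theorem coProj_finset_sum (L : ℕ) (s : Finset ι) (g : ι → Form1 n ℝ) (α : Fin n) (q : Fin n → ℤ) :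
    coProj L (fun κ p => ∑ i ∈ s, g i κ p) α q = ∑ i ∈ s, coProj L (g i) α q := by
  have e : (fun κ p => ∑ i ∈ s, g i κ p) = ∑ i ∈ s, g i := by
    funext κ p
    simp only [Finset.sum_apply]
  have h := congrFun (congrFun (map_sum (coProjHom L) g s) α) q
  simp only [Finset.sum_apply, coProjHom_apply] at h
  rw [e]
  exact h

/-- [folklore] `Π` of a finite sum of bond families. -/
theorem axProj_finset_sum (L : ℕ) (s : Finset ι) (A : ι → Form1 n ℝ) (α : Fin n) (x : Fin n → ℤ) :
    axProj L (fun κ p => ∑ i ∈ s, A i κ p) α x = ∑ i ∈ s, axProj L (A i) α x := by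
  have e : (fun κ p => ∑ i ∈ s, A i κ p) = ∑ i ∈ s, A i := by
    funext κ p
    simp only [Finset.sum_apply]
  have h := congrFun (congrFun (map_sum (axProjHom L) A s) α) x
  simp only [Finset.sum_apply, axProjHom_apply] at h
  rw [e]
  exact h

end Series

/-! ### §9b The leg maps pass through pointwise-summable series and through row/column combinations of kernel tables; the
outward exchanges `comp A (legCo₂ K) = legCo₂ (comp A K)`, `legAx₁ (comp A K) = comp (legAx₁ A) K`; `legAx₁` commutes with `legCo₂` -/

section LegSeries

variable {d : ℕ} {ι : Type*}

/-- [folklore] `legCo₁` passes through a pointwise-summable series of kernel tables. -/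
theorem legCo₁_tsum (N : ℕ) {F : ι → ExpKernelCalculus.MKer (d + 1) (Fib d)} (hF : ∀ x z a b, Summable fun i => F i x z a b)
    (x z : Fin (d + 1) → ℤ) (a b : Fib d) :
    legCo₁ N (fun x z a b => ∑' i, F i x z a b) x z a b = ∑' i, legCo₁ N (F i) x z a b := by
  cases a with
  | inr m => rfl
  | inl α =>
    exact coProj_tsum N (g := fun i α' x' => F i x' z (Sum.inl α') b) (fun κ p => hF p z (Sum.inl κ) b) α x

/-- [folklore] … and the family `i ↦ legCo₁ (F i)` is pointwise summable. -/
theorem summable_family_legCo₁ (N : ℕ) {F : ι → ExpKernelCalculus.MKer (d + 1) (Fib d)}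
    (hF : ∀ x z a b, Summable fun i => F i x z a b) (x z : Fin (d + 1) → ℤ) (a b : Fib d) :
    Summable fun i => legCo₁ N (F i) x z a b := by
  cases a with
  | inr m => exact hF x z (Sum.inr m) b
  | inl α =>
    exact summable_family_coProj N (g := fun i α' x' => F i x' z (Sum.inl α') b) (fun κ p => hF p z (Sum.inl κ) b) α x

/-- [folklore] `legCo₂` passes through a pointwise-summable series of kernel tables. -/
theorem legCo₂_tsum (N : ℕ) {F : ι → ExpKernelCalculus.MKer (d + 1) (Fib d)} (hF : ∀ x z a b, Summable fun i => F i x z a b)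
    (x z : Fin (d + 1) → ℤ) (a b : Fib d) :
    legCo₂ N (fun x z a b => ∑' i, F i x z a b) x z a b = ∑' i, legCo₂ N (F i) x z a b := by
  cases b with
  | inr m => rfl
  | inl β =>
    exact coProj_tsum N (g := fun i β' z' => F i x z' a (Sum.inl β')) (fun κ p => hF x p a (Sum.inl κ)) β z

/-- [folklore] … and the family `i ↦ legCo₂ (F i)` is pointwise summable. -/
theorem summable_family_legCo₂ (N : ℕ) {F : ι → ExpKernelCalculus.MKer (d + 1) (Fib d)}
    (hF : ∀ x z a b, Summable fun i => F i x z a b) (x z : Fin (d + 1) → ℤ) (a b : Fib d) :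
    Summable fun i => legCo₂ N (F i) x z a b := by
  cases b with
  | inr m => exact hF x z a (Sum.inr m)
  | inl β =>
    exact summable_family_coProj N (g := fun i β' z' => F i x z' a (Sum.inl β')) (fun κ p => hF x p a (Sum.inl κ)) β z

/-- [folklore] `dressK` passes through a pointwise-summable series of kernel tables. -/
theorem dressK_tsum (N : ℕ) {F : ι → ExpKernelCalculus.MKer (d + 1) (Fib d)} (hF : ∀ x z a b, Summable fun i => F i x z a b)
    (x z : Fin (d + 1) → ℤ) (a b : Fib d) :
    dressK N (fun x z a b => ∑' i, F i x z a b) x z a b = ∑' i, dressK N (F i) x z a b := by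
  have h1 : legCo₁ N (fun x z a b => ∑' i, F i x z a b) = fun x z a b => ∑' i, legCo₁ N (F i) x z a b :=
    funext fun x => funext fun z => funext fun a => funext fun b => legCo₁_tsum N hF x z a b
  show legCo₂ N (legCo₁ N (fun x z a b => ∑' i, F i x z a b)) x z a b = ∑' i, legCo₂ N (legCo₁ N (F i)) x z a b
  rw [h1]
  exact legCo₂_tsum N (summable_family_legCo₁ N hF) x z a b

/-- [folklore] `legAx₁` passes through a pointwise-summable series of kernel tables (`1 ≤ N`). -/
theorem legAx₁_tsum {N : ℕ} (hN : 1 ≤ N) {F : ι → ExpKernelCalculus.MKer (d + 1) (Fib d)}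
    (hF : ∀ x z a b, Summable fun i => F i x z a b) (x z : Fin (d + 1) → ℤ) (a b : Fib d) :
    legAx₁ N (fun x z a b => ∑' i, F i x z a b) x z a b = ∑' i, legAx₁ N (F i) x z a b := by
  cases a with
  | inr m => rfl
  | inl α =>
    exact axProj_tsum hN (g := fun i α' x' => F i x' z (Sum.inl α') b) (fun κ p => hF p z (Sum.inl κ) b) α x

/-- [folklore] `legCo₁` of a left multiple. -/
theorem legCo₁_mul_left (N : ℕ) (c : ℝ) (K : ExpKernelCalculus.MKer (d + 1) (Fib d)) (x z : Fin (d + 1) → ℤ) (a b : Fib d) :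
    legCo₁ N (fun x z a b => c * K x z a b) x z a b = c * legCo₁ N K x z a b := by
  cases a with
  | inr m => rfl
  | inl α => exact coProj_mul_left N c (fun α' x' => K x' z (Sum.inl α') b) α x

/-- [folklore] `legCo₂` of a left multiple. -/
theorem legCo₂_mul_left (N : ℕ) (c : ℝ) (K : ExpKernelCalculus.MKer (d + 1) (Fib d)) (x z : Fin (d + 1) → ℤ) (a b : Fib d) :
    legCo₂ N (fun x z a b => c * K x z a b) x z a b = c * legCo₂ N K x z a b := by
  cases b with
  | inr m => rfl
  | inl β => exact coProj_mul_left N c (fun β' z' => K x z' a (Sum.inl β')) β z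

/-- [folklore] `dressK` of a left multiple. -/
theorem dressK_mul_left (N : ℕ) (c : ℝ) (K : ExpKernelCalculus.MKer (d + 1) (Fib d)) (x z : Fin (d + 1) → ℤ) (a b : Fib d) :
    dressK N (fun x z a b => c * K x z a b) x z a b = c * dressK N K x z a b := by
  have h1 : legCo₁ N (fun x z a b => c * K x z a b) = fun x z a b => c * legCo₁ N K x z a b :=
    funext fun x => funext fun z => funext fun a => funext fun b => legCo₁_mul_left N c K x z a b
  show legCo₂ N (legCo₁ N (fun x z a b => c * K x z a b)) x z a b = c * legCo₂ N (legCo₁ N K) x z a b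
  rw [h1]
  exact legCo₂_mul_left N c (legCo₁ N K) x z a b

/-- [folklore] `legCo₁` of a finite sum of kernel tables. -/
theorem legCo₁_finset_sum (N : ℕ) (s : Finset ι) (K : ι → ExpKernelCalculus.MKer (d + 1) (Fib d)) (x z : Fin (d + 1) → ℤ)
    (a b : Fib d) : legCo₁ N (fun x z a b => ∑ i ∈ s, K i x z a b) x z a b = ∑ i ∈ s, legCo₁ N (K i) x z a b := by
  cases a with
  | inr m => rfl
  | inl α => exact coProj_finset_sum N s (fun i α' x' => K i x' z (Sum.inl α') b) α x

/-- [folklore] `legCo₂` of a finite sum of kernel tables. -/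
theorem legCo₂_finset_sum (N : ℕ) (s : Finset ι) (K : ι → ExpKernelCalculus.MKer (d + 1) (Fib d)) (x z : Fin (d + 1) → ℤ)
    (a b : Fib d) : legCo₂ N (fun x z a b => ∑ i ∈ s, K i x z a b) x z a b = ∑ i ∈ s, legCo₂ N (K i) x z a b := by
  cases b with
  | inr m => rfl
  | inl β => exact coProj_finset_sum N s (fun i β' z' => K i x z' a (Sum.inl β')) β z

/-- [folklore] `dressK` of a finite sum of kernel tables. -/
theorem dressK_finset_sum (N : ℕ) (s : Finset ι) (K : ι → ExpKernelCalculus.MKer (d + 1) (Fib d)) (x z : Fin (d + 1) → ℤ)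
    (a b : Fib d) : dressK N (fun x z a b => ∑ i ∈ s, K i x z a b) x z a b = ∑ i ∈ s, dressK N (K i) x z a b := by
  have h1 : legCo₁ N (fun x z a b => ∑ i ∈ s, K i x z a b) = fun x z a b => ∑ i ∈ s, legCo₁ N (K i) x z a b :=
    funext fun x => funext fun z => funext fun a => funext fun b => legCo₁_finset_sum N s K x z a b
  show legCo₂ N (legCo₁ N (fun x z a b => ∑ i ∈ s, K i x z a b)) x z a b = ∑ i ∈ s, legCo₂ N (legCo₁ N (K i)) x z a b
  rw [h1]
  exact legCo₂_finset_sum N s (fun i => legCo₁ N (K i)) x z a b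

/-- [folklore] `legCo₂` of the `y`-th summand of a composition (the second leg sits in the right factor only):
`legCo₂ (Σ_f B(x,y)_{af} K(y,·)_{f·}) = Σ_f B(x,y)_{af} (legCo₂ K)(y,·)_{f·}`. -/
theorem legCo₂_rowComb (N : ℕ) (B K : ExpKernelCalculus.MKer (d + 1) (Fib d)) (x y z : Fin (d + 1) → ℤ) (a b : Fib d) :
    legCo₂ N (fun x' z' a' b' => ∑ f : Fib d, B x' y a' f * K y z' f b') x z a b = ∑ f : Fib d, B x y a f * legCo₂ N K y z f b := by
  cases b with
  | inr m => rfl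
  | inl β =>
    calc coProj N (fun β' z' => ∑ f : Fib d, B x y a f * K y z' f (Sum.inl β')) β z
        = ∑ f : Fib d, coProj N (fun β' z' => B x y a f * K y z' f (Sum.inl β')) β z :=
          coProj_finset_sum N Finset.univ (fun f β' z' => B x y a f * K y z' f (Sum.inl β')) β z
      _ = ∑ f : Fib d, B x y a f * legCo₂ N K y z f (Sum.inl β) :=
          Finset.sum_congr rfl fun f _ => coProj_mul_left N (B x y a f) (fun β' z' => K y z' f (Sum.inl β')) β z

/-- [folklore] `legAx₁` of the `y`-th summand of a composition (the first leg sits in the left factor only):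
`legAx₁ (Σ_f B(·,y)_{·f} K(y,z)_{fb}) = Σ_f (legAx₁ B)(·,y)_{·f} K(y,z)_{fb}`. -/
theorem legAx₁_colComb (N : ℕ) (B K : ExpKernelCalculus.MKer (d + 1) (Fib d)) (x y z : Fin (d + 1) → ℤ) (a b : Fib d) :
    legAx₁ N (fun x' z' a' b' => ∑ f : Fib d, B x' y a' f * K y z' f b') x z a b = ∑ f : Fib d, legAx₁ N B x y a f * K y z f b := by
  cases a with
  | inr m => rfl
  | inl α =>
    calc axProj N (fun α' x' => ∑ f : Fib d, B x' y (Sum.inl α') f * K y z f b) α x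
        = ∑ f : Fib d, axProj N (fun α' x' => B x' y (Sum.inl α') f * K y z f b) α x :=
          axProj_finset_sum N Finset.univ (fun f α' x' => B x' y (Sum.inl α') f * K y z f b) α x
      _ = ∑ f : Fib d, legAx₁ N B x y (Sum.inl α) f * K y z f b :=
          Finset.sum_congr rfl fun f _ => axProj_mul_right N (K y z f b) (fun α' x' => B x' y (Sum.inl α') f) α x

/-- [folklore] **`Πᵀ` ON THE OUTER SECOND LEG PASSES OUT OF A COMPOSITION:** `A ∘ (legCo₂ K) = legCo₂ (A ∘ K)` whenever the
composition series converge (`Πᵀ` acts on the free column index `(z, b)`, the series runs over the contracted index `y`). -/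
theorem comp_legCo₂_out (N : ℕ) {B K : ExpKernelCalculus.MKer (d + 1) (Fib d)}
    (hs : ∀ x z a b, Summable fun y => ∑ f : Fib d, B x y a f * K y z f b) :
    ExpKernelCalculus.comp B (legCo₂ N K) = legCo₂ N (ExpKernelCalculus.comp B K) := by
  funext x z a b
  symm
  calc legCo₂ N (ExpKernelCalculus.comp B K) x z a b
      = ∑' y, legCo₂ N (fun x' z' a' b' => ∑ f : Fib d, B x' y a' f * K y z' f b') x z a b :=
        legCo₂_tsum N (F := fun y x' z' a' b' => ∑ f : Fib d, B x' y a' f * K y z' f b') hs x z a b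
    _ = ∑' y, ∑ f : Fib d, B x y a f * legCo₂ N K y z f b := tsum_congr fun y => legCo₂_rowComb N B K x y z a b
    _ = ExpKernelCalculus.comp B (legCo₂ N K) x z a b := rfl

/-- [folklore] **`Π` ON THE OUTER FIRST LEG PASSES INTO THE LEFT FACTOR:** `legAx₁ (B ∘ K) = (legAx₁ B) ∘ K` whenever the
composition series converge (`1 ≤ N`). -/
theorem legAx₁_comp {N : ℕ} (hN : 1 ≤ N) {B K : ExpKernelCalculus.MKer (d + 1) (Fib d)}
    (hs : ∀ x z a b, Summable fun y => ∑ f : Fib d, B x y a f * K y z f b) :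
    legAx₁ N (ExpKernelCalculus.comp B K) = ExpKernelCalculus.comp (legAx₁ N B) K := by
  funext x z a b
  calc legAx₁ N (ExpKernelCalculus.comp B K) x z a b
      = ∑' y, legAx₁ N (fun x' z' a' b' => ∑ f : Fib d, B x' y a' f * K y z' f b') x z a b :=
        legAx₁_tsum hN (F := fun y x' z' a' b' => ∑ f : Fib d, B x' y a' f * K y z' f b') hs x z a b
    _ = ∑' y, ∑ f : Fib d, legAx₁ N B x y a f * K y z f b := tsum_congr fun y => legAx₁_colComb N B K x y z a b
    _ = ExpKernelCalculus.comp (legAx₁ N B) K x z a b := rfl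

/-- [folklore] **`Π` ON THE FIRST LEG COMMUTES WITH `Πᵀ` ON THE SECOND LEG** (they act on different legs; letter-level transport
`AxialProjector.axProj_map` / `coProj_map`). -/
theorem legAx₁_legCo₂_comm (N : ℕ) (M : ExpKernelCalculus.MKer (d + 1) (Fib d)) :
    legAx₁ N (legCo₂ N M) = legCo₂ N (legAx₁ N M) := by
  funext x y a b
  cases a with
  | inr m =>
    cases b with
    | inr m' => rfl
    | inl β => rfl
  | inl α =>
    cases b with
    | inr m' => rfl
    | inl β =>
      let k : Form1 (d + 1) (Form1 (d + 1) ℝ) := fun α' x' β' y' => M x' y' (Sum.inl α') (Sum.inl β')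
      have h1 : (fun β' y' => legAx₁ N M x y' (Sum.inl α) (Sum.inl β')) = axProj N k α x := by
        funext β' y'
        exact AxialProjector.axProj_map (evHom β' y') k N α x
      have h2 : (fun α' x' => legCo₂ N M x' y (Sum.inl α') (Sum.inl β)) =
          fun α' x' => evHom β y (coProjHom N (k α' x')) := rfl
      show axProj N (fun α' x' => legCo₂ N M x' y (Sum.inl α') (Sum.inl β)) α x =
        coProj N (fun β' y' => legAx₁ N M x y' (Sum.inl α) (Sum.inl β')) β y
      rw [h1, h2, AxialProjector.axProj_map (evHom β y) (fun α' x' => coProjHom N (k α' x')) N α x,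
        AxialProjector.axProj_map (coProjHom N) k N α x]
      rfl

end LegSeries

/-! ### §9c `Π`-legged resolvents DECAY (rate kept, constant `cAx` per leg); rows/columns of bi-localised kernels are summable -/

section AxDecay

variable {d : ℕ}

/-- [folklore] A point in the block of `x`, or in the block of `x + e_κ`, is at `ℓ¹`-distance `≤ (d+1)·N + 1` from `x` (`1 ≤ N`)
(the «near» shape of `AxialProjector.abs_axProj_le`). -/
theorem l1_sub_le_of_near' {N : ℕ} (hN : 1 ≤ N) {x q : Fin (d + 1) → ℤ} {κ : Fin (d + 1)}
    (h : blk N q = blk N x ∨ blk N q = blk N (x + unitVec κ)) : l1 (x - q) ≤ ((d : ℝ) + 1) * N + 1 := by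
  rcases h with h | h
  · have := l1_sub_le_of_blk_eq hN h
    linarith
  · have h1 := l1_sub_le_of_blk_eq hN h
    have h2 : l1 (x - q) ≤ l1 (x - (x + unitVec κ)) + l1 ((x + unitVec κ) - q) := l1_sub_triangle x (x + unitVec κ) q
    have h3 : l1 (x - (x + unitVec κ)) = 1 := by
      rw [l1_sub_symm, add_sub_cancel_left]
      unfold l1
      simp [unitVec_apply, apply_ite abs, Finset.sum_ite_eq', Finset.mem_univ]
    linarith

/-- [folklore] Re-centring a decay bound in the column variable: `ℓ¹(y − q) ≤ r ⇒ C·e^{−δℓ¹(x−q)} ≤ C·e^{δr}·e^{−δℓ¹(x−y)}`. -/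
theorem exp_recenter_col {x y q : Fin (d + 1) → ℤ} {r C δ : ℝ} (hr : l1 (y - q) ≤ r) (hC : 0 ≤ C) (hδ : 0 ≤ δ) :
    C * Real.exp (-δ * l1 (x - q)) ≤ C * Real.exp (δ * r) * Real.exp (-δ * l1 (x - y)) := by
  have tri : l1 (x - y) ≤ l1 (x - q) + l1 (q - y) := l1_sub_triangle x q y
  rw [l1_sub_symm q y] at tri
  rw [mul_assoc, ← Real.exp_add]
  refine mul_le_mul_of_nonneg_left (Real.exp_le_exp.2 ?_) hC
  nlinarith [mul_nonneg hδ (show 0 ≤ l1 (x - q) + r - l1 (x - y) by linarith)]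

/-- [folklore] Re-centring a decay bound in the row variable: `ℓ¹(x − q) ≤ r ⇒ C·e^{−δℓ¹(q−y)} ≤ C·e^{δr}·e^{−δℓ¹(x−y)}`. -/
theorem exp_recenter_row {x y q : Fin (d + 1) → ℤ} {r C δ : ℝ} (hr : l1 (x - q) ≤ r) (hC : 0 ≤ C) (hδ : 0 ≤ δ) :
    C * Real.exp (-δ * l1 (q - y)) ≤ C * Real.exp (δ * r) * Real.exp (-δ * l1 (x - y)) := by
  have tri : l1 (x - y) ≤ l1 (x - q) + l1 (q - y) := l1_sub_triangle x q y
  rw [mul_assoc, ← Real.exp_add]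
  refine mul_le_mul_of_nonneg_left (Real.exp_le_exp.2 ?_) hC
  nlinarith [mul_nonneg hδ (show 0 ≤ r + l1 (q - y) - l1 (x - y) by linarith)]

/-- [folklore] The `Π`-leg constant: `cAx δ := (1 + 2(d+1)·N) · exp(δ((d+1)N + 1))`. -/
noncomputable def cAx (d N : ℕ) (δ : ℝ) : ℝ :=
  (1 + 2 * ((d : ℝ) + 1) * N) * Real.exp (δ * (((d : ℝ) + 1) * N + 1))

/-- [folklore] `1 ≤ cAx`. -/
theorem one_le_cAx (d N : ℕ) {δ : ℝ} (hδ : 0 ≤ δ) : 1 ≤ cAx d N δ := by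
  unfold cAx
  have h1 : (1 : ℝ) ≤ 1 + 2 * ((d : ℝ) + 1) * N := by
    have : (0 : ℝ) ≤ 2 * ((d : ℝ) + 1) * N := by positivity
    linarith
  have h2 : (1 : ℝ) ≤ Real.exp (δ * (((d : ℝ) + 1) * N + 1)) := Real.one_le_exp (by positivity)
  nlinarith

/-- [folklore] `0 ≤ cAx`. -/
theorem cAx_nonneg (d N : ℕ) (δ : ℝ) : 0 ≤ cAx d N δ := by
  unfold cAx
  positivity

/-- [folklore] **`Π` ON THE SECOND LEG OF A DECAYING KERNEL DECAYS** at the same rate: `Decays A C δ ⇒ Decays (legAx₂ N A) (cAx·C) δ`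
(`1 ≤ N`, `0 ≤ δ`; `Π` reads `A` on two blocks around the second endpoint, `AxialProjector.abs_axProj_le`). -/
theorem decays_legAx₂ {N : ℕ} (hN : 1 ≤ N) {A : ExpKernelCalculus.MKer (d + 1) (Fib d)} {C δ : ℝ} (hA : Decays A C δ)
    (hδ : 0 ≤ δ) : Decays (legAx₂ N A) (cAx d N δ * C) δ := by
  have hC : 0 ≤ C := hA.nonneg (Sum.inl 0)
  intro x y a b
  cases b with
  | inr m =>
    rw [legAx₂_inr]
    calc |A x y a (Sum.inr m)| ≤ C * Real.exp (-δ * l1 (x - y)) := hA x y a _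
      _ ≤ cAx d N δ * C * Real.exp (-δ * l1 (x - y)) := by
          have h1 := one_le_cAx d N hδ
          have h2 : 0 ≤ C * Real.exp (-δ * l1 (x - y)) := by positivity
          nlinarith
  | inl β =>
    rw [legAx₂_inl]
    have hM0 : 0 ≤ C * Real.exp (δ * (((d : ℝ) + 1) * N + 1)) * Real.exp (-δ * l1 (x - y)) := by positivity
    have hM : ∀ (κ : Fin (d + 1)) (q : Fin (d + 1) → ℤ), (blk N q = blk N y ∨ blk N q = blk N (y + unitVec β)) →
        |A x q a (Sum.inl κ)| ≤ C * Real.exp (δ * (((d : ℝ) + 1) * N + 1)) * Real.exp (-δ * l1 (x - y)) :=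
      fun κ q hq => (hA x q a _).trans (exp_recenter_col (l1_sub_le_of_near' hN hq) hC hδ)
    calc |axProj N (fun β' y' => A x y' a (Sum.inl β')) β y|
        ≤ (1 + 2 * ((d + 1 : ℕ) : ℝ) * N) * (C * Real.exp (δ * (((d : ℝ) + 1) * N + 1)) * Real.exp (-δ * l1 (x - y))) :=
          abs_axProj_le hN _ β y hM0 hM
      _ = cAx d N δ * C * Real.exp (-δ * l1 (x - y)) := by
          unfold cAx
          push_cast
          ring

/-- [folklore] **`Π` ON THE FIRST LEG OF A DECAYING KERNEL DECAYS** at the same rate: `Decays A C δ ⇒ Decays (legAx₁ N A) (cAx·C) δ`. -/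
theorem decays_legAx₁ {N : ℕ} (hN : 1 ≤ N) {A : ExpKernelCalculus.MKer (d + 1) (Fib d)} {C δ : ℝ} (hA : Decays A C δ)
    (hδ : 0 ≤ δ) : Decays (legAx₁ N A) (cAx d N δ * C) δ := by
  have hC : 0 ≤ C := hA.nonneg (Sum.inl 0)
  intro x y a b
  cases a with
  | inr m =>
    rw [legAx₁_inr]
    calc |A x y (Sum.inr m) b| ≤ C * Real.exp (-δ * l1 (x - y)) := hA x y _ b
      _ ≤ cAx d N δ * C * Real.exp (-δ * l1 (x - y)) := by
          have h1 := one_le_cAx d N hδ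
          have h2 : 0 ≤ C * Real.exp (-δ * l1 (x - y)) := by positivity
          nlinarith
  | inl α =>
    rw [legAx₁_inl]
    have hM0 : 0 ≤ C * Real.exp (δ * (((d : ℝ) + 1) * N + 1)) * Real.exp (-δ * l1 (x - y)) := by positivity
    have hM : ∀ (κ : Fin (d + 1)) (q : Fin (d + 1) → ℤ), (blk N q = blk N x ∨ blk N q = blk N (x + unitVec α)) →
        |A q y (Sum.inl κ) b| ≤ C * Real.exp (δ * (((d : ℝ) + 1) * N + 1)) * Real.exp (-δ * l1 (x - y)) :=
      fun κ q hq => (hA q y _ b).trans (exp_recenter_row (l1_sub_le_of_near' hN hq) hC hδ)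
    calc |axProj N (fun α' x' => A x' y (Sum.inl α') b) α x|
        ≤ (1 + 2 * ((d + 1 : ℕ) : ℝ) * N) * (C * Real.exp (δ * (((d : ℝ) + 1) * N + 1)) * Real.exp (-δ * l1 (x - y))) :=
          abs_axProj_le hN _ α x hM0 hM
      _ = cAx d N δ * C * Real.exp (-δ * l1 (x - y)) := by
          unfold cAx
          push_cast
          ring

/-- [folklore] **THE `Π`-CONJUGATED RESOLVENT DECAYS:** `Decays A C δ ⇒ Decays (axDressK N A) (cAx²·C) δ`. -/
theorem decays_axDressK {N : ℕ} (hN : 1 ≤ N) {A : ExpKernelCalculus.MKer (d + 1) (Fib d)} {C δ : ℝ} (hA : Decays A C δ)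
    (hδ : 0 ≤ δ) : Decays (axDressK N A) (cAx d N δ * (cAx d N δ * C)) δ :=
  decays_legAx₁ hN (decays_legAx₂ hN hA hδ) hδ

/-- [folklore] A column of a bi-localised kernel (rate `δ > 0`) is summable. -/
theorem summable_col_of_biLoc {K : ExpKernelCalculus.MKer (d + 1) (Fib d)} {p q : Fin (d + 1) → ℤ} {C δ : ℝ}
    (hK : BiLoc K p q C δ) (hδ : 0 < δ) (z : Fin (d + 1) → ℤ) (f b : Fib d) : Summable fun y => K y z f b := by
  have hC : 0 ≤ C := hK.nonneg (Sum.inl 0)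
  refine Summable.of_norm_bounded ((summable_exp_shift' hδ p).mul_left C) (fun y => ?_)
  rw [Real.norm_eq_abs]
  refine (hK y z f b).trans (mul_le_mul_of_nonneg_left (Real.exp_le_exp.2 ?_) hC)
  nlinarith [l1_nonneg (z - q), hδ.le]

/-- [folklore] A row of a bi-localised kernel (rate `δ > 0`) is summable. -/
theorem summable_row_of_biLoc {K : ExpKernelCalculus.MKer (d + 1) (Fib d)} {p q : Fin (d + 1) → ℤ} {C δ : ℝ}
    (hK : BiLoc K p q C δ) (hδ : 0 < δ) (x : Fin (d + 1) → ℤ) (a f : Fib d) : Summable fun y => K x y a f := by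
  have hC : 0 ≤ C := hK.nonneg (Sum.inl 0)
  refine Summable.of_norm_bounded ((summable_exp_shift' hδ q).mul_left C) (fun y => ?_)
  rw [Real.norm_eq_abs]
  refine (hK x y a f).trans (mul_le_mul_of_nonneg_left (Real.exp_le_exp.2 ?_) hC)
  nlinarith [l1_nonneg (x - p), hδ.le]

end AxDecay

/-! ### §9d The chain-rule vertex of DRESSED stencils: `vertexOf (dressK ∘ S) = dressK (vertexOf S)` (the leg dressings pass through
the `u`-series), and the `Π`-dressed chain-rule vertex `axVertexOf` (undressed stencils, `Π`-dressed `ℋ`-column weights) -/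

section VertexDress

variable {d : ℕ}

/-- [folklore] `dressK` passes through a weighted superposition whose series converge pointwise. -/
theorem dressK_wsum (N : ℕ) {w : (Fin (d + 1) → ℤ) → ℝ} {T : (Fin (d + 1) → ℤ) → ExpKernelCalculus.MKer (d + 1) (Fib d)}
    (hs : ∀ x z a b, Summable fun u => w u * T u x z a b) :
    dressK N (wsum w T) = wsum w (fun u => dressK N (T u)) := by
  funext x z a b
  calc dressK N (wsum w T) x z a b
      = ∑' u, dressK N (fun x z a b => w u * T u x z a b) x z a b :=
        dressK_tsum N (F := fun u x z a b => w u * T u x z a b) hs x z a b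
    _ = ∑' u, w u * dressK N (T u) x z a b := tsum_congr fun u => dressK_mul_left N (w u) (T u) x z a b
    _ = wsum w (fun u => dressK N (T u)) x z a b := rfl

/-- [folklore] The `ℋ`-column weights against a local stencil family give pointwise-convergent superposition series
(`KernelSpecInstance.decay_wH`: the weights are bounded; the stencil decays from its own index). -/
theorem summable_wH_mul_stencil {N : ℕ} [NeZero N]
    {T : Fin (d + 1) → (Fin (d + 1) → ℤ) → ExpKernelCalculus.MKer (d + 1) (Fib d)} {Ct δt : ℝ} (hT : LocStencil T Ct δt)
    (hδt : 0 < δt) (κ μ : Fin (d + 1)) (y x z : Fin (d + 1) → ℤ) (a b : Fib d) :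
    Summable fun u => wH (N := N) κ μ (u - (N : ℤ) • y) * T κ u x z a b := by
  obtain ⟨δw, Cw, hδw, hwH⟩ := decay_wH (N := N) (d := d)
  have hCw : 0 ≤ Cw := by
    have h0 := hwH 0 0 0
    simp only [l1, Pi.zero_apply, Int.cast_zero, abs_zero, Finset.sum_const_zero, mul_zero, Real.exp_zero, mul_one] at h0
    exact (abs_nonneg _).trans h0
  have hCt : 0 ≤ Ct := (hT κ 0).nonneg (Sum.inl 0)
  refine Summable.of_norm_bounded ((summable_exp_shift hδt x).mul_left (Cw * Ct)) (fun u => ?_)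
  rw [Real.norm_eq_abs, abs_mul]
  have h1 : |wH (N := N) κ μ (u - (N : ℤ) • y)| ≤ Cw := by
    have he : Real.exp (-δw * l1 (u - (N : ℤ) • y)) ≤ 1 := by
      rw [Real.exp_le_one_iff]
      nlinarith [l1_nonneg (u - (N : ℤ) • y), hδw.le]
    calc |wH (N := N) κ μ (u - (N : ℤ) • y)| ≤ Cw * Real.exp (-δw * l1 (u - (N : ℤ) • y)) := hwH κ μ _
      _ ≤ Cw * 1 := mul_le_mul_of_nonneg_left he hCw
      _ = Cw := mul_one _
  have h2 : |T κ u x z a b| ≤ Ct * Real.exp (-δt * l1 (x - u)) := by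
    refine (hT κ u x z a b).trans (mul_le_mul_of_nonneg_left (Real.exp_le_exp.2 ?_) hCt)
    nlinarith [l1_nonneg (z - u), hδt.le]
  calc |wH (N := N) κ μ (u - (N : ℤ) • y)| * |T κ u x z a b| ≤ Cw * (Ct * Real.exp (-δt * l1 (x - u))) :=
        mul_le_mul h1 h2 (abs_nonneg _) hCw
    _ = Cw * Ct * Real.exp (-δt * l1 (x - u)) := by ring

/-- [folklore] **THE CHAIN-RULE VERTEX OF DRESSED STENCILS IS THE DRESSED CHAIN-RULE VERTEX:**
`vertexOf (fun κ u ↦ dressK N (T κ u)) μ y = dressK N (vertexOf T μ y)` for a local stencil family `T` — the leg dressings act on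
the kernel entry, the `ℋ`-superposition on the stencil index, and the series converge absolutely. -/
theorem vertexOf_dressK {N : ℕ} [NeZero N]
    {T : Fin (d + 1) → (Fin (d + 1) → ℤ) → ExpKernelCalculus.MKer (d + 1) (Fib d)} {Ct δt : ℝ} (hT : LocStencil T Ct δt)
    (hδt : 0 < δt) (μ : Fin (d + 1)) (y : Fin (d + 1) → ℤ) :
    vertexOf (N := N) (fun κ u => dressK N (T κ u)) μ y = dressK N (vertexOf (N := N) T μ y) := by
  have h : ∀ κ' : Fin (d + 1), wsum (fun u => wH (N := N) κ' μ (u - (N : ℤ) • y)) (fun u => dressK N (T κ' u)) =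
      dressK N (wsum (fun u => wH (N := N) κ' μ (u - (N : ℤ) • y)) (T κ')) :=
    fun κ' => (dressK_wsum N (fun x z a b => summable_wH_mul_stencil hT hδt κ' μ y x z a b)).symm
  funext x z a b
  calc vertexOf (N := N) (fun κ u => dressK N (T κ u)) μ y x z a b
      = ∑ κ' : Fin (d + 1), wsum (fun u => wH (N := N) κ' μ (u - (N : ℤ) • y)) (fun u => dressK N (T κ' u)) x z a b := rfl
    _ = ∑ κ' : Fin (d + 1), dressK N (wsum (fun u => wH (N := N) κ' μ (u - (N : ℤ) • y)) (T κ')) x z a b :=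
        Finset.sum_congr rfl fun κ' _ => by rw [h κ']
    _ = dressK N (fun x z a b => ∑ κ' : Fin (d + 1), wsum (fun u => wH (N := N) κ' μ (u - (N : ℤ) • y)) (T κ') x z a b)
          x z a b :=
        (dressK_finset_sum N Finset.univ (fun κ' => wsum (fun u => wH (N := N) κ' μ (u - (N : ℤ) • y)) (T κ')) x z a b).symm
    _ = dressK N (vertexOf (N := N) T μ y) x z a b := rfl

/-- [folklore] **THE `Π`-DRESSED CHAIN-RULE VERTEX** `V^Π μ y := Σ_{κ′} wsum ((Π ℋ-column)(κ′)) (S κ′)`: the UNDRESSED stencils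
superposed with the `Π`-dressed minimiser column `u ↦ (Π ℋ(·; μ, N•y))(κ′, u)` — `ℋ_tree = Π ℋ` (the right-hand side of §7's
`vertexOf_coProj`, now a named kernel). -/
noncomputable def axVertexOf {N : ℕ} [NeZero N]
    (S : Fin (d + 1) → (Fin (d + 1) → ℤ) → ExpKernelCalculus.MKer (d + 1) (Fib d)) (μ : Fin (d + 1))
    (y : Fin (d + 1) → ℤ) : ExpKernelCalculus.MKer (d + 1) (Fib d) :=
  fun x z a b => ∑ κ' : Fin (d + 1), wsum (axProj N (fun κ u => wH (N := N) κ μ (u - (N : ℤ) • y)) κ') (S κ') x z a b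

/-- [folklore] `vertexOf (Πᵀ S) = V^Π` as kernels (§7's `vertexOf_coProj`, all entries). -/
theorem vertexOf_coProj_eq {N : ℕ} [NeZero N]
    {S : Fin (d + 1) → (Fin (d + 1) → ℤ) → ExpKernelCalculus.MKer (d + 1) (Fib d)} {Cs δ : ℝ} (hS : LocStencil S Cs δ)
    (hδ : 0 ≤ δ) (μ : Fin (d + 1)) (y : Fin (d + 1) → ℤ) :
    vertexOf (N := N) (coProj N S) μ y = axVertexOf (N := N) S μ y :=
  funext fun x => funext fun z => funext fun a => funext fun b => vertexOf_coProj hS hδ μ y x z a b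

/-- [folklore] **THE `Π`-DRESSED CHAIN-RULE VERTEX IS A VERTEX FAMILY** (some constant, some rate): through `vertexOf_coProj_eq` and
`locStencil_coProj` it is the chain-rule vertex of a local stencil family. -/
theorem vertexFamily_axVertexOf' {N : ℕ} [NeZero N]
    {S : Fin (d + 1) → (Fin (d + 1) → ℤ) → ExpKernelCalculus.MKer (d + 1) (Fib d)} {Cs δ : ℝ} (hS : LocStencil S Cs δ)
    (hδ : 0 < δ) : ∃ Cv δv : ℝ, 0 < δv ∧ ExpKernelCalculus.VertexFamily (axVertexOf (N := N) S) N Cv δv := by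
  have hN : 1 ≤ N := Nat.one_le_iff_ne_zero.mpr (NeZero.ne N)
  obtain ⟨Cv, δv, hδv, hV⟩ := OneStepResolventKernel.vertexFamily_vertexOf' (N := N) (locStencil_coProj hN hS hδ.le) hδ
  refine ⟨Cv, δv, hδv, fun μ y => ?_⟩
  rw [← vertexOf_coProj_eq hS hδ.le]
  exact hV μ y

/-- [folklore] **THE FIRST-ORDER VERTEX OF THE DRESSED JETS:** `vertexOf (dress J).S μ y = dressK N (V^Π μ y)` — the chain-rule vertex
of the dressed stencil family is the `Πᵀ`-legged `Π`-dressed vertex of the undressed stencils. -/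
theorem vertexOf_dress_S {N : ℕ} [NeZero N] (J : JetData d N) (μ : Fin (d + 1)) (y : Fin (d + 1) → ℤ) :
    vertexOf (N := N) (dress J).S μ y = dressK N (axVertexOf (N := N) J.S μ y) := by
  have hN : 1 ≤ N := Nat.one_le_iff_ne_zero.mpr (NeZero.ne N)
  rw [← vertexOf_coProj_eq J.loc J.δ_pos.le]
  exact vertexOf_dressK (locStencil_coProj hN J.loc J.δ_pos.le) J.δ_pos μ y

end VertexDress

/-! ### §9e THE BUBBLE HALF and the assembled dressing lemma `TOf_dress` -/

section BubbleHalf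

variable {d : ℕ}

/-- [folklore] **THE BUBBLE HALF OF THE DRESSING LEMMA, ON THE WHOLE LATTICE.**  For a decaying kernel `A` (rate `δ > 0`; the resolvent
`KInv`) and bi-localised vertex kernels `V`, `V′` (rate `δv > 0`):
`bubble A (dressK N V) (dressK N V′) = bubble (axDressK N A) V V′`, i.e. `tr (A·ΠᵀVΠᵀ·A·ΠᵀV′Πᵀ) = tr (ΠAΠ·V·ΠAΠ·V′)`.
Chain (no associativity is used): `A ∘ dressK V = legCo₂ (legAx₂ A ∘ V)` (`comp_legCo₂_out`, `comp_legCo₁`), the entrywise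
adjunction `comp_legCo₂` across the middle product, `legAx₁_legCo₂_comm` + `legAx₁_comp` (`Π` lands on the second resolvent:
`axDressK A ∘ V′`), trace cyclicity (`KernelWard.tr_comp_comm_bb`, BY NAME), `comp_legCo₂` + `legAx₁_comp` again, cyclicity back.
Localisation only: `Decays` / `BiLoc`; all rates are first unified to `min δ δv` (`OneStepResolventKernel.decays_mono` / `biLoc_mono`). -/
theorem bubble_dressK {N : ℕ} (hN : 1 ≤ N) {A V V' : ExpKernelCalculus.MKer (d + 1) (Fib d)} {C δ Cv Cv' δv : ℝ}
    {p p' q q' : Fin (d + 1) → ℤ} (hA : Decays A C δ) (hδ : 0 < δ) (hV : BiLoc V p p' Cv δv) (hV' : BiLoc V' q q' Cv' δv)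
    (hδv : 0 < δv) :
    ExpKernelCalculus.bubble A (dressK N V) (dressK N V') = ExpKernelCalculus.bubble (axDressK N A) V V' := by
  -- one rate for everything
  have hm0 : 0 < min δ δv := lt_min hδ hδv
  have hm2 : 0 < min δ δv / 2 := half_pos hm0
  have hC : 0 ≤ C := hA.nonneg (Sum.inl 0)
  have hCv : 0 ≤ Cv := hV.nonneg (Sum.inl 0)
  have hCv' : 0 ≤ Cv' := hV'.nonneg (Sum.inl 0)
  have hAm : Decays A C (min δ δv) := OneStepResolventKernel.decays_mono hA hC le_rfl (min_le_left _ _)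
  have hVm : BiLoc V p p' Cv (min δ δv) := OneStepResolventKernel.biLoc_mono hV hCv (min_le_right _ _)
  have hV'm : BiLoc V' q q' Cv' (min δ δv) := OneStepResolventKernel.biLoc_mono hV' hCv' (min_le_right _ _)
  -- the `Π`-legged resolvents decay
  have hA₂ : Decays (legAx₂ N A) (cAx d N (min δ δv) * C) (min δ δv) := decays_legAx₂ hN hAm hm0.le
  have hAA : Decays (axDressK N A) (cAx d N (min δ δv) * (cAx d N (min δ δv) * C)) (min δ δv) := decays_axDressK hN hAm hm0.le
  have hBV : Bdd V Cv := bdd_of_biLoc hVm hm0.le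
  have hBV' : Bdd V' Cv' := bdd_of_biLoc hV'm hm0.le
  -- the four composites, bi-localised at rate `m/2`
  have hX := ExpKernelCalculus.biLoc_comp_decays hA₂ hVm hm2.le (half_lt_self hm0)
  have hX' := ExpKernelCalculus.biLoc_comp_decays hA₂ hV'm hm2.le (half_lt_self hm0)
  have hZ := ExpKernelCalculus.biLoc_comp_decays hAA hV'm hm2.le (half_lt_self hm0)
  have hY := ExpKernelCalculus.biLoc_comp_decays hAA hVm hm2.le (half_lt_self hm0)
  have hX'₂ := biLoc_legCo₂ hN hX' hm2.le
  have hZ₂ := biLoc_legCo₂ hN hZ hm2.le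
  have hBX := bdd_of_biLoc hX hm2.le
  have hBZ := bdd_of_biLoc hZ hm2.le
  -- e1: `A ∘ dressK W = legCo₂ (legAx₂ A ∘ W)` for any bi-localised `W`
  have e1 : ∀ {W : ExpKernelCalculus.MKer (d + 1) (Fib d)} {Cw : ℝ} {s s' : Fin (d + 1) → ℤ}, BiLoc W s s' Cw (min δ δv) →
      ExpKernelCalculus.comp A (dressK N W) = legCo₂ N (ExpKernelCalculus.comp (legAx₂ N A) W) := by
    intro W Cw s s' hW
    have hBW : Bdd W Cw := bdd_of_biLoc hW hm0.le
    have hB1 : Bdd (legCo₁ N W) (cN d N (min δ δv) * Cw) := bdd_of_biLoc (biLoc_legCo₁ hN hW hm0.le) hm0.le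
    have hs : ∀ x z a b, Summable fun y => ∑ f : Fib d, A x y a f * legCo₁ N W y z f b := fun x z a b =>
      summable_sum fun f _ => summable_mul_of_bdd' (summable_row_of_decays hAm hm0 x a f) (fun y => hB1 y z f b)
    have hin : ExpKernelCalculus.comp A (legCo₁ N W) = ExpKernelCalculus.comp (legAx₂ N A) W :=
      funext fun x => funext fun z => funext fun a => funext fun b =>
        comp_legCo₁ hN (fun f => summable_row_of_decays hAm hm0 x a f) (fun y f => hBW y z f b)
    show ExpKernelCalculus.comp A (legCo₂ N (legCo₁ N W)) = _
    rw [comp_legCo₂_out N hs, hin]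
  -- e2: the middle adjunction, entry by entry under the trace
  have e2 : ExpKernelCalculus.tr (ExpKernelCalculus.comp (legCo₂ N (ExpKernelCalculus.comp (legAx₂ N A) V))
        (legCo₂ N (ExpKernelCalculus.comp (legAx₂ N A) V'))) =
      ExpKernelCalculus.tr (ExpKernelCalculus.comp (ExpKernelCalculus.comp (legAx₂ N A) V)
        (legAx₁ N (legCo₂ N (ExpKernelCalculus.comp (legAx₂ N A) V')))) := by
    show (∑' x, ∑ a : Fib d, ExpKernelCalculus.comp (legCo₂ N (ExpKernelCalculus.comp (legAx₂ N A) V))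
        (legCo₂ N (ExpKernelCalculus.comp (legAx₂ N A) V')) x x a a) =
      ∑' x, ∑ a : Fib d, ExpKernelCalculus.comp (ExpKernelCalculus.comp (legAx₂ N A) V)
        (legAx₁ N (legCo₂ N (ExpKernelCalculus.comp (legAx₂ N A) V'))) x x a a
    refine tsum_congr fun x => Finset.sum_congr rfl fun a _ => ?_
    exact comp_legCo₂ hN (fun y f => hBX x y a f) (fun f => summable_col_of_biLoc hX'₂ hm2 x f a)
  -- e3: `Π` on the first leg of `legCo₂ X'` lands on the second resolvent
  have e3 : legAx₁ N (legCo₂ N (ExpKernelCalculus.comp (legAx₂ N A) V')) =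
      legCo₂ N (ExpKernelCalculus.comp (axDressK N A) V') := by
    have hs : ∀ x z a b, Summable fun y => ∑ f : Fib d, legAx₂ N A x y a f * V' y z f b := fun x z a b =>
      summable_sum fun f _ => summable_mul_of_bdd' (summable_row_of_decays hA₂ hm0 x a f) (fun y => hBV' y z f b)
    rw [legAx₁_legCo₂_comm, legAx₁_comp hN hs]
    rfl
  -- e4: cyclicity
  have e4 : ExpKernelCalculus.tr (ExpKernelCalculus.comp (ExpKernelCalculus.comp (legAx₂ N A) V)
        (legCo₂ N (ExpKernelCalculus.comp (axDressK N A) V'))) =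
      ExpKernelCalculus.tr (ExpKernelCalculus.comp (legCo₂ N (ExpKernelCalculus.comp (axDressK N A) V'))
        (ExpKernelCalculus.comp (legAx₂ N A) V)) :=
    KernelWard.tr_comp_comm_bb hX hZ₂ hm2
  -- e5: the second adjunction, entry by entry under the trace
  have e5 : ExpKernelCalculus.tr (ExpKernelCalculus.comp (legCo₂ N (ExpKernelCalculus.comp (axDressK N A) V'))
        (ExpKernelCalculus.comp (legAx₂ N A) V)) =
      ExpKernelCalculus.tr (ExpKernelCalculus.comp (ExpKernelCalculus.comp (axDressK N A) V')
        (legAx₁ N (ExpKernelCalculus.comp (legAx₂ N A) V))) := by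
    show (∑' x, ∑ a : Fib d, ExpKernelCalculus.comp (legCo₂ N (ExpKernelCalculus.comp (axDressK N A) V'))
        (ExpKernelCalculus.comp (legAx₂ N A) V) x x a a) =
      ∑' x, ∑ a : Fib d, ExpKernelCalculus.comp (ExpKernelCalculus.comp (axDressK N A) V')
        (legAx₁ N (ExpKernelCalculus.comp (legAx₂ N A) V)) x x a a
    refine tsum_congr fun x => Finset.sum_congr rfl fun a _ => ?_
    exact comp_legCo₂ hN (fun y f => hBZ x y a f) (fun f => summable_col_of_biLoc hX hm2 x f a)
  -- e6: `Π` on the first leg of `X` lands on the first resolvent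
  have e6 : legAx₁ N (ExpKernelCalculus.comp (legAx₂ N A) V) = ExpKernelCalculus.comp (axDressK N A) V := by
    have hs : ∀ x z a b, Summable fun y => ∑ f : Fib d, legAx₂ N A x y a f * V y z f b := fun x z a b =>
      summable_sum fun f _ => summable_mul_of_bdd' (summable_row_of_decays hA₂ hm0 x a f) (fun y => hBV y z f b)
    rw [legAx₁_comp hN hs]
    rfl
  -- e7: cyclicity back
  have e7 : ExpKernelCalculus.tr (ExpKernelCalculus.comp (ExpKernelCalculus.comp (axDressK N A) V')
        (ExpKernelCalculus.comp (axDressK N A) V)) =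
      ExpKernelCalculus.tr (ExpKernelCalculus.comp (ExpKernelCalculus.comp (axDressK N A) V)
        (ExpKernelCalculus.comp (axDressK N A) V')) :=
    KernelWard.tr_comp_comm_bb hZ hY hm2
  show ExpKernelCalculus.tr (ExpKernelCalculus.comp (ExpKernelCalculus.comp A (dressK N V))
      (ExpKernelCalculus.comp A (dressK N V'))) =
    ExpKernelCalculus.tr (ExpKernelCalculus.comp (ExpKernelCalculus.comp (axDressK N A) V)
      (ExpKernelCalculus.comp (axDressK N A) V'))
  rw [e1 hVm, e1 hV'm, e2, e3, e4, e5, e6, e7]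

/-- [folklore] **THE DRESSING LEMMA, ASSEMBLED (route (α), RULING (R29-5)).**  The typed kernel of the DRESSED jets is the resolvent
Hessian kernel of the `Π`-CONJUGATED weak-Landau resolvent with the UNDRESSED second-order jets and the `Π`-DRESSED chain-rule vertex
of the UNDRESSED stencils (`ℋ_tree = Π ℋ`):
`TOf (dress J) = hessKer (axDressK N KInv) (axVertexOf J.S) J.W`
(`hessKer A V W μ ν z = ½·tadpole A (W μ 0 ν z) − ½·bubble A (V μ 0) (V ν z)`; tadpole half `tadpole_dress_W` (§8), bubble half
`bubble_dressK` with `vertexOf_dress_S`; `OneStepResolventKernel.decays_KInv`, `J.loc`, `J.loc₂`, nothing else). -/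
theorem TOf_dress {N : ℕ} [NeZero N] (J : JetData d N) :
    TOf (N := N) (dress J) =
      ExpKernelCalculus.hessKer (axDressK N (KInv (N := N) (d := d))) (axVertexOf (N := N) J.S) J.W := by
  have hN : 1 ≤ N := Nat.one_le_iff_ne_zero.mpr (NeZero.ne N)
  obtain ⟨δ, C, hδ, -, hA⟩ := decays_KInv (N := N) (d := d)
  obtain ⟨Cv, δv, hδv, hV⟩ := vertexFamily_axVertexOf' (N := N) J.loc J.δ_pos
  funext μ ν z
  show (1 / 2) * ExpKernelCalculus.tadpole (KInv (N := N) (d := d)) ((dress J).W μ 0 ν z) -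
      (1 / 2) * ExpKernelCalculus.bubble (KInv (N := N) (d := d)) (vertexOf (N := N) (dress J).S μ 0)
        (vertexOf (N := N) (dress J).S ν z) =
    (1 / 2) * ExpKernelCalculus.tadpole (axDressK N (KInv (N := N) (d := d))) (J.W μ 0 ν z) -
      (1 / 2) * ExpKernelCalculus.bubble (axDressK N (KInv (N := N) (d := d))) (axVertexOf (N := N) J.S μ 0)
        (axVertexOf (N := N) J.S ν z)
  rw [tadpole_dress_W, vertexOf_dress_S, vertexOf_dress_S, bubble_dressK hN hA hδ (hV μ 0) (hV ν z) hδv]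

/-- [folklore] The same statement with the first-order vertex written as `vertexOf (Πᵀ J.S)` (§7's bond-slot form):
`TOf (dress J) = hessKer (axDressK N KInv) (vertexOf (coProj N J.S)) J.W`. -/
theorem TOf_dress' {N : ℕ} [NeZero N] (J : JetData d N) :
    TOf (N := N) (dress J) =
      ExpKernelCalculus.hessKer (axDressK N (KInv (N := N) (d := d))) (vertexOf (N := N) (coProj N J.S)) J.W := by
  have e : vertexOf (N := N) (coProj N J.S) = axVertexOf (N := N) J.S :=
    funext fun μ => funext fun y => vertexOf_coProj_eq J.loc J.δ_pos.le μ y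
  rw [TOf_dress, e]

/-- [folklore] `TdressOf J` (§5, the route-(α) completed typed kernel) in closed form. -/
theorem TdressOf_eq_hessKer {N : ℕ} [NeZero N] (J : JetData d N) :
    TdressOf J = ExpKernelCalculus.hessKer (axDressK N (KInv (N := N) (d := d))) (axVertexOf (N := N) J.S) J.W :=
  TOf_dress J

end BubbleHalf

/-! ## §10 (v1.4) The dressing lemma for the STEP kernels: `TstepOf Lc j (dress J)` over the DECIMATED composite resolvent
`OneStepKernelFamily.KInvStep Lc j` and the chain-rule vertex through ITS `ℋ`-column (`OneStepKernelFamily.vertexOfK`) — the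
`vertexOfK`-twins of §9d for an ARBITRARY decaying kernel `K` in the weights, the generic-`A` assembled statement `hessKer_dress`, and
the corollaries `TstepOf_dress`, `TbalOf_dress` (every `j`).  §9's `TOf_dress` is the instance `K = KInv N` (`vertexOfK_KInv`). -/

section StepDress

variable {d : ℕ}

/-- [folklore] The `ℋ`-column of a decaying kernel against a local stencil family gives pointwise-convergent superposition series
(the weights are bounded by the kernel's constant; the stencil decays from its own index). -/
theorem summable_colH_mul_stencil {N : ℕ} {K : ExpKernelCalculus.MKer (d + 1) (Fib d)} {C δ : ℝ} (hK : Decays K C δ) (hδ : 0 ≤ δ)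
    {T : Fin (d + 1) → (Fin (d + 1) → ℤ) → ExpKernelCalculus.MKer (d + 1) (Fib d)} {Ct δt : ℝ} (hT : LocStencil T Ct δt)
    (hδt : 0 < δt) (κ μ : Fin (d + 1)) (y x z : Fin (d + 1) → ℤ) (a b : Fib d) :
    Summable fun u => colH K N μ y κ u * T κ u x z a b := by
  have hC : 0 ≤ C := hK.nonneg (Sum.inl 0)
  have hCt : 0 ≤ Ct := (hT κ 0).nonneg (Sum.inl 0)
  refine Summable.of_norm_bounded ((summable_exp_shift hδt x).mul_left (C * Ct)) (fun u => ?_)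
  rw [Real.norm_eq_abs, abs_mul]
  have h1 : |colH K N μ y κ u| ≤ C := by
    have he : Real.exp (-δ * l1 (u - (N : ℤ) • y)) ≤ 1 := by
      rw [Real.exp_le_one_iff]
      nlinarith [l1_nonneg (u - (N : ℤ) • y), hδ]
    calc |colH K N μ y κ u| ≤ C * Real.exp (-δ * l1 (u - (N : ℤ) • y)) := abs_colH_le hK μ y κ u
      _ ≤ C * 1 := mul_le_mul_of_nonneg_left he hC
      _ = C := mul_one _
  have h2 : |T κ u x z a b| ≤ Ct * Real.exp (-δt * l1 (x - u)) := by
    refine (hT κ u x z a b).trans (mul_le_mul_of_nonneg_left (Real.exp_le_exp.2 ?_) hCt)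
    nlinarith [l1_nonneg (z - u), hδt.le]
  calc |colH K N μ y κ u| * |T κ u x z a b| ≤ C * (Ct * Real.exp (-δt * l1 (x - u))) :=
        mul_le_mul h1 h2 (abs_nonneg _) hC
    _ = C * Ct * Real.exp (-δt * l1 (x - u)) := by ring

/-- [folklore] **THE CHAIN-RULE VERTEX THROUGH `K` OF DRESSED STENCILS IS THE DRESSED VERTEX:**
`vertexOfK K N (fun κ u ↦ dressK N (T κ u)) μ y = dressK N (vertexOfK K N T μ y)` for a decaying `K` and a local stencil family `T`
(§9d's `vertexOf_dressK` with the weights `colH K` in place of the `wH`-column). -/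
theorem vertexOfK_dressK {N : ℕ} {K : ExpKernelCalculus.MKer (d + 1) (Fib d)} {C δ : ℝ} (hK : Decays K C δ) (hδ : 0 ≤ δ)
    {T : Fin (d + 1) → (Fin (d + 1) → ℤ) → ExpKernelCalculus.MKer (d + 1) (Fib d)} {Ct δt : ℝ} (hT : LocStencil T Ct δt)
    (hδt : 0 < δt) (μ : Fin (d + 1)) (y : Fin (d + 1) → ℤ) :
    vertexOfK K N (fun κ u => dressK N (T κ u)) μ y = dressK N (vertexOfK K N T μ y) := by
  have h : ∀ κ' : Fin (d + 1), wsum (colH K N μ y κ') (fun u => dressK N (T κ' u)) =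
      dressK N (wsum (colH K N μ y κ') (T κ')) :=
    fun κ' => (dressK_wsum N (fun x z a b => summable_colH_mul_stencil hK hδ hT hδt κ' μ y x z a b)).symm
  funext x z a b
  calc vertexOfK K N (fun κ u => dressK N (T κ u)) μ y x z a b
      = ∑ κ' : Fin (d + 1), wsum (colH K N μ y κ') (fun u => dressK N (T κ' u)) x z a b := rfl
    _ = ∑ κ' : Fin (d + 1), dressK N (wsum (colH K N μ y κ') (T κ')) x z a b :=
        Finset.sum_congr rfl fun κ' _ => by rw [h κ']
    _ = dressK N (fun x z a b => ∑ κ' : Fin (d + 1), wsum (colH K N μ y κ') (T κ') x z a b) x z a b :=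
        (dressK_finset_sum N Finset.univ (fun κ' => wsum (colH K N μ y κ') (T κ')) x z a b).symm
    _ = dressK N (vertexOfK K N T μ y) x z a b := rfl

/-- [folklore] **THE `Π`-DRESSED CHAIN-RULE VERTEX THROUGH `K`** `V^Π_K μ y := Σ_{κ′} wsum ((Π colH K N μ y)(κ′)) (S κ′)`: the UNDRESSED
stencils superposed with the `Π`-dressed `ℋ`-column of `K` (for `K = KInv N` this is §9d's `axVertexOf`, `axVertexOfK_KInv`). -/
noncomputable def axVertexOfK (K : ExpKernelCalculus.MKer (d + 1) (Fib d)) (N : ℕ)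
    (S : Fin (d + 1) → (Fin (d + 1) → ℤ) → ExpKernelCalculus.MKer (d + 1) (Fib d)) (μ : Fin (d + 1))
    (y : Fin (d + 1) → ℤ) : ExpKernelCalculus.MKer (d + 1) (Fib d) :=
  fun x z a b => ∑ κ' : Fin (d + 1), wsum (axProj N (colH K N μ y) κ') (S κ') x z a b

/-- [folklore] For the one-step resolvent the `K`-form is §9d's `axVertexOf` (`OneStepResolventKernel.vertexOf_weight`: the `ℋ`-column of
`KInv N` at the coarse bond `(μ, y)` is `u ↦ wH κ′ μ (u − N•y)`). -/
theorem axVertexOfK_KInv {N : ℕ} [NeZero N] (S : Fin (d + 1) → (Fin (d + 1) → ℤ) → ExpKernelCalculus.MKer (d + 1) (Fib d))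
    (μ : Fin (d + 1)) (y : Fin (d + 1) → ℤ) : axVertexOfK (KInv (N := N) (d := d)) N S μ y = axVertexOf (N := N) S μ y := by
  have hw : colH (KInv (N := N) (d := d)) N μ y = fun κ u => wH (N := N) κ μ (u - (N : ℤ) • y) :=
    funext fun κ => funext fun u => (OneStepResolventKernel.vertexOf_weight (N := N) κ μ u y).symm
  funext x z a b
  simp only [axVertexOfK, axVertexOf, hw]

/-- [folklore] **THE BOND-SLOT ADJUNCTION THROUGH `K`** (§7's `vertexOf_coProj` with the summable side the `ℋ`-column of a decaying `K`,
`summable_col_of_decays`): `vertexOfK K N (Πᵀ S) μ y = V^Π_K μ y` entrywise. -/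
theorem vertexOfK_coProj {N : ℕ} (hN : 1 ≤ N) {K : ExpKernelCalculus.MKer (d + 1) (Fib d)} {C δ : ℝ} (hK : Decays K C δ)
    (hδK : 0 < δ) {S : Fin (d + 1) → (Fin (d + 1) → ℤ) → ExpKernelCalculus.MKer (d + 1) (Fib d)} {Cs δs : ℝ}
    (hS : LocStencil S Cs δs) (hδs : 0 ≤ δs) (μ : Fin (d + 1)) (y x z : Fin (d + 1) → ℤ) (a b : Fib d) :
    vertexOfK K N (coProj N S) μ y x z a b = ∑ κ' : Fin (d + 1), wsum (axProj N (colH K N μ y) κ') (S κ') x z a b := by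
  -- the `ℋ`-column of `K` is summable (a column of a decaying kernel)
  have hA : ∀ κ : Fin (d + 1), Summable (colH K N μ y κ) :=
    fun κ => summable_col_of_decays hK hδK ((N : ℤ) • y) (Sum.inl κ) (Sum.inr μ)
  -- the stencil entries are bounded by `Cs`
  have hg : ∀ (κ : Fin (d + 1)) (u : Fin (d + 1) → ℤ), |(fun κ u => S κ u x z a b) κ u| ≤ Cs := by
    intro κ u
    have h := hS κ u x z a b
    have hCs : 0 ≤ Cs := (hS κ u).nonneg (Sum.inl 0)
    have he : Real.exp (-δs * (l1 (x - u) + l1 (z - u))) ≤ 1 := by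
      rw [Real.exp_le_one_iff]
      have := l1_nonneg (x - u)
      have := l1_nonneg (z - u)
      nlinarith
    calc |S κ u x z a b| ≤ Cs * Real.exp (-δs * (l1 (x - u) + l1 (z - u))) := h
      _ ≤ Cs * 1 := mul_le_mul_of_nonneg_left he hCs
      _ = Cs := mul_one _
  have e1 : vertexOfK K N (coProj N S) μ y x z a b =
      ∑ κ' : Fin (d + 1), ∑' u, colH K N μ y κ' u * coProj N (fun κ u => S κ u x z a b) κ' u := by
    show (∑ κ' : Fin (d + 1), ∑' u, colH K N μ y κ' u * coProj N S κ' u x z a b) = _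
    refine Finset.sum_congr rfl fun κ' _ => tsum_congr fun u => ?_
    rw [coProj_eval]
  rw [e1, sum_tsum_mul_coProj hN hA hg]
  rfl

/-- [folklore] `vertexOfK K N (Πᵀ S) = V^Π_K` as kernels. -/
theorem vertexOfK_coProj_eq {N : ℕ} (hN : 1 ≤ N) {K : ExpKernelCalculus.MKer (d + 1) (Fib d)} {C δ : ℝ} (hK : Decays K C δ)
    (hδK : 0 < δ) {S : Fin (d + 1) → (Fin (d + 1) → ℤ) → ExpKernelCalculus.MKer (d + 1) (Fib d)} {Cs δs : ℝ}
    (hS : LocStencil S Cs δs) (hδs : 0 ≤ δs) (μ : Fin (d + 1)) (y : Fin (d + 1) → ℤ) :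
    vertexOfK K N (coProj N S) μ y = axVertexOfK K N S μ y :=
  funext fun x => funext fun z => funext fun a => funext fun b => vertexOfK_coProj hN hK hδK hS hδs μ y x z a b

/-- [folklore] **`V^Π_K` IS A VERTEX FAMILY** (some constant, some rate): through `vertexOfK_coProj_eq` and `locStencil_coProj` it is the
chain-rule vertex through `K` of a local stencil family (`OneStepKernelFamily.vertexFamily_vertexOfK'`). -/
theorem vertexFamily_axVertexOfK' {N : ℕ} [NeZero N] {K : ExpKernelCalculus.MKer (d + 1) (Fib d)}
    (hK : ∃ δ C : ℝ, 0 < δ ∧ 0 ≤ C ∧ Decays K C δ)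
    {S : Fin (d + 1) → (Fin (d + 1) → ℤ) → ExpKernelCalculus.MKer (d + 1) (Fib d)} {Cs δs : ℝ} (hS : LocStencil S Cs δs)
    (hδs : 0 < δs) : ∃ Cv δv : ℝ, 0 < δv ∧ ExpKernelCalculus.VertexFamily (axVertexOfK K N S) N Cv δv := by
  have hN : 1 ≤ N := Nat.one_le_iff_ne_zero.mpr (NeZero.ne N)
  obtain ⟨δ, C, hδ, -, hK'⟩ := hK
  obtain ⟨Cv, δv, hδv, hV⟩ := vertexFamily_vertexOfK' (N := N) ⟨δ, C, hδ, hK'.nonneg (Sum.inl 0), hK'⟩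
    (locStencil_coProj hN hS hδs.le) hδs
  refine ⟨Cv, δv, hδv, fun μ y => ?_⟩
  rw [← vertexOfK_coProj_eq hN hK' hδ hS hδs.le]
  exact hV μ y

/-- [folklore] **THE FIRST-ORDER VERTEX THROUGH `K` OF THE DRESSED JETS:** `vertexOfK K N (dress J).S μ y = dressK N (V^Π_K μ y)`. -/
theorem vertexOfK_dress_S {N : ℕ} [NeZero N] {K : ExpKernelCalculus.MKer (d + 1) (Fib d)} {C δ : ℝ} (hK : Decays K C δ)
    (hδ : 0 < δ) (J : JetData d N) (μ : Fin (d + 1)) (y : Fin (d + 1) → ℤ) :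
    vertexOfK K N (dress J).S μ y = dressK N (axVertexOfK K N J.S μ y) := by
  have hN : 1 ≤ N := Nat.one_le_iff_ne_zero.mpr (NeZero.ne N)
  rw [← vertexOfK_coProj_eq hN hK hδ J.loc J.δ_pos.le]
  exact vertexOfK_dressK hK hδ.le (locStencil_coProj hN J.loc J.δ_pos.le) J.δ_pos μ y

/-- [folklore] **THE DRESSING LEMMA OVER AN ARBITRARY DECAYING RESOLVENT `K`.**  For every `K` with `Decays K C δ`, `δ > 0`, and every
jet datum `J`:
`hessKer K (vertexOfK K N (dress J).S) (dress J).W = hessKer (axDressK N K) (axVertexOfK K N J.S) J.W`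
— the resolvent Hessian kernel over `K` of the DRESSED jets is the one over the `Π`-CONJUGATED `K` (`axDressK N K = Π K Π` on the
field legs) with the UNDRESSED second-order tables and the `Π`-dressed chain-rule vertex through `K` of the UNDRESSED stencils
(`ℋ_tree = Π ℋ_K`).  Halves: `tadpole_dressK` (§8), `bubble_dressK` (§9e), both stated for generic `A`; vertex form `vertexOfK_dress_S`;
localisation only (`J.loc`, `J.loc₂`, the decay of `K`). -/
theorem hessKer_dress {N : ℕ} [NeZero N] {K : ExpKernelCalculus.MKer (d + 1) (Fib d)} {C δ : ℝ} (hK : Decays K C δ)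
    (hδ : 0 < δ) (J : JetData d N) :
    ExpKernelCalculus.hessKer K (vertexOfK K N (dress J).S) (dress J).W =
      ExpKernelCalculus.hessKer (axDressK N K) (axVertexOfK K N J.S) J.W := by
  have hN : 1 ≤ N := Nat.one_le_iff_ne_zero.mpr (NeZero.ne N)
  obtain ⟨Cv, δv, hδv, hV⟩ := vertexFamily_axVertexOfK' (N := N) ⟨δ, C, hδ, hK.nonneg (Sum.inl 0), hK⟩ J.loc J.δ_pos
  funext μ ν z
  show (1 / 2) * ExpKernelCalculus.tadpole K ((dress J).W μ 0 ν z) -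
      (1 / 2) * ExpKernelCalculus.bubble K (vertexOfK K N (dress J).S μ 0) (vertexOfK K N (dress J).S ν z) =
    (1 / 2) * ExpKernelCalculus.tadpole (axDressK N K) (J.W μ 0 ν z) -
      (1 / 2) * ExpKernelCalculus.bubble (axDressK N K) (axVertexOfK K N J.S μ 0) (axVertexOfK K N J.S ν z)
  rw [dress_W, tadpole_dressK hN hK hδ (J.loc₂ μ 0 ν z) J.δ_pos, vertexOfK_dress_S hK hδ, vertexOfK_dress_S hK hδ,
    bubble_dressK hN hK hδ (hV μ 0) (hV ν z) hδv]

/-- [folklore] **THE DRESSING LEMMA FOR THE STEP KERNELS (every step `j`).**  The typed step-`j` kernel of the dressed jets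
(`OneStepKernelFamily.TstepOf`: the DECIMATED composite resolvent `KInvStep Lc j = dec (Lc^j) (KInv (Lc^(j+1)))` and the chain-rule vertex
through ITS `ℋ`-column) is
`TstepOf Lc j (dress J) = hessKer (axDressK Lc (KInvStep Lc j)) (axVertexOfK (KInvStep Lc j) Lc J.S) J.W`
— `hessKer_dress` at `K := KInvStep Lc j` (`OneStepKernelFamily.decays_KInvStep`). -/
theorem TstepOf_dress {Lc : ℕ} [NeZero Lc] (j : ℕ) (J : JetData d Lc) :
    TstepOf Lc j (dress J) =
      ExpKernelCalculus.hessKer (axDressK Lc (KInvStep (d := d) Lc j)) (axVertexOfK (KInvStep (d := d) Lc j) Lc J.S) J.W := by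
  obtain ⟨δ, C, hδ, -, hK⟩ := decays_KInvStep (d := d) (Lc := Lc) j
  exact hessKer_dress hK hδ J

/-- [folklore] **THE WALL'S KERNELS IN CLOSED FORM (every `j`).**  For ANY family of step jet data `Js : ℕ → JetData 3 Lc`, the one-step
kernel family of the DRESSED family `fun j ↦ dress (Js j)` (route (α): `JsBal N Lc := fun j ↦ dress (JsBal⁰ N Lc j)`) reads, member by
member, `TbalOf Lc (fun j ↦ dress (Js j)) j = hessKer (axDressK Lc (KInvStep Lc j)) (axVertexOfK (KInvStep Lc j) Lc (Js j).S) (Js j).W`. -/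
theorem TbalOf_dress {Lc : ℕ} [NeZero Lc] (Js : ℕ → JetData 3 Lc) (j : ℕ) :
    TbalOf Lc (fun j => dress (Js j)) j =
      ExpKernelCalculus.hessKer (axDressK Lc (KInvStep (d := 3) Lc j)) (axVertexOfK (KInvStep (d := 3) Lc j) Lc (Js j).S)
        (Js j).W :=
  TstepOf_dress j (Js j)

/-- [folklore] Consistency with §9: at `K = KInv N` the generic statement is `TOf_dress` (`vertexOfK_KInv`, `axVertexOfK_KInv`). -/
theorem hessKer_dress_KInv {N : ℕ} [NeZero N] (J : JetData d N) :
    ExpKernelCalculus.hessKer (KInv (N := N) (d := d)) (vertexOfK (KInv (N := N) (d := d)) N (dress J).S) (dress J).W =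
      ExpKernelCalculus.hessKer (axDressK N (KInv (N := N) (d := d))) (axVertexOf (N := N) J.S) J.W := by
  obtain ⟨δ, C, hδ, -, hK⟩ := decays_KInv (N := N) (d := d)
  have e : axVertexOfK (KInv (N := N) (d := d)) N J.S = axVertexOf (N := N) J.S :=
    funext fun μ => funext fun y => axVertexOfK_KInv J.S μ y
  rw [hessKer_dress hK hδ J, e]

end StepDress

end Literature.MathematicalPhysics.QuantumFieldTheory.Balaban1983to89.Beta.AxialDressing
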